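import Summits.Ventures.CertifiedManyBodySolver.Theses.TcThermcert1
import Literature.MathematicalPhysics.QuantumLattice.HubbardNNNHoppingFluxThermal
import Literature.Algebra.Lie.SelfAdjointHullPolar
import Literature.MathematicalPhysics.QuantumLattice.HubbardGaugeBound
import Literature.MathematicalPhysics.QuantumLattice.FermionLiebRobinson
import Summits.HubbardSuperconductivity.HubbardSuperconductivity.Theorems.WeakCouplingBCSWcbcsBcsConstructionHamiltonianNormBound
import Literature.Analysis.Complex.BorelCaratheodoryDeriv
import Literature.Analysis.Complex.HolomorphicLogarithm
import Summits.Ventures.CertifiedManyBodySolver.Theorems.TcThermcert1FugacityProjection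
import Summits.Ventures.CertifiedManyBodySolver.Theorems.TcThermcert1SaddleBoxLowerBound
import Summits.Ventures.CertifiedManyBodySolver.Theorems.TcThermcert1SaddleGeometry
import Summits.Ventures.CertifiedManyBodySolver.Theorems.TcThermcert1GcHighTemperature
import Mathlib
import HarnessLib

/-!
# Line `zerofree_corridor_b8` on K1′ = `TcThermcert1.ThermalStiffnessCeilingU8b8_le_7o44` (stmt-Ventures-24560) — CHECKED SKELETON (v10-b8)

THIS FILE = line `zerofree_corridor` v10 of the PARENT crux K1 (stmt-Ventures-26381, `Lines/zerofree_corridor.lean`) RE-ANCHORED at `β₁·t = 8`: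
byte-identical §A–§N except that the β₁·t = 10 stub `stub_zeroFreeCold` and the K1 compositions that consume it (`zeroFreeStrip_of_stubs`,
`ThermalStiffnessCeilingU8b10_le_1o8_of_stubs`) are removed, and the ONE sorried stub is `stub_zeroFreeCold8` (the β₁·t = 8 cold family) with the
skeleton theorem `ThermalStiffnessCeilingU8b8_le_7o44_of_stubs8 : TcThermcert1.ThermalStiffnessCeilingU8b8_le_7o44` (§N). Written by the floor
idea-rescuer g10 (write-crux stmt-Ventures-26381) for registration by a seat keyed to stmt-Ventures-24560:
`ledger skeleton check <this path> --crux stmt-Ventures-24560` (director-hubbard I2165; hub-tc-therm-plan-1 g2 SPLIT-K1-b8.md). The hypothesis-form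
compositions `…_of`, `…_of5` (conclusion `K1Crux`) are kept as documentation of the parent line.

Idea `Ideas/zero-free-corridor.md` (idea-1 of CENSUS-TcThermcert1-R159, trigger (β)); planner hubbard-floor-idea-rescuer g6 (BN-resc-6).
Route decl concluded BY NAME: `ThermalStiffnessCeilingU8b10_le_1o8_of_stubs : TcThermcert1.ThermalStiffnessCeilingU8b10_le_1o8` (§K; no hypotheses, applies
`…_of5 : transfer → data → K1 → K2 → K3 → Z_cold → K1Crux` to the declared stubs; `…_of : stub₁ → stub₂ → stub₃ → K1Crux` is the v4 shape; `K1Crux` is the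
reducible alias of the route decl, v7 — see §G).

THE LINE. `g_L(β,θ) := log Z_L(β,0) − log Z_L(β,θ)` (canonical `(N_L,S^z=0)` sector of the seam-flux `t–t′` torus, `δ = 1/8`) is the flux
cost whose quadratic lower bound `10 ρ_s θ² ≤ g_L(10,θ)` is K1's premise. Two facts and one bet:
* FLUX-BLINDNESS (§A–§C, PROVED here, 0 sorry): `tr_p H_L(θ)^k = tr_p H_L(0)^k` for every `k < L` (every sector `p`, every `t′, U`,
  every `L ≥ 3`): a closed walk of fewer than `L` hops cannot wind the torus. Hence (§D–§E, PROVED) `β ↦ Z_L(β,θ) − Z_L(β,0)` vanishes to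
  order `L` at `β = 0`.
* CORRIDOR TRANSFER (`stub_corridorTransfer`, PROVED in v4 from §J = the landed helpers `Theorems/TcThermcert1CorridorTransferDiscs.lean` +
  `Theorems/TcThermcert1CorridorTransfer.lean`, inlined): two functions analytic, zero-free and of size `e^{±M}` on a corridor around `[0,b]`
  which agree to order `L` at `0` have `|log f(b) − log g(b)| ≤ C (M+1) r^L`, `r < 1` (holomorphic logs on the convex corridor, one-sided
  Borel–Carathéodory coefficient bounds at real centres, a split-Taylor two-radii chain of `⌈8b/η⌉` discs; `C = 48·5^n`, `r = 2^{−2^{−n}}`).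
* A-PRIORI DATA (`stub_corridorData`, PROVED in v3 from §I = the landed `Theorems/TcThermcert1SectorPartitionFnBounds.lean`, inlined): `Z_L(·,θ)` is entire,
  `|Z_L| ≤ e^{2L²} e^{|Re β|·Λ_L}`, `Z_L(x) ≥ e^{−|x|·Λ_L}` real on the axis, `Λ_L = (18 + 10|U| + 26|t′|) L²` ⇒ corridor data with `M = A L²`.
* HYPOTHESIS Z (`stub_zeroFreeStrip`, THE BET): an `L`-uniform zero-free corridor of `β ↦ Z_L(β,θ)` around `[0,10]` for `|θ| ≤ θ₁` at the
  anchor `(t′,U,n) = (0,8,7/8)` — no Fisher zero of the twisted canonical family reaches the temperature segment `T ≥ t/10`.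
Then `|g_L(10,θ)| ≤ C (A L² + 1) r^L → 0` uniformly in `|θ| ≤ θ₁`, which contradicts `10 ρ_s θ² ≤ g_L` at `θ = min θ₀ θ₁` for any
`ρ_s > 0` (§F, PROVED; honours `Disproof.k1_false_without_theta0_pos` / `_fluxPremise`: the flux premise is consumed at a positive twist).

§A  (A1) the trace of a power of a trinomial pencil `M₀ + u M₊ + u⁻¹ M₋` on the unit circle is a trigonometric polynomial of degree `≤ k`;
    (A2) a trigonometric polynomial of degree `k < L` that is `2π/L`-periodic is constant (root-of-unity averaging).
§B  the uniformly twisted `t–t'` torus IS such a pencil in `u = e^{iθ/L}` (`uniformTwistTT'_eq_pencil`); the seam-flux torus is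
    `2π`-periodic in `θ` and gauge-equivalent to it on every coordinate sector (tree `conj_hubbardTorusTT'Flux_eq_uniform`, `L ≥ 3`).
§C  flux-blindness of the first `L - 1` sector moments.   §D  `(d/dβ)^k tr e^{−βH}|₀ = (−1)^k tr H^k`.   §E  the K1 objects.
§F  sockets: twist-insensitivity ⇒ the leaf (proved); corridor, corridor data, Hypothesis Z.   §G  the stubs (v4: ONE open —
    Hypothesis Z `stub_zeroFreeStrip`; `stub_corridorTransfer` (§J) and `stub_corridorData` (§I) proved) and the composition.
§H  (v2, crit-1 remark R1) the typed split `Z = Z_hot ∧ Z_cold` (both directions proved) and the glue for a reshaped stub set — NOT registered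
    stubs; the registered stub set §G is unchanged. Tree-side landing of §A–§D: `Theorems/TcThermcert1FluxBlindnessPencil.lean` (p688828) and
    `Theorems/TcThermcert1FluxBlindness.lean` (model part), namespace `…Theorems.TcThermcert1.FluxBlindness`.
§K  (v5–v7) the hot end via the fugacity torus: `Z_hot ⇐ K1 (proved) + K2 + K3`; registered stubs v7 = {K2 `stub_gcHighTempAnalytic`,
    K3 `stub_largePowersSaddle2D`, `stub_zeroFreeCold`}.
§L  (v8, g9, BN-resc-10) the TYPED SPLIT OF K3 (statement of K3 byte-identical, now DERIVED): K3a `stub_boxLowerBound` — the model-free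
    local box lower bound `Re ∬_{[−ρ,ρ]²} e^{M G} ≥ c/M`, PROVED (tree helpers `Theorems/TcThermcert1SaddleBoxGaussian.lean` p702010 +
    `Theorems/TcThermcert1SaddleBoxLowerBound.lean`); K3b `stub_saddleGeometry` — the saddle geometry of the exponent on the fugacity torus
    through the complex critical point (v8 OPEN; v9 PROVED); K3c `largePowersSaddle2D_of : K3a → K3b → K3` PROVED (periodic recentring, factor
    `e^{MΦ₀}`, box + off-box split `8π² e^{−γM} < c/M`). Registered (sorried) stubs v8 = {`stub_gcHighTempAnalytic`, `stub_saddleGeometry`,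
    `stub_zeroFreeCold`}; `…_of5` / `…_of_stubs` unchanged.
§M  (v9, g9, BN-resc-10b) K3b `stub_saddleGeometry` PROVED from the tree (`Theorems/TcThermcert1SaddleGeometry.lean`, `saddle_geometry`;
    nine helper modules `TcThermcert1Saddle{TorusPhase,CriticalPoint,CauchyTaylor,LogCircle,BasePoint,Taylor,Local,Global,Geometry}`:
    continuous exponent, Banach critical point in `ℂ²`, Cauchy–Taylor at order 2, log-circle calculus, base point, second-order
    expansions, local quadratic bounds, global gap, assembly with `ρ = 10⁻⁶`, `s = 1/20`, `S = 1/5`, `K = 16501`, `γ = ρ²/200`);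
    hence K3 `stub_largePowersSaddle2D` is PROVED outright (0 sorry below it). Registered (sorried) stubs v9 = {`stub_gcHighTempAnalytic`,
    `stub_zeroFreeCold`} — the hot end now owes only the K2 port; statements of K1/K2/K3/K3a/K3b/Z_cold/`_of5`/`_of_stubs` byte-identical.
§N  (v10, g10, BN-resc-11) K2 `stub_gcHighTempAnalytic` PROVED from the tree (`Theorems/TcThermcert1GcHighTemperature.lean`,
    `gcHighTempAnalytic`; twelve helper modules `TcThermcert1Gc{FugacityNormalization,FusedExponential,NormalizationLog,GibbsFactorization,
    PolymerRepresentation,WeightBound,LocalTraces,KPSmallness,ActivityBound,LocalUnfusing,ClusterExpansion,HighTemperature}`: one-site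
    normalisation `z₂ = 1+ζ↑+ζ↓+ζ↑ζ↓e^{−βU}` and its holomorphic log on the annulus², Gibbs factorisation of the fugacity-weighted trace over
    connected bond clusters, the abstract polymer representation `tr = z₂^{|Λ|}·Ξ(ρ)`, local traces and the activity bound
    `|ρ(X)| ≤ (e⁶·10⁶·s)^{|X|}` (site ratio ≤ 289, `‖βU‖ ≤ 1/256`), local unfusing (ρ is a polynomial in the fugacities ⇒ holomorphic),
    Kotecký–Preiss smallness with `a(X) = |X|`, hence `P = log Ξ(ρ)` holomorphic with `|P| ≤ a|Λ|`, and `h = log(z₂/((1+ζ↑)(1+ζ↓))) + L⁻²P`).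
    THE HOT END IS A THEOREM: registered (sorried) stubs v10 = {`stub_zeroFreeCold`} — the line owes exactly THE BET. New PROVED socket
    `leafAtBeta_of_zeroFreeCold`: for EVERY anchor `β₁ > 0` and every `c ≥ 0`, the small-width cold-side zero-freeness family at `β₁` alone
    gives the thermal stiffness leaf `ObsThermalStiffnessSeqCeilingAtBeta 0 8 (7/8) β₁ c` (at `β₁ = 10`, `c = 1/8` this is the registered
    composition; it is the statement a re-anchored leaf `β₁·t < β_c·t` would consume — census r11, BN-resc-11). K1′ BY NAME: the split child
    `TcThermcert1.ThermalStiffnessCeilingU8b8_le_7o44` (stmt-Ventures-24560, route rev 1, director I2165) follows from the `β₁·t = 8` cold family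
    (`ThermalStiffnessCeilingU8b8_le_7o44_of_zeroFreeCold8`, hypothesis displayed) and from this line's registered stub (`…_of_stubs`, via
    `zeroFreeCold_family_mono`). No statement of the registered set changed.
-/

/-! ## §I A-priori data (INLINED copy of the landed helper `Theorems/TcThermcert1SectorPartitionFnBounds.lean`, p691429, commit c931e029e172,
namespace `…Theorems.TcThermcert1.ZeroFreeCorridor`; inlined under `….ZerofreeCorridor.AprioriData` only because the farm did not yet serve the new module's olean when v3 was
written — replace this section by `import Summits.Ventures.CertifiedManyBodySolver.Theorems.TcThermcert1SectorPartitionFnBounds` at the next edit)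

Spectral sums `tr e^{−zH} = Σ_i e^{−zλ_i}` (entire; `|·| ≤ dim·e^{|Re z|Λ}`; real and `≥ dim·e^{−|x|Λ}` on the axis; `= dim` at `0`), `‖M.toBlock p p‖ ≤ ‖M‖`, block
eigenvalues `≤ ‖M‖`; the flux-uniform bound `‖H_L(θ)‖ ≤ (18 + 10|U| + 26|t′|)·L²` for `hubbardTorusTT'Flux`; sector dimension `≤ e^{2L²}`. -/

namespace Summit.Ventures.CertifiedManyBodySolver.Cruxes.ThermalStiffnessCeilingU8b10_le_1o8.ZerofreeCorridor.AprioriData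

open Matrix Finset
open scoped ComplexConjugate
open Literature.Algebra.Lie.SelfAdjointHullPolar
open Literature.MathematicalPhysics.QuantumLattice
open Literature.MathematicalPhysics.QuantumFieldTheory
open Literature.Probability.LatticeModels

/-! ## §1 Spectral sums `tr e^{−zH}` -/

section Spectral

variable {n : Type*} [Fintype n] [DecidableEq n]

/-- `tr e^{zA} = Σ_i e^{λ_i z}` for Hermitian `A` and complex `z` (spectral theorem). -/
theorem trace_exp_smul_eq_sum_eigenvalues {A : Matrix n n ℂ} (hA : A.IsHermitian) (z : ℂ) :
    (NormedSpace.exp (z • A)).trace = ∑ i, Complex.exp ((hA.eigenvalues i : ℂ) * z) := by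
  conv_lhs => rw [eq_conj_diagonal_of_isHermitian hA]
  rw [exp_smul_conj_diagonal, trace_mul_cycle, Matrix.mem_unitaryGroup_iff'.mp hA.eigenvectorUnitary.2, one_mul,
    trace_diagonal]

/-- The complex-temperature partition function as a spectral sum: `tr e^{−zH} = Σ_i e^{−z λ_i}`. -/
theorem trace_exp_neg_smul_eq_sum_eigenvalues {H : Matrix n n ℂ} (hH : H.IsHermitian) (z : ℂ) :
    (NormedSpace.exp (-z • H)).trace = ∑ i, Complex.exp (-(z * hH.eigenvalues i)) := by
  rw [trace_exp_smul_eq_sum_eigenvalues hH]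
  refine Finset.sum_congr rfl fun i _ => ?_
  ring_nf

/-- `z ↦ tr e^{−zH}` is entire. -/
theorem differentiable_trace_exp_neg_smul {H : Matrix n n ℂ} (hH : H.IsHermitian) :
    Differentiable ℂ fun z : ℂ => (NormedSpace.exp (-z • H)).trace := by
  have h : (fun z : ℂ => (NormedSpace.exp (-z • H)).trace) = fun z => ∑ i, Complex.exp (-(z * hH.eigenvalues i)) :=
    funext fun z => trace_exp_neg_smul_eq_sum_eigenvalues hH z
  rw [h]
  fun_prop

/-- At infinite temperature the partition function is the dimension: `tr e^{−0·H} = |n|`. -/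
theorem trace_exp_neg_zero_smul (H : Matrix n n ℂ) :
    (NormedSpace.exp (-(0 : ℂ) • H)).trace = Fintype.card n := by
  rw [neg_zero, zero_smul, NormedSpace.exp_zero, trace_one]

/-- `|tr e^{−zH}| ≤ |n| · e^{|Re z| Λ}` when all `|λ_i| ≤ Λ`. -/
theorem norm_trace_exp_neg_smul_le {H : Matrix n n ℂ} (hH : H.IsHermitian) {Λ : ℝ} (hΛ : ∀ i, |hH.eigenvalues i| ≤ Λ)
    (z : ℂ) : ‖(NormedSpace.exp (-z • H)).trace‖ ≤ Fintype.card n * Real.exp (|z.re| * Λ) := by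
  rw [trace_exp_neg_smul_eq_sum_eigenvalues hH]
  refine (norm_sum_le _ _).trans ?_
  have hterm : ∀ i, ‖Complex.exp (-(z * hH.eigenvalues i))‖ ≤ Real.exp (|z.re| * Λ) := by
    intro i
    rw [Complex.norm_exp]
    refine Real.exp_le_exp.mpr ?_
    simp only [Complex.neg_re, Complex.mul_re, Complex.ofReal_re, Complex.ofReal_im, mul_zero, sub_zero]
    calc -(z.re * hH.eigenvalues i) ≤ |z.re * hH.eigenvalues i| := neg_le_abs _
      _ = |z.re| * |hH.eigenvalues i| := abs_mul _ _
      _ ≤ |z.re| * Λ := mul_le_mul_of_nonneg_left (hΛ i) (abs_nonneg _)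
  calc ∑ i, ‖Complex.exp (-(z * hH.eigenvalues i))‖ ≤ ∑ _i : n, Real.exp (|z.re| * Λ) := Finset.sum_le_sum fun i _ => hterm i
    _ = Fintype.card n * Real.exp (|z.re| * Λ) := by rw [Finset.sum_const, Finset.card_univ, nsmul_eq_mul]

/-- On the real axis `tr e^{−xH}` is real. -/
theorem trace_exp_neg_smul_ofReal_im {H : Matrix n n ℂ} (hH : H.IsHermitian) (x : ℝ) :
    ((NormedSpace.exp (-(x : ℂ) • H)).trace).im = 0 := by
  rw [trace_exp_neg_smul_eq_sum_eigenvalues hH, Complex.im_sum]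
  refine Finset.sum_eq_zero fun i _ => ?_
  rw [show -((x : ℂ) * (hH.eigenvalues i : ℂ)) = ((-(x * hH.eigenvalues i) : ℝ) : ℂ) by push_cast; ring,
    Complex.exp_ofReal_im]

/-- On the real axis `Re tr e^{−xH} ≥ |n| · e^{−|x| Λ}` when all `|λ_i| ≤ Λ` (each Boltzmann factor is at least `e^{−|x|Λ}`). -/
theorem card_mul_exp_neg_le_trace_exp_neg_smul_ofReal_re {H : Matrix n n ℂ} (hH : H.IsHermitian) {Λ : ℝ}
    (hΛ : ∀ i, |hH.eigenvalues i| ≤ Λ) (x : ℝ) :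
    Fintype.card n * Real.exp (-(|x| * Λ)) ≤ ((NormedSpace.exp (-(x : ℂ) • H)).trace).re := by
  rw [trace_exp_neg_smul_eq_sum_eigenvalues hH, Complex.re_sum]
  have hterm : ∀ i, (Complex.exp (-((x : ℂ) * hH.eigenvalues i))).re = Real.exp (-(x * hH.eigenvalues i)) := by
    intro i
    rw [show -((x : ℂ) * (hH.eigenvalues i : ℂ)) = ((-(x * hH.eigenvalues i) : ℝ) : ℂ) by push_cast; ring,
      Complex.exp_ofReal_re]
  simp only [hterm]
  have hle : ∀ i, Real.exp (-(|x| * Λ)) ≤ Real.exp (-(x * hH.eigenvalues i)) := by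
    intro i
    refine Real.exp_le_exp.mpr (neg_le_neg ?_)
    calc x * hH.eigenvalues i ≤ |x * hH.eigenvalues i| := le_abs_self _
      _ = |x| * |hH.eigenvalues i| := abs_mul _ _
      _ ≤ |x| * Λ := mul_le_mul_of_nonneg_left (hΛ i) (abs_nonneg _)
  calc (Fintype.card n : ℝ) * Real.exp (-(|x| * Λ)) = ∑ _i : n, Real.exp (-(|x| * Λ)) := by
        rw [Finset.sum_const, Finset.card_univ, nsmul_eq_mul]
    _ ≤ ∑ i, Real.exp (-(x * hH.eigenvalues i)) := Finset.sum_le_sum fun i _ => hle i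

end Spectral

/-! ## §1′ Eigenvalues versus the `ℓ²` operator norm; norms of principal blocks -/

section OpNorm

open scoped Matrix.Norms.L2Operator

variable {n : Type*} [Fintype n] [DecidableEq n]

/-- Principal blocks do not increase the `ℓ²` operator norm: `‖M.toBlock p p‖ ≤ ‖M‖` (`M.toBlock p p = P M Pᴴ` with the
coordinate co-isometry `P`, `P Pᴴ = 1`). -/
theorem l2_opNorm_toBlock_le (M : Matrix n n ℂ) (p : n → Prop) [DecidablePred p] : ‖M.toBlock p p‖ ≤ ‖M‖ := by
  set P : Matrix {a // p a} n ℂ := (1 : Matrix n n ℂ).submatrix Subtype.val id with hP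
  have hB : M.toBlock p p = P * M * Pᴴ := by
    ext s t
    simp [hP, Matrix.mul_apply, Matrix.one_apply, toBlock_apply]
  have hPP : P * Pᴴ = 1 := by
    ext s t
    simp [hP, Matrix.mul_apply, Matrix.one_apply, Subtype.val_inj]
  have h1 : ‖(1 : Matrix {a // p a} {a // p a} ℂ)‖ ≤ 1 := by
    rw [Matrix.cstar_norm_def, map_one, ContinuousLinearMap.one_def]
    exact ContinuousLinearMap.norm_id_le
  have hPn : ‖Pᴴ‖ ≤ 1 := by
    have h := l2_opNorm_conjTranspose_mul_self Pᴴ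
    rw [conjTranspose_conjTranspose, hPP] at h
    nlinarith [norm_nonneg Pᴴ, h1, h]
  have hPn' : ‖P‖ ≤ 1 := by rw [← l2_opNorm_conjTranspose]; exact hPn
  rw [hB]
  calc ‖P * M * Pᴴ‖ ≤ ‖P * M‖ * ‖Pᴴ‖ := l2_opNorm_mul _ _
    _ ≤ ‖P‖ * ‖M‖ * ‖Pᴴ‖ := mul_le_mul_of_nonneg_right (l2_opNorm_mul _ _) (norm_nonneg _)
    _ ≤ 1 * ‖M‖ * 1 := by gcongr
    _ = ‖M‖ := by ring

/-- Eigenvalues of a principal block of a Hermitian matrix are bounded by the norm of the whole matrix: `|λ_i(B)| ≤ ‖B‖` (the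
eigenvalue lies in the spectrum; cf. the tree's `abs_eigenvalues_le_norm` in `StabilitySpectralFlowProofs`, not imported here), then
`‖M.toBlock p p‖ ≤ ‖M‖`. -/
theorem abs_eigenvalues_toBlock_le_norm {M : Matrix n n ℂ} (p : n → Prop) [DecidablePred p]
    (hB : (M.toBlock p p).IsHermitian) (i : {a // p a}) : |hB.eigenvalues i| ≤ ‖M‖ := by
  haveI : Nonempty {a // p a} := ⟨i⟩
  have hmem : ((hB.eigenvalues i : ℝ) : ℂ) ∈ spectrum ℂ (M.toBlock p p) :=
    (spectrum.algebraMap_mem_iff ℂ).mpr (hB.eigenvalues_mem_spectrum_real i)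
  have h := spectrum.norm_le_norm_of_mem hmem
  rw [Complex.norm_real, Real.norm_eq_abs] at h
  exact h.trans (l2_opNorm_toBlock_le M p)

end OpNorm

/-! ## §2 The seam-flux `t–t′` torus: a flux-uniform norm bound and the sector dimensions -/

section Model

open scoped Matrix.Norms.L2Operator

variable {L : ℕ} [NeZero L]

/-- Vertices of the diagonal (next-nearest-neighbour) torus graph have at most `4` neighbours. -/
theorem card_filter_fermionTorusDiagGraph_adj_le (v : FermionTorus 2 L) :
    (Finset.univ.filter ((fermionTorusDiagGraph L).Adj v)).card ≤ 4 := by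
  classical
  have hsub : (Finset.univ.filter ((fermionTorusDiagGraph L).Adj v)).image FermionTorus.toTorusSite ⊆
      (Finset.univ : Finset (Fin 2 × Bool)).image fun p =>
        if p.2 then v.toTorusSite + torusDiagJump L p.1 else v.toTorusSite - torusDiagJump L p.1 := by
    intro z hz
    obtain ⟨w, hw, rfl⟩ := Finset.mem_image.1 hz
    have hadj := (Finset.mem_filter.1 hw).2
    simp only [fermionTorusDiagGraph, SimpleGraph.comap_adj, torusDiagGraph, SimpleGraph.fromRel_adj] at hadj
    obtain ⟨-, ⟨s, h⟩ | ⟨s, h⟩⟩ := hadj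
    · exact Finset.mem_image.2 ⟨(s, true), Finset.mem_univ _, by simp only [if_true]; exact h.symm⟩
    · refine Finset.mem_image.2 ⟨(s, false), Finset.mem_univ _, ?_⟩
      simp only [Bool.false_eq_true, if_false]
      rw [h, add_sub_cancel_right]
  have hinj : Function.Injective (FermionTorus.toTorusSite : FermionTorus 2 L → TorusSite 2 L) :=
    FermionTorus.equivTorusSite.injective
  calc (Finset.univ.filter ((fermionTorusDiagGraph L).Adj v)).card
      = ((Finset.univ.filter ((fermionTorusDiagGraph L).Adj v)).image FermionTorus.toTorusSite).card :=
        (Finset.card_image_of_injective _ hinj).symm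
    _ ≤ ((Finset.univ : Finset (Fin 2 × Bool)).image fun p =>
        if p.2 then v.toTorusSite + torusDiagJump L p.1 else v.toTorusSite - torusDiagJump L p.1).card :=
        Finset.card_le_card hsub
    _ ≤ (Finset.univ : Finset (Fin 2 × Bool)).card := Finset.card_image_le
    _ = 4 := by simp

omit [NeZero L] in
/-- `‖c†_i c_j‖ ≤ 1` on the torus Fock space. -/
theorem norm_creation_mul_annihilation_le_one (i j : Orb (FermionTorus 2 L)) :
    ‖(creation i * annihilation j : Matrix (Finset (Orb (FermionTorus 2 L))) (Finset (Orb (FermionTorus 2 L))) ℂ)‖ ≤ 1 := by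
  have h1 := norm_creation_le_one (ι := Orb (FermionTorus 2 L)) i
  have h2 := norm_annihilation_le_one (ι := Orb (FermionTorus 2 L)) j
  exact (norm_mul_le _ _).trans (mul_le_one₀ h1 (norm_nonneg _) h2)

/-- The vertical-seam twist correction has norm `≤ 8L` (`4L` terms of norm `≤ 2`). -/
theorem norm_seamTwist_le (θ : ℝ) : ‖seamTwist L θ‖ ≤ 8 * L := by
  have hph : ∀ b : Bool, ‖(1 : ℂ) - Complex.exp ((if b then 1 else -1) * Complex.I * θ)‖ ≤ 2 := by
    intro b
    refine (norm_sub_le _ _).trans ?_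
    have : ‖Complex.exp ((if b then 1 else -1) * Complex.I * θ)‖ = 1 := by
      rw [Complex.norm_exp]
      cases b <;> simp
    rw [this, norm_one]; norm_num
  calc ‖seamTwist L θ‖ ≤ ∑ _y : ZMod L, ∑ _σ : Fin 2, ∑ _b : Bool, (2 : ℝ) := by
        unfold seamTwist
        refine (norm_sum_le _ _).trans (Finset.sum_le_sum fun y _ => (norm_sum_le _ _).trans
          (Finset.sum_le_sum fun σ _ => (norm_sum_le _ _).trans (Finset.sum_le_sum fun b _ => ?_)))
        refine (norm_smul_le _ _).trans ?_
        refine (mul_le_mul (hph b) (norm_creation_mul_annihilation_le_one _ _) (norm_nonneg _) zero_le_two).trans ?_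
        norm_num
    _ = 8 * L := by
        simp only [Finset.sum_const, Finset.card_univ, ZMod.card, Fintype.card_fin, Fintype.card_bool]
        ring

/-- The diagonal-seam twist correction has norm `≤ 16L²` (`4L²` summands of norm `≤ 4`). -/
theorem norm_diagSeamTwist_le (θ : ℝ) : ‖diagSeamTwist L θ‖ ≤ 16 * (L : ℝ) ^ 2 := by
  have he1 : ‖(1 : ℂ) - ((Circle.exp θ : Circle) : ℂ)‖ ≤ 2 :=
    (norm_sub_le _ _).trans (by rw [Circle.norm_coe, norm_one]; norm_num)
  have he2 : ‖(1 : ℂ) - conj ((Circle.exp θ : Circle) : ℂ)‖ ≤ 2 := by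
    rw [← Complex.norm_conj, map_sub, map_one, Complex.conj_conj]; exact he1
  calc ‖diagSeamTwist L θ‖ ≤ ∑ _s : Fin 2, ∑ _x : Site 2 L, ∑ _σ : Fin 2, (4 : ℝ) := by
        unfold diagSeamTwist
        refine (norm_sum_le _ _).trans (Finset.sum_le_sum fun s _ => (norm_sum_le _ _).trans
          (Finset.sum_le_sum fun x _ => (norm_sum_le _ _).trans (Finset.sum_le_sum fun σ _ => ?_)))
        split_ifs
        · refine (norm_add_le _ _).trans ?_
          refine (add_le_add
            ((norm_smul_le _ _).trans (mul_le_mul he1 (norm_creation_mul_annihilation_le_one _ _) (norm_nonneg _) zero_le_two))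
            ((norm_smul_le _ _).trans (mul_le_mul he2 (norm_creation_mul_annihilation_le_one _ _) (norm_nonneg _) zero_le_two))).trans ?_
          norm_num
        · rw [norm_zero]; norm_num
    _ = 16 * (L : ℝ) ^ 2 := by
        have hcard : Fintype.card (Site 2 L) = L ^ 2 := by simp [ZMod.card, Fintype.card_fin]
        simp only [Finset.sum_const, Finset.card_univ, hcard, Fintype.card_fin]
        ring

/-- `‖H_{t=1,U}‖ ≤ 10 (1 + |U|) L²` for the nearest-neighbour torus Hubbard Hamiltonian (`≤ 5L²` local terms of norm `≤ 2 + |U|`). -/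
theorem norm_hamiltonian_fermionTorusGraph_le (U : ℝ) :
    ‖hamiltonian (fermionTorusGraph 2 L) 1 U‖ ≤ 10 * (1 + |U|) * (L : ℝ) ^ 2 := by
  have hcard : (Fintype.card (HubbardIdx (fermionTorusGraph 2 L)) : ℝ) ≤ 5 * (L : ℝ) ^ 2 := by
    exact_mod_cast Summit.HubbardSuperconductivity.HubbardSuperconductivity.Theorems.card_hubbardIdx_fermionTorus_two_le L
  rw [← hamiltonianWith_zero, ← sum_hubbardTermOp]
  calc ‖∑ Z, hubbardTermOp (fermionTorusGraph 2 L) 1 U 0 Z‖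
      ≤ ∑ Z, ‖hubbardTermOp (fermionTorusGraph 2 L) 1 U 0 Z‖ := norm_sum_le _ _
    _ ≤ ∑ _Z : HubbardIdx (fermionTorusGraph 2 L), 2 * (1 + |U|) :=
        Finset.sum_le_sum fun Z _ => (norm_hubbardTermOp_le _ 1 U 0 Z).trans (by rw [abs_one, abs_zero]; linarith [abs_nonneg U])
    _ = (Fintype.card (HubbardIdx (fermionTorusGraph 2 L)) : ℝ) * (2 * (1 + |U|)) := by
        rw [Finset.sum_const, nsmul_eq_mul, Finset.card_univ]
    _ ≤ (5 * (L : ℝ) ^ 2) * (2 * (1 + |U|)) := mul_le_mul_of_nonneg_right hcard (by positivity)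
    _ = 10 * (1 + |U|) * (L : ℝ) ^ 2 := by ring

/-- `‖H′_{t′}‖ ≤ 10 |t′| L²` for the diagonal (next-nearest-neighbour) hopping Hamiltonian. -/
theorem norm_hamiltonian_fermionTorusDiagGraph_le (t' : ℝ) :
    ‖hamiltonian (fermionTorusDiagGraph L) t' 0‖ ≤ 10 * |t'| * (L : ℝ) ^ 2 := by
  have hcard : (Fintype.card (HubbardIdx (fermionTorusDiagGraph L)) : ℝ) ≤ 5 * (L : ℝ) ^ 2 := by
    have h := Summit.HubbardSuperconductivity.HubbardSuperconductivity.Theorems.card_hubbardIdx_le_of_degree_le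
      (fermionTorusDiagGraph L) (Δ := 4) fun x => card_filter_fermionTorusDiagGraph_adj_le x
    rw [show Fintype.card (FermionTorus 2 L) = L ^ 2 from by
      change Fintype.card (Fin 2 → Fin L) = L ^ 2; rw [Fintype.card_fun, Fintype.card_fin, Fintype.card_fin]] at h
    have h' : (Fintype.card (HubbardIdx (fermionTorusDiagGraph L)) : ℝ) ≤ ((4 + 1) * L ^ 2 : ℕ) := by exact_mod_cast h
    refine h'.trans (le_of_eq ?_)
    push_cast; ring
  rw [← hamiltonianWith_zero, ← sum_hubbardTermOp]
  calc ‖∑ Z, hubbardTermOp (fermionTorusDiagGraph L) t' 0 0 Z‖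
      ≤ ∑ Z, ‖hubbardTermOp (fermionTorusDiagGraph L) t' 0 0 Z‖ := norm_sum_le _ _
    _ ≤ ∑ _Z : HubbardIdx (fermionTorusDiagGraph L), 2 * |t'| :=
        Finset.sum_le_sum fun Z _ => (norm_hubbardTermOp_le _ t' 0 0 Z).trans (by rw [abs_zero]; linarith)
    _ = (Fintype.card (HubbardIdx (fermionTorusDiagGraph L)) : ℝ) * (2 * |t'|) := by
        rw [Finset.sum_const, nsmul_eq_mul, Finset.card_univ]
    _ ≤ (5 * (L : ℝ) ^ 2) * (2 * |t'|) := mul_le_mul_of_nonneg_right hcard (by positivity)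
    _ = 10 * |t'| * (L : ℝ) ^ 2 := by ring

/-- **Flux-uniform norm bound** `‖H_L(θ)‖ ≤ (18 + 10|U| + 26|t′|)·L²` for the seam-flux `t–t′` Hubbard torus
`hubbardTorusTT'Flux L t′ U θ = H_{1,U} + H′_{t′} + (seam twist) + t′·(diagonal seam twist)`. -/
theorem norm_hubbardTorusTT'Flux_le (t' U θ : ℝ) :
    ‖hubbardTorusTT'Flux L t' U θ‖ ≤ (18 + 10 * |U| + 26 * |t'|) * (L : ℝ) ^ 2 := by
  have hL1 : (1 : ℝ) ≤ L := by exact_mod_cast Nat.one_le_iff_ne_zero.mpr (NeZero.ne L)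
  have hLL : (L : ℝ) ≤ (L : ℝ) ^ 2 := by nlinarith
  rw [hubbardTorusTT'Flux_eq, hubbardTorusTT']
  calc _ ≤ ‖hamiltonian (fermionTorusGraph 2 L) 1 U + hamiltonian (fermionTorusDiagGraph L) t' 0‖ +
          ‖seamTwist L θ + (t' : ℂ) • diagSeamTwist L θ‖ := norm_add_le _ _
    _ ≤ (‖hamiltonian (fermionTorusGraph 2 L) 1 U‖ + ‖hamiltonian (fermionTorusDiagGraph L) t' 0‖) +
          (‖seamTwist L θ‖ + ‖(t' : ℂ) • diagSeamTwist L θ‖) := add_le_add (norm_add_le _ _) (norm_add_le _ _)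
    _ ≤ (10 * (1 + |U|) * (L : ℝ) ^ 2 + 10 * |t'| * (L : ℝ) ^ 2) + (8 * L + |t'| * (16 * (L : ℝ) ^ 2)) := by
        gcongr
        · exact norm_hamiltonian_fermionTorusGraph_le U
        · exact norm_hamiltonian_fermionTorusDiagGraph_le t'
        · exact norm_seamTwist_le θ
        · rw [norm_smul, Complex.norm_real, Real.norm_eq_abs]
          exact mul_le_mul_of_nonneg_left (norm_diagSeamTwist_le θ) (abs_nonneg _)
    _ ≤ (18 + 10 * |U| + 26 * |t'|) * (L : ℝ) ^ 2 := by nlinarith [abs_nonneg U, abs_nonneg t']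

/-- **Sector eigenvalue bound**: every eigenvalue of every coordinate-sector block of `H_L(θ)` is at most
`(18 + 10|U| + 26|t′|)·L²` in absolute value, uniformly in the flux (generic in the decidability instances of the sector). -/
theorem abs_eigenvalues_sectorBlock_le (t' U θ : ℝ) (q : Finset (Orb (FermionTorus 2 L)) → Prop) [DecidablePred q]
    [DecidableEq {a // q a}] (hB : ((hubbardTorusTT'Flux L t' U θ).toBlock q q).IsHermitian) (i : {a // q a}) :
    |hB.eigenvalues i| ≤ (18 + 10 * |U| + 26 * |t'|) * (L : ℝ) ^ 2 :=
  (abs_eigenvalues_toBlock_le_norm q hB i).trans (norm_hubbardTorusTT'Flux_le t' U θ)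

omit [NeZero L] in
/-- **Sector dimensions**: a coordinate sector of the torus Fock space has dimension `≤ 4^{L²} ≤ e^{2L²}` (generic in the `Fintype`
instance of the sector). -/
theorem card_sector_le_exp (q : Finset (Orb (FermionTorus 2 L)) → Prop) [Fintype {a // q a}] :
    (Fintype.card {a // q a} : ℝ) ≤ Real.exp (2 * (L : ℝ) ^ 2) := by
  have h1 : Fintype.card {a // q a} ≤ Fintype.card (Finset (Orb (FermionTorus 2 L))) :=
    Fintype.card_le_of_injective Subtype.val Subtype.val_injective
  have h2 : Fintype.card (Finset (Orb (FermionTorus 2 L))) = 2 ^ (2 * L ^ 2) := by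
    rw [Fintype.card_finset]
    congr 1
    rw [show Fintype.card (Orb (FermionTorus 2 L)) = Fintype.card (FermionTorus 2 L × Fin 2) from Fintype.card_congr (Equiv.refl _),
      Fintype.card_prod, Fintype.card_fin, show Fintype.card (FermionTorus 2 L) = L ^ 2 from by
        change Fintype.card (Fin 2 → Fin L) = L ^ 2; rw [Fintype.card_fun, Fintype.card_fin, Fintype.card_fin]]
    ring
  calc (Fintype.card {a // q a} : ℝ) ≤ (2 : ℝ) ^ (2 * L ^ 2) := by exact_mod_cast h2 ▸ h1
    _ ≤ Real.exp 1 ^ (2 * L ^ 2) := by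
        gcongr
        have := Real.add_one_le_exp (1 : ℝ)
        linarith
    _ = Real.exp (2 * (L : ℝ) ^ 2) := by rw [← Real.exp_nat_mul]; push_cast; ring_nf

end Model

end Summit.Ventures.CertifiedManyBodySolver.Cruxes.ThermalStiffnessCeilingU8b10_le_1o8.ZerofreeCorridor.AprioriData

/-! ## §J Corridor transfer (INLINED copy of the landed helpers `Theorems/TcThermcert1CorridorTransferDiscs.lean` (p693767) and
`Theorems/TcThermcert1CorridorTransfer.lean`, namespace `…Theorems.TcThermcert1.ZeroFreeCorridor`; inlined under `….ZerofreeCorridor.CorridorTransfer`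
only because the farm does not serve a just-landed module's olean at once — replace this section by the two imports at the next edit)

§J1 Borel–Carathéodory coefficient bound at a general centre and on small balls; §J2 split-Taylor two-radii estimate; §J3 matching jets pass
to logarithms (`analyticOrderAt`); §J4 the corridor is open and convex, holomorphic logarithms of admissible data; §J5 coefficient bounds for
`h = ℓ_f − ℓ_g` at real centres and the disc chain; §J6 the rate constant `r = 2^{−2^{−n}}` (n-fold square root) and `corridorTransfer`. -/

noncomputable section

namespace Summit.Ventures.CertifiedManyBodySolver.Cruxes.ThermalStiffnessCeilingU8b10_le_1o8.ZerofreeCorridor.CorridorTransfer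

open Complex Metric Set Filter Topology Finset

/-! ## §1 Borel–Carathéodory coefficient bounds at a general centre -/

/-- Borel–Carathéodory coefficient bound at a general centre `c`: `h` holomorphic on `ball c R` with `Re h ≤ M`
there `⇒ ‖h^{(k)}(c)‖ ≤ 2·k!·(M − Re h(c))/R^k` for `k ≥ 1` (apply the centred tree lemma to `w ↦ −h c + h (w + c)`). -/
theorem norm_iteratedDeriv_le_of_re_le {h : ℂ → ℂ} {c : ℂ} {M R : ℝ} (hR : 0 < R)
    (hh : DifferentiableOn ℂ h (ball c R)) (hre : ∀ z ∈ ball c R, (h z).re ≤ M) {k : ℕ} (hk : 1 ≤ k) :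
    ‖iteratedDeriv k h c‖ ≤ 2 * k.factorial * (M - (h c).re) / R ^ k := by
  set F : ℂ → ℂ := fun w => -h c + h (w + c) with hF
  have hmaps : ∀ w ∈ ball (0 : ℂ) R, w + c ∈ ball c R := by
    intro w hw
    rw [mem_ball, dist_eq_norm] at hw ⊢
    simpa using hw
  have hFd : DifferentiableOn ℂ F (ball 0 R) :=
    (hh.comp ((differentiableOn_id).add_const c) hmaps).const_add (-h c)
  have hFre : ∀ w ∈ ball (0 : ℂ) R, (F w).re ≤ M - (h c).re := by
    intro w hw
    have := hre (w + c) (hmaps w hw)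
    simp only [hF, add_re, neg_re]
    linarith
  have hF0 : F 0 = 0 := by simp [hF]
  have hBC := Literature.Analysis.Complex.borelCaratheodory_norm_iteratedDeriv_le_of_ball hR hFd hFre hF0 hk
  have hder : iteratedDeriv k F 0 = iteratedDeriv k h c := by
    have h1 : iteratedDeriv k F 0 = iteratedDeriv k (fun w => h (w + c)) 0 :=
      congrFun (funext fun x => by rw [hF, iteratedDeriv_const_add hk]) 0
    rw [h1, iteratedDeriv_comp_add_const k h c]
    simp
  rw [hder] at hBC
  exact hBC

/-- Small-ball coefficient bound: `h` holomorphic on `ball c ρ` with `‖h‖ ≤ ε` there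
`⇒ ‖h^{(k)}(c)‖ ≤ k!·(4ε)/ρ^k` for every `k` (Borel–Carathéodory with `M = ε`, `−Re h(c) ≤ ε`; `k = 0` directly). -/
theorem norm_iteratedDeriv_le_of_norm_le {h : ℂ → ℂ} {c : ℂ} {ε ρ : ℝ} (hρ : 0 < ρ)
    (hh : DifferentiableOn ℂ h (ball c ρ)) (hε : ∀ z ∈ ball c ρ, ‖h z‖ ≤ ε) (k : ℕ) :
    ‖iteratedDeriv k h c‖ ≤ k.factorial * (4 * ε) / ρ ^ k := by
  have hc : ‖h c‖ ≤ ε := hε c (mem_ball_self hρ)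
  have hε0 : 0 ≤ ε := le_trans (norm_nonneg _) hc
  rcases Nat.eq_zero_or_pos k with rfl | hk
  · simp only [iteratedDeriv_zero, Nat.factorial_zero, Nat.cast_one, one_mul, pow_zero, div_one]
    linarith
  · have hre : ∀ z ∈ ball c ρ, (h z).re ≤ ε := fun z hz => le_trans (re_le_norm _) (hε z hz)
    have h1 := norm_iteratedDeriv_le_of_re_le hρ hh hre hk
    have h2 : -(h c).re ≤ ε := by
      have := abs_re_le_norm (h c)
      have := neg_abs_le (h c).re
      linarith
    have hfac : (0 : ℝ) < k.factorial := by positivity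
    have hρk : (0 : ℝ) < ρ ^ k := pow_pos hρ k
    calc ‖iteratedDeriv k h c‖ ≤ 2 * k.factorial * (ε - (h c).re) / ρ ^ k := h1
      _ ≤ 2 * k.factorial * (2 * ε) / ρ ^ k := by
          gcongr
          linarith
      _ = k.factorial * (4 * ε) / ρ ^ k := by ring

/-! ## §2 The two-radii estimate from a split Taylor series -/

/-- Split Taylor estimate: if `‖h^{(n)}(c)‖ ≤ n!·A/R^n` for all `n` and `‖h^{(n)}(c)‖ ≤ n!·B/(R/4)^n` for `n < N`,
then `‖h z‖ ≤ B·2^N + 2A·2^{−N}` on `closedBall c (R/2)` (`Complex.hasSum_taylorSeries_on_ball`, split at `N`). -/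
theorem norm_le_of_taylor_split {h : ℂ → ℂ} {c z : ℂ} {R A B : ℝ} (hR : 0 < R)
    (hh : DifferentiableOn ℂ h (ball c R)) (hA : 0 ≤ A) (hB : 0 ≤ B)
    (hbig : ∀ n : ℕ, ‖iteratedDeriv n h c‖ ≤ n.factorial * A / R ^ n) (N : ℕ)
    (hfin : ∀ n : ℕ, n < N → ‖iteratedDeriv n h c‖ ≤ n.factorial * B / (R / 4) ^ n)
    (hz : z ∈ closedBall c (R / 2)) :
    ‖h z‖ ≤ B * 2 ^ N + 2 * A * (1 / 2) ^ N := by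
  have hzball : z ∈ ball c R := closedBall_subset_ball (by linarith) hz
  have hT := Complex.hasSum_taylorSeries_on_ball hh hzball
  set t : ℕ → ℂ := fun n => (n.factorial : ℂ)⁻¹ • (z - c) ^ n • iteratedDeriv n h c with ht_def
  have hzc : ‖z - c‖ ≤ R / 2 := by rwa [mem_closedBall, dist_eq_norm] at hz
  -- generic term bound
  have key : ∀ (n : ℕ) (K ρ : ℝ), 0 < ρ → 0 ≤ K →
      ‖iteratedDeriv n h c‖ ≤ n.factorial * K / ρ ^ n → ‖t n‖ ≤ K * (R / 2 / ρ) ^ n := by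
    intro n K ρ hρ hK hb
    have hfac : (0 : ℝ) < n.factorial := by positivity
    have hnorm : ‖t n‖ = (n.factorial : ℝ)⁻¹ * (‖z - c‖ ^ n * ‖iteratedDeriv n h c‖) := by
      simp only [ht_def, smul_eq_mul, norm_mul, norm_inv, Complex.norm_natCast, norm_pow]
    rw [hnorm]
    calc (n.factorial : ℝ)⁻¹ * (‖z - c‖ ^ n * ‖iteratedDeriv n h c‖)
        ≤ (n.factorial : ℝ)⁻¹ * ((R / 2) ^ n * (n.factorial * K / ρ ^ n)) := by
          apply mul_le_mul_of_nonneg_left _ (inv_nonneg.mpr hfac.le)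
          exact mul_le_mul (pow_le_pow_left₀ (norm_nonneg _) hzc n) hb (norm_nonneg _)
            (pow_nonneg (by linarith) n)
      _ = K * (R / 2 / ρ) ^ n := by
          rw [div_pow (R / 2) ρ n]
          field_simp
  have htail : ∀ n : ℕ, ‖t (n + N)‖ ≤ A * (1 / 2 : ℝ) ^ (n + N) := by
    intro n
    have h1 := key (n + N) A R hR hA (hbig (n + N))
    have h2 : R / 2 / R = 1 / 2 := by field_simp
    rwa [h2] at h1
  have hfinb : ∀ n : ℕ, n < N → ‖t n‖ ≤ B * (2 : ℝ) ^ n := by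
    intro n hn
    have h1 := key n B (R / 4) (by positivity) hB (hfin n hn)
    have h2 : R / 2 / (R / 4) = 2 := by field_simp; ring
    rwa [h2] at h1
  have hT' : HasSum (fun n => t (n + N)) (h z - ∑ i ∈ range N, t i) := (hasSum_nat_add_iff' N).mpr hT
  have hgeo : HasSum (fun n : ℕ => A * (1 / 2 : ℝ) ^ (n + N)) (2 * A * (1 / 2) ^ N) := by
    have h0 := hasSum_geometric_two.mul_left (A * (1 / 2 : ℝ) ^ N)
    have h1 : (fun n : ℕ => A * (1 / 2 : ℝ) ^ (n + N)) = fun i => A * (1 / 2) ^ N * (1 / 2) ^ i := by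
      funext i; rw [pow_add]; ring
    rw [h1, show 2 * A * (1 / 2 : ℝ) ^ N = A * (1 / 2) ^ N * 2 by ring]
    exact h0
  have h1 : ‖h z - ∑ i ∈ range N, t i‖ ≤ 2 * A * (1 / 2) ^ N := hT'.norm_le_of_bounded hgeo htail
  have h2 : ‖∑ i ∈ range N, t i‖ ≤ B * 2 ^ N := by
    calc ‖∑ i ∈ range N, t i‖ ≤ ∑ i ∈ range N, ‖t i‖ := norm_sum_le _ _
      _ ≤ ∑ i ∈ range N, B * (2 : ℝ) ^ i := Finset.sum_le_sum fun i hi => hfinb i (mem_range.mp hi)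
      _ = B * ∑ i ∈ range N, (2 : ℝ) ^ i := by rw [Finset.mul_sum]
      _ = B * (2 ^ N - 1) := by
          rw [geom_sum_eq (by norm_num : (2 : ℝ) ≠ 1) N]
          norm_num
      _ ≤ B * 2 ^ N := by nlinarith
  calc ‖h z‖ = ‖(h z - ∑ i ∈ range N, t i) + ∑ i ∈ range N, t i‖ := by rw [sub_add_cancel]
    _ ≤ ‖h z - ∑ i ∈ range N, t i‖ + ‖∑ i ∈ range N, t i‖ := norm_add_le _ _
    _ ≤ 2 * A * (1 / 2) ^ N + B * 2 ^ N := add_le_add h1 h2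
    _ = B * 2 ^ N + 2 * A * (1 / 2) ^ N := by ring

/-- Two-radii estimate: `h` holomorphic on `ball c R`, `‖h^{(n)}(c)‖ ≤ n!·A/R^n` for all `n`, and `‖h‖ ≤ ε` on
`ball c (R/4)` `⇒ ‖h‖ ≤ 4ε·2^N + 2A·2^{−N}` on `closedBall c (R/2)`, for every `N`. -/
theorem norm_le_two_radii {h : ℂ → ℂ} {c z : ℂ} {R A ε : ℝ} (hR : 0 < R)
    (hh : DifferentiableOn ℂ h (ball c R)) (hA : 0 ≤ A)
    (hbig : ∀ n : ℕ, ‖iteratedDeriv n h c‖ ≤ n.factorial * A / R ^ n)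
    (hε : ∀ w ∈ ball c (R / 4), ‖h w‖ ≤ ε) (N : ℕ) (hz : z ∈ closedBall c (R / 2)) :
    ‖h z‖ ≤ 4 * ε * 2 ^ N + 2 * A * (1 / 2) ^ N := by
  have hε0 : 0 ≤ ε := le_trans (norm_nonneg _) (hε c (mem_ball_self (by positivity)))
  have hsmall : ∀ n : ℕ, n < N → ‖iteratedDeriv n h c‖ ≤ n.factorial * (4 * ε) / (R / 4) ^ n :=
    fun n _ => norm_iteratedDeriv_le_of_norm_le (by positivity)
      (hh.mono (ball_subset_ball (by linarith))) hε n
  exact norm_le_of_taylor_split hR hh hA (by positivity) hbig N hsmall hz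

/-! ## §3 Matching jets pass to the logarithms -/

/-- If `f = exp ∘ ℓ_f`, `g = exp ∘ ℓ_g` near `0`, `g 0 ≠ 0`, `ℓ_f 0 = ℓ_g 0` and `f^{(k)}(0) = g^{(k)}(0)` for `k < L`,
then `(ℓ_f − ℓ_g)^{(k)}(0) = 0` for `k < L`: `f − g = g·(exp∘h − 1)` with `h = ℓ_f − ℓ_g`, so
`ord₀ (f − g) = ord₀ g + ord₀ (exp − 1) · ord₀ h = ord₀ h` (`analyticOrderAt_mul`, `AnalyticAt.analyticOrderAt_comp`). -/
theorem iteratedDeriv_sub_eq_zero_of_jets {f g ℓf ℓg : ℂ → ℂ} {U : Set ℂ} (hU : U ∈ 𝓝 (0 : ℂ))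
    (hf : DifferentiableOn ℂ f U) (hg : DifferentiableOn ℂ g U)
    (hℓf : DifferentiableOn ℂ ℓf U) (hℓg : DifferentiableOn ℂ ℓg U)
    (hef : ∀ z ∈ U, exp (ℓf z) = f z) (heg : ∀ z ∈ U, exp (ℓg z) = g z) (hg0 : g 0 ≠ 0)
    (h0 : ℓf 0 = ℓg 0) {L : ℕ} (hjet : ∀ k : ℕ, k < L → iteratedDeriv k f 0 = iteratedDeriv k g 0) :
    ∀ k : ℕ, k < L → iteratedDeriv k (ℓf - ℓg) 0 = 0 := by
  have hfa : AnalyticAt ℂ f 0 := hf.analyticAt hU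
  have hga : AnalyticAt ℂ g 0 := hg.analyticAt hU
  have hha : AnalyticAt ℂ (ℓf - ℓg) 0 := (hℓf.analyticAt hU).sub (hℓg.analyticAt hU)
  have hh0 : (ℓf - ℓg) 0 = 0 := by simp [h0]
  -- (a) `ord₀ (f - g) ≥ L`
  have h1 : (L : ℕ∞) ≤ analyticOrderAt (f - g) 0 := by
    rw [natCast_le_analyticOrderAt_iff_iteratedDeriv_eq_zero (hfa.sub hga)]
    intro i hi
    rw [iteratedDeriv_sub hfa.contDiffAt hga.contDiffAt, hjet i hi, sub_self]
  -- (b) `f - g = g · (E ∘ h)` near `0`, with `E w = exp w - 1`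
  have h2 : (f - g) =ᶠ[𝓝 0] (g * ((fun w => exp w - 1) ∘ (ℓf - ℓg))) := by
    filter_upwards [hU] with z hz
    simp only [Pi.sub_apply, Pi.mul_apply, Function.comp_apply]
    rw [← hef z hz, ← heg z hz, Complex.exp_sub]
    have hne : exp (ℓg z) ≠ 0 := Complex.exp_ne_zero _
    field_simp
  have hEa : ∀ w : ℂ, AnalyticAt ℂ (fun w => exp w - 1) w := fun w =>
    (Complex.differentiable_exp.sub (differentiable_const (1 : ℂ))).analyticAt w
  have hEord : analyticOrderAt (fun w => exp w - 1) ((ℓf - ℓg) 0) = 1 := by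
    rw [hh0]
    apply (hEa 0).analyticOrderAt_eq_one_of_zero_deriv_ne_zero
    · simp
    · have hd : deriv (fun w => exp w - 1) 0 = exp 0 := ((Complex.hasDerivAt_exp 0).sub_const 1).deriv
      rw [hd, Complex.exp_zero]
      exact one_ne_zero
  have h4 : (fun x => (ℓf - ℓg) x - (ℓf - ℓg) 0) = (ℓf - ℓg) := by
    funext x; rw [hh0, sub_zero]
  have h3 : analyticOrderAt (f - g) 0 = analyticOrderAt (ℓf - ℓg) 0 := by
    rw [analyticOrderAt_congr h2, analyticOrderAt_mul hga ((hEa _).comp hha),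
      hga.analyticOrderAt_eq_zero.mpr hg0, zero_add, (hEa _).analyticOrderAt_comp hha, hEord, one_mul, h4]
  rw [h3] at h1
  exact (natCast_le_analyticOrderAt_iff_iteratedDeriv_eq_zero hha).mp h1

/-! ## §4 Holomorphic logarithms on the corridor -/

/-- The corridor `(−η, b+η) × (−η, η)·i` is open and convex. -/
theorem corridor_isOpen_convex {η b : ℝ} {U : Set ℂ}
    (hU : U = {z : ℂ | -η < z.re ∧ z.re < b + η ∧ |z.im| < η}) : IsOpen U ∧ Convex ℝ U := by
  have hUeq : U = ({z : ℂ | -η < z.re} ∩ {z : ℂ | z.re < b + η}) ∩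
      ({z : ℂ | -η < z.im} ∩ {z : ℂ | z.im < η}) := by
    ext z
    simp only [hU, mem_setOf_eq, mem_inter_iff, abs_lt]
    tauto
  rw [hUeq]
  exact ⟨((isOpen_lt continuous_const continuous_re).inter (isOpen_lt continuous_re continuous_const)).inter
      ((isOpen_lt continuous_const continuous_im).inter (isOpen_lt continuous_im continuous_const)),
    ((convex_halfSpace_re_gt _).inter (convex_halfSpace_re_lt _)).inter
      ((convex_halfSpace_im_gt _).inter (convex_halfSpace_im_lt _))⟩

/-- Holomorphic logarithm of admissible corridor data: `f` holomorphic and zero-free on the corridor `U`,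
`‖f‖ ≤ e^M` on `U`, real with real part `≥ e^{−M} > 0` on the axis `⇒ f = exp ∘ ℓ` on `U` with `ℓ` holomorphic,
`Re ℓ ≤ M` on `U`, and `ℓ x = log (f x).re` for real `x ∈ (−η, b+η)` (existence on the convex open `U`:
`Literature.Analysis.Complex.exists_differentiableOn_exp_eq_of_starConvex`; the axis formula by uniqueness of
continuous logarithms on the interval, `Literature.Analysis.Complex.eqOn_of_exp_eqOn`). -/
theorem exists_log_on_corridor {η b M : ℝ} {f : ℂ → ℂ} {U : Set ℂ}
    (hU : U = {z : ℂ | -η < z.re ∧ z.re < b + η ∧ |z.im| < η}) (hη : 0 < η) (hb : 0 < b)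
    (hfd : DifferentiableOn ℂ f U) (hf0 : ∀ z ∈ U, f z ≠ 0) (hfM : ∀ z ∈ U, ‖f z‖ ≤ Real.exp M)
    (hfax : ∀ x : ℝ, -η < x → x < b + η → (f x).im = 0 ∧ Real.exp (-M) ≤ (f x).re) :
    ∃ ℓ : ℂ → ℂ, DifferentiableOn ℂ ℓ U ∧ (∀ z ∈ U, exp (ℓ z) = f z) ∧ (∀ z ∈ U, (ℓ z).re ≤ M) ∧
      ∀ x : ℝ, -η < x → x < b + η → ℓ x = ((Real.log (f x).re : ℝ) : ℂ) := by
  obtain ⟨hUo, hUc⟩ := corridor_isOpen_convex hU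
  have hmem : ∀ x : ℝ, -η < x → x < b + η → (x : ℂ) ∈ U := by
    intro x h1 h2
    rw [hU]
    simp only [mem_setOf_eq, ofReal_re, ofReal_im, abs_zero]
    exact ⟨h1, h2, hη⟩
  have h0U : (0 : ℂ) ∈ U := by simpa using hmem 0 (by linarith) (by linarith)
  -- positivity and realness on the axis
  have hreal : ∀ x : ℝ, -η < x → x < b + η → 0 < (f x).re ∧ f x = (((f x).re : ℝ) : ℂ) := by
    intro x h1 h2
    obtain ⟨him, hre⟩ := hfax x h1 h2
    refine ⟨lt_of_lt_of_le (Real.exp_pos _) hre, ?_⟩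
    apply Complex.ext <;> simp [him]
  have hexplog : ∀ x : ℝ, -η < x → x < b + η → exp ((Real.log (f x).re : ℝ) : ℂ) = f x := by
    intro x h1 h2
    obtain ⟨hpos, heq⟩ := hreal x h1 h2
    rw [← Complex.ofReal_exp, Real.exp_log hpos]
    exact heq.symm
  have hc₀ : exp ((Real.log (f 0).re : ℝ) : ℂ) = f 0 := by
    simpa using hexplog 0 (by linarith) (by linarith)
  obtain ⟨ℓ, hℓd, hℓ0, hℓe⟩ :=
    Literature.Analysis.Complex.exists_differentiableOn_exp_eq_of_starConvex hUo (hUc.starConvex h0U) h0U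
      hfd hf0 hc₀
  refine ⟨ℓ, hℓd, hℓe, ?_, ?_⟩
  · intro z hz
    have h1 : Real.exp (ℓ z).re ≤ Real.exp M := by
      rw [← Complex.norm_exp, hℓe z hz]
      exact hfM z hz
    exact Real.exp_le_exp.mp h1
  · intro x hx1 hx2
    have hs : IsPreconnected (Ioo (-η) (b + η)) := isPreconnected_Ioo
    have hmaps : MapsTo (fun y : ℝ => (y : ℂ)) (Ioo (-η) (b + η)) U := fun y hy => hmem y hy.1 hy.2
    have hG₁ : ContinuousOn (fun y : ℝ => ℓ y) (Ioo (-η) (b + η)) :=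
      hℓd.continuousOn.comp continuous_ofReal.continuousOn hmaps
    have hfre : ContinuousOn (fun y : ℝ => (f y).re) (Ioo (-η) (b + η)) :=
      continuous_re.comp_continuousOn (hfd.continuousOn.comp continuous_ofReal.continuousOn hmaps)
    have hG₂ : ContinuousOn (fun y : ℝ => ((Real.log (f y).re : ℝ) : ℂ)) (Ioo (-η) (b + η)) :=
      continuous_ofReal.comp_continuousOn (hfre.log fun y hy => (hreal y hy.1 hy.2).1.ne')
    have hx₀ : (0 : ℝ) ∈ Ioo (-η) (b + η) := ⟨by linarith, by linarith⟩
    have heq := Literature.Analysis.Complex.eqOn_of_exp_eqOn hs hG₁ hG₂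
      (fun y hy => by
        show exp (ℓ y) = exp ((Real.log (f y).re : ℝ) : ℂ)
        rw [hℓe _ (hmem y hy.1 hy.2), hexplog y hy.1 hy.2])
      hx₀ (by simpa using hℓ0)
    exact heq ⟨hx1, hx2⟩

/-! ## §5 Coefficient bounds for `h = ℓ_f − ℓ_g` at real centres; the disc chain -/

/-- Discs of radius `η/2` with real centre in `[0, b]` lie in the corridor. -/
theorem ball_subset_corridor {η b : ℝ} {U : Set ℂ}
    (hU : U = {z : ℂ | -η < z.re ∧ z.re < b + η ∧ |z.im| < η}) (hη : 0 < η) {c : ℝ} (hc0 : 0 ≤ c)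
    (hcb : c ≤ b) : ball (c : ℂ) (η / 2) ⊆ U := by
  intro z hz
  rw [mem_ball, dist_eq_norm] at hz
  have h1 : |(z - c).re| < η / 2 := lt_of_le_of_lt (abs_re_le_norm _) hz
  have h2 : |(z - c).im| < η / 2 := lt_of_le_of_lt (abs_im_le_norm _) hz
  simp only [sub_re, ofReal_re, sub_im, ofReal_im, sub_zero] at h1 h2
  rw [abs_lt] at h1
  rw [hU]
  simp only [mem_setOf_eq]
  exact ⟨by linarith [h1.1], by linarith [h1.2], by linarith⟩

/-- Coefficient bounds at a real centre `c ∈ [0, b]` for the difference `h = ℓ_f − ℓ_g` of two logarithms with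
`Re ℓ ≤ M` on the corridor and `ℓ(x)` real with `Re ℓ(x) ≥ −M` on `[0, b]`:
`‖h^{(k)}(c)‖ ≤ k!·8M/(η/2)^k` for every `k` (Borel–Carathéodory for `k ≥ 1`, directly for `k = 0`). -/
theorem coeff_bounds_sub_log {ℓf ℓg : ℂ → ℂ} {U : Set ℂ} {η b M : ℝ}
    (hU : U = {z : ℂ | -η < z.re ∧ z.re < b + η ∧ |z.im| < η}) (hη : 0 < η) (hM : 0 ≤ M)
    (hℓfd : DifferentiableOn ℂ ℓf U) (hℓgd : DifferentiableOn ℂ ℓg U)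
    (hℓfM : ∀ z ∈ U, (ℓf z).re ≤ M) (hℓgM : ∀ z ∈ U, (ℓg z).re ≤ M)
    (hℓfax : ∀ x : ℝ, 0 ≤ x → x ≤ b → (ℓf x).im = 0 ∧ -M ≤ (ℓf x).re)
    (hℓgax : ∀ x : ℝ, 0 ≤ x → x ≤ b → (ℓg x).im = 0 ∧ -M ≤ (ℓg x).re)
    {c : ℝ} (hc0 : 0 ≤ c) (hcb : c ≤ b) :
    DifferentiableOn ℂ (ℓf - ℓg) (ball (c : ℂ) (η / 2)) ∧
      ∀ k : ℕ, ‖iteratedDeriv k (ℓf - ℓg) c‖ ≤ k.factorial * (8 * M) / (η / 2) ^ k := by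
  have hsub := ball_subset_corridor hU hη hc0 hcb
  have hR : 0 < η / 2 := by positivity
  have hfd := hℓfd.mono hsub
  have hgd := hℓgd.mono hsub
  refine ⟨hfd.sub hgd, fun k => ?_⟩
  have hcU : (c : ℂ) ∈ U := hsub (mem_ball_self hR)
  obtain ⟨hfi, hfr⟩ := hℓfax c hc0 hcb
  obtain ⟨hgi, hgr⟩ := hℓgax c hc0 hcb
  have hfr' := hℓfM c hcU
  have hgr' := hℓgM c hcU
  rcases Nat.eq_zero_or_pos k with rfl | hk
  · have hval : (ℓf - ℓg) (c : ℂ) = (((ℓf c).re - (ℓg c).re : ℝ) : ℂ) := by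
      apply Complex.ext <;> simp [hfi, hgi]
    simp only [iteratedDeriv_zero, Nat.factorial_zero, Nat.cast_one, one_mul, pow_zero, div_one, hval,
      Complex.norm_real, Real.norm_eq_abs]
    rw [abs_le]
    constructor <;> linarith
  · have hfa : AnalyticAt ℂ ℓf c := hfd.analyticAt (ball_mem_nhds _ hR)
    have hga : AnalyticAt ℂ ℓg c := hgd.analyticAt (ball_mem_nhds _ hR)
    rw [iteratedDeriv_sub hfa.contDiffAt hga.contDiffAt]
    have h1 := norm_iteratedDeriv_le_of_re_le hR hfd (fun z hz => hℓfM z (hsub hz)) hk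
    have h2 := norm_iteratedDeriv_le_of_re_le hR hgd (fun z hz => hℓgM z (hsub hz)) hk
    have hfac : (0 : ℝ) ≤ 2 * k.factorial := by positivity
    have hRk : (0 : ℝ) < (η / 2) ^ k := pow_pos hR k
    have ha : 2 * (k.factorial : ℝ) * (M - (ℓf c).re) ≤ 2 * k.factorial * (2 * M) :=
      mul_le_mul_of_nonneg_left (by linarith) hfac
    have hb' : 2 * (k.factorial : ℝ) * (M - (ℓg c).re) ≤ 2 * k.factorial * (2 * M) :=
      mul_le_mul_of_nonneg_left (by linarith) hfac
    calc ‖iteratedDeriv k ℓf c - iteratedDeriv k ℓg c‖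
        ≤ ‖iteratedDeriv k ℓf c‖ + ‖iteratedDeriv k ℓg c‖ := norm_sub_le _ _
      _ ≤ 2 * k.factorial * (M - (ℓf c).re) / (η / 2) ^ k +
            2 * k.factorial * (M - (ℓg c).re) / (η / 2) ^ k := add_le_add h1 h2
      _ ≤ 2 * k.factorial * (2 * M) / (η / 2) ^ k + 2 * k.factorial * (2 * M) / (η / 2) ^ k :=
          add_le_add (div_le_div_of_nonneg_right ha hRk.le) (div_le_div_of_nonneg_right hb' hRk.le)
      _ = k.factorial * (8 * M) / (η / 2) ^ k := by ring

/-- Arithmetic of one chain step: with `2N ≤ e`,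
`4·(3·5^j·A·2^{−e})·2^N + 2A·2^{−N} ≤ 3·5^{j+1}·A·2^{−N}`. -/
theorem chain_step_arith {A : ℝ} (hA : 0 ≤ A) (j e N : ℕ) (hN : 2 * N ≤ e) :
    4 * (3 * 5 ^ j * A * (1 / 2 : ℝ) ^ e) * 2 ^ N + 2 * A * (1 / 2) ^ N ≤
      3 * 5 ^ (j + 1) * A * (1 / 2) ^ N := by
  have hx : (0 : ℝ) < (1 / 2 : ℝ) ^ N := by positivity
  have hP : (1 : ℝ) ≤ 5 ^ j := one_le_pow₀ (by norm_num)
  have h1 : (1 / 2 : ℝ) ^ e ≤ (1 / 2) ^ (2 * N) :=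
    pow_le_pow_of_le_one (by norm_num) (by norm_num) hN
  have h2 : (1 / 2 : ℝ) ^ (2 * N) * 2 ^ N = (1 / 2) ^ N := by
    rw [pow_mul, ← mul_pow]
    norm_num
  have hAx : 0 ≤ A * (1 / 2 : ℝ) ^ N := mul_nonneg hA hx.le
  have h3 : A * (1 / 2 : ℝ) ^ N * 1 ≤ A * (1 / 2) ^ N * 5 ^ j := mul_le_mul_of_nonneg_left hP hAx
  have h5A : (0 : ℝ) ≤ 4 * (3 * 5 ^ j * A) * 2 ^ N := by positivity
  calc 4 * (3 * 5 ^ j * A * (1 / 2 : ℝ) ^ e) * 2 ^ N + 2 * A * (1 / 2) ^ N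
      = 4 * (3 * 5 ^ j * A) * 2 ^ N * (1 / 2 : ℝ) ^ e + 2 * A * (1 / 2) ^ N := by ring
    _ ≤ 4 * (3 * 5 ^ j * A) * 2 ^ N * (1 / 2 : ℝ) ^ (2 * N) + 2 * A * (1 / 2) ^ N := by
        have := mul_le_mul_of_nonneg_left h1 h5A
        linarith
    _ = 12 * 5 ^ j * A * ((1 / 2 : ℝ) ^ (2 * N) * 2 ^ N) + 2 * A * (1 / 2) ^ N := by ring
    _ = 12 * 5 ^ j * A * (1 / 2) ^ N + 2 * A * (1 / 2) ^ N := by rw [h2]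
    _ ≤ 12 * 5 ^ j * A * (1 / 2) ^ N + 3 * 5 ^ j * A * (1 / 2) ^ N := by nlinarith [h3, hAx]
    _ = 3 * 5 ^ (j + 1) * A * (1 / 2) ^ N := by ring

/-- The disc chain: `h` holomorphic on the discs `ball (j s) R`, `j ≤ n`, with the uniform coefficient bound
`‖h^{(k)}(j s)‖ ≤ k!·A/R^k`, step `0 ≤ s ≤ R/4`, and `h^{(k)}(0) = 0` for `k < L`
`⇒ ‖h‖ ≤ 3·5^j·A·2^{−⌊L/2^j⌋}` on `closedBall (j s) (R/2)` for every `j ≤ n` (induction on `j`, each step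
`norm_le_two_radii` with `N = ⌊L/2^{j+1}⌋`). -/
theorem chain_bound {h : ℂ → ℂ} {R s A : ℝ} {L n : ℕ} (hR : 0 < R) (hs0 : 0 ≤ s) (hs : s ≤ R / 4)
    (hA : 0 ≤ A)
    (hdiff : ∀ j : ℕ, j ≤ n → DifferentiableOn ℂ h (ball (((j : ℝ) * s : ℝ) : ℂ) R))
    (hbig : ∀ j : ℕ, j ≤ n → ∀ k : ℕ,
      ‖iteratedDeriv k h (((j : ℝ) * s : ℝ) : ℂ)‖ ≤ k.factorial * A / R ^ k)
    (hjet : ∀ k : ℕ, k < L → iteratedDeriv k h 0 = 0) :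
    ∀ j : ℕ, j ≤ n → ∀ z ∈ closedBall (((j : ℝ) * s : ℝ) : ℂ) (R / 2),
      ‖h z‖ ≤ 3 * 5 ^ j * A * (1 / 2 : ℝ) ^ (L / 2 ^ j) := by
  intro j
  induction j with
  | zero =>
    intro _ z hz
    have hd := hdiff 0 (Nat.zero_le _)
    have hb := hbig 0 (Nat.zero_le _)
    simp only [Nat.cast_zero, zero_mul, ofReal_zero] at hz hd hb
    have hfin0 : ∀ k : ℕ, k < L → ‖iteratedDeriv k h 0‖ ≤ k.factorial * 0 / (R / 4) ^ k := by
      intro k hk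
      rw [hjet k hk, norm_zero]
      simp
    have h1 := norm_le_of_taylor_split hR hd hA le_rfl hb L hfin0 hz
    have h2 : 0 ≤ A * (1 / 2 : ℝ) ^ L := by positivity
    simp only [pow_zero, Nat.div_one, mul_one]
    linarith
  | succ j ih =>
    intro hj z hz
    have hj' : j ≤ n := Nat.le_of_succ_le hj
    have hd : dist ((((j + 1 : ℕ) : ℝ) * s : ℝ) : ℂ) ((((j : ℕ) : ℝ) * s : ℝ) : ℂ) = s := by
      rw [dist_eq_norm, ← Complex.ofReal_sub, Complex.norm_real, Real.norm_eq_abs, Nat.cast_succ,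
        show ((j : ℝ) + 1) * s - (j : ℝ) * s = s by ring, abs_of_nonneg hs0]
    have hε : ∀ w ∈ ball ((((j + 1 : ℕ) : ℝ) * s : ℝ) : ℂ) (R / 4),
        ‖h w‖ ≤ 3 * 5 ^ j * A * (1 / 2 : ℝ) ^ (L / 2 ^ j) := by
      intro w hw
      apply ih hj' w
      rw [mem_closedBall]
      rw [mem_ball] at hw
      calc dist w ((((j : ℕ) : ℝ) * s : ℝ) : ℂ)
          ≤ dist w ((((j + 1 : ℕ) : ℝ) * s : ℝ) : ℂ) +
              dist ((((j + 1 : ℕ) : ℝ) * s : ℝ) : ℂ) ((((j : ℕ) : ℝ) * s : ℝ) : ℂ) := dist_triangle _ _ _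
        _ ≤ R / 4 + s := by rw [hd]; linarith
        _ ≤ R / 2 := by linarith
    have hN : 2 * (L / 2 ^ (j + 1)) ≤ L / 2 ^ j := by
      rw [pow_succ, ← Nat.div_div_eq_div_mul]
      exact Nat.mul_div_le (L / 2 ^ j) 2
    calc ‖h z‖ ≤ 4 * (3 * 5 ^ j * A * (1 / 2 : ℝ) ^ (L / 2 ^ j)) * 2 ^ (L / 2 ^ (j + 1)) +
          2 * A * (1 / 2) ^ (L / 2 ^ (j + 1)) :=
        norm_le_two_radii hR (hdiff (j + 1) hj) hA (hbig (j + 1) hj) hε (L / 2 ^ (j + 1)) hz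
      _ ≤ 3 * 5 ^ (j + 1) * A * (1 / 2) ^ (L / 2 ^ (j + 1)) := chain_step_arith hA j _ _ hN

/-! ## §6 The rate constant and the main theorem -/

/-- The `n`-fold square root `r_n` of `1/2`: `0 < r_n < 1` and `r_n^{2^n} = 1/2`. -/
theorem sqrt_iterate_half (n : ℕ) :
    0 < Real.sqrt^[n] (1 / 2 : ℝ) ∧ Real.sqrt^[n] (1 / 2 : ℝ) < 1 ∧
      (Real.sqrt^[n] (1 / 2 : ℝ)) ^ (2 ^ n) = 1 / 2 := by
  induction n with
  | zero => norm_num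
  | succ n ih =>
    obtain ⟨h0, h1, h2⟩ := ih
    rw [Function.iterate_succ_apply']
    refine ⟨Real.sqrt_pos.mpr h0, ?_, ?_⟩
    · rw [Real.sqrt_lt' one_pos]
      simpa using h1
    · rw [pow_succ, pow_mul', Real.sq_sqrt h0.le, h2]

/-- Exponent bookkeeping: if `0 ≤ r ≤ 1` and `r^q = 1/2` (`q > 0`) then `2^{−⌊L/q⌋} ≤ 2·r^L`. -/
theorem half_pow_div_le {r : ℝ} (hr0 : 0 ≤ r) (hr1 : r ≤ 1) {q : ℕ} (hq : 0 < q)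
    (hrq : r ^ q = 1 / 2) (L : ℕ) : (1 / 2 : ℝ) ^ (L / q) ≤ 2 * r ^ L := by
  have hlt : L < q * (L / q + 1) := Nat.lt_mul_div_succ L hq
  have h1 : r ^ (q * (L / q + 1)) ≤ r ^ L := pow_le_pow_of_le_one hr0 hr1 hlt.le
  have h2 : r ^ (q * (L / q + 1)) = (1 / 2 : ℝ) ^ (L / q) * (1 / 2) := by
    rw [pow_mul, hrq, pow_succ]
  rw [h2] at h1
  linarith

/-- **Corridor transfer** (the registered stub `stub_corridorTransfer` of line `zerofree_corridor`, structure-free):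
for `η, b > 0` there are `C > 0`, `0 ≤ r < 1` such that two functions holomorphic and zero-free on the corridor
`(−η, b+η) × (−η, η)·i`, bounded by `e^M` there, real with real part `≥ e^{−M}` on the axis, whose derivatives
at `0` agree up to order `L`, satisfy `|log f(b) − log g(b)| ≤ C·(M+1)·r^L`.  Here `C = 48·5^n`,
`r = (1/2)^{2^{−n}}`, `n = ⌈8b/η⌉`. -/
theorem corridorTransfer {η b : ℝ} (hη : 0 < η) (hb : 0 < b) :
    ∃ C r : ℝ, 0 < C ∧ 0 ≤ r ∧ r < 1 ∧
      ∀ (L : ℕ) (M : ℝ) (f g : ℂ → ℂ), 0 ≤ M →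
        DifferentiableOn ℂ f {z : ℂ | -η < z.re ∧ z.re < b + η ∧ |z.im| < η} →
        (∀ z ∈ {z : ℂ | -η < z.re ∧ z.re < b + η ∧ |z.im| < η}, f z ≠ 0) →
        (∀ z ∈ {z : ℂ | -η < z.re ∧ z.re < b + η ∧ |z.im| < η}, ‖f z‖ ≤ Real.exp M) →
        (∀ x : ℝ, -η < x → x < b + η → (f x).im = 0 ∧ Real.exp (-M) ≤ (f x).re) →
        DifferentiableOn ℂ g {z : ℂ | -η < z.re ∧ z.re < b + η ∧ |z.im| < η} →
        (∀ z ∈ {z : ℂ | -η < z.re ∧ z.re < b + η ∧ |z.im| < η}, g z ≠ 0) →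
        (∀ z ∈ {z : ℂ | -η < z.re ∧ z.re < b + η ∧ |z.im| < η}, ‖g z‖ ≤ Real.exp M) →
        (∀ x : ℝ, -η < x → x < b + η → (g x).im = 0 ∧ Real.exp (-M) ≤ (g x).re) →
        (∀ k : ℕ, k < L → iteratedDeriv k f 0 = iteratedDeriv k g 0) →
        |Real.log (f b).re - Real.log (g b).re| ≤ C * (M + 1) * r ^ L := by
  -- the constants
  set n : ℕ := ⌈8 * b / η⌉₊ with hn_def
  have hn_pos : 0 < n := Nat.ceil_pos.mpr (by positivity)
  have hn_ge : 8 * b / η ≤ n := Nat.le_ceil _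
  have hn_real_pos : (0 : ℝ) < n := by exact_mod_cast hn_pos
  have hn0 : (n : ℝ) ≠ 0 := hn_real_pos.ne'
  obtain ⟨hr0, hr1, hrq⟩ := sqrt_iterate_half n
  refine ⟨48 * 5 ^ n, Real.sqrt^[n] (1 / 2 : ℝ), by positivity, hr0.le, hr1, ?_⟩
  intro L M f g hM hfd hf0 hfM hfax hgd hg0 hgM hgax hjet
  set U : Set ℂ := {z : ℂ | -η < z.re ∧ z.re < b + η ∧ |z.im| < η} with hU
  -- logarithms
  obtain ⟨ℓf, hℓfd, hℓfe, hℓfM, hℓfax⟩ := exists_log_on_corridor hU hη hb hfd hf0 hfM hfax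
  obtain ⟨ℓg, hℓgd, hℓge, hℓgM, hℓgax⟩ := exists_log_on_corridor hU hη hb hgd hg0 hgM hgax
  -- axis facts for the logarithms
  have haxis : ∀ (F ℓ : ℂ → ℂ),
      (∀ x : ℝ, -η < x → x < b + η → (F x).im = 0 ∧ Real.exp (-M) ≤ (F x).re) →
      (∀ x : ℝ, -η < x → x < b + η → ℓ x = ((Real.log (F x).re : ℝ) : ℂ)) →
      ∀ x : ℝ, 0 ≤ x → x ≤ b → (ℓ x).im = 0 ∧ -M ≤ (ℓ x).re := by
    intro F ℓ hFax hℓax x h1 h2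
    have h1' : -η < x := by linarith
    have h2' : x < b + η := by linarith
    have hpos : 0 < (F x).re := lt_of_lt_of_le (Real.exp_pos _) (hFax x h1' h2').2
    rw [hℓax x h1' h2']
    simp only [ofReal_im, ofReal_re]
    exact ⟨trivial, (Real.le_log_iff_exp_le hpos).mpr (hFax x h1' h2').2⟩
  -- coefficient bounds at the real centres
  have hcoef : ∀ c : ℝ, 0 ≤ c → c ≤ b → DifferentiableOn ℂ (ℓf - ℓg) (ball (c : ℂ) (η / 2)) ∧
      ∀ k : ℕ, ‖iteratedDeriv k (ℓf - ℓg) c‖ ≤ k.factorial * (8 * M) / (η / 2) ^ k :=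
    fun c hc0 hcb => coeff_bounds_sub_log hU hη hM hℓfd hℓgd hℓfM hℓgM (haxis f ℓf hfax hℓfax)
      (haxis g ℓg hgax hℓgax) hc0 hcb
  -- the jets of `h = ℓf - ℓg` vanish to order `L` at `0`
  have hjetH : ∀ k : ℕ, k < L → iteratedDeriv k (ℓf - ℓg) 0 = 0 := by
    rcases Nat.eq_zero_or_pos L with hL | hL
    · intro k hk; omega
    · have h0U : (0 : ℂ) ∈ U := by
        rw [hU]
        simp only [mem_setOf_eq, zero_re, zero_im, abs_zero]
        exact ⟨by linarith, by linarith, hη⟩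
      have hUn : U ∈ 𝓝 (0 : ℂ) := (corridor_isOpen_convex hU).1.mem_nhds h0U
      have hfg0 : f 0 = g 0 := by simpa using hjet 0 hL
      have hℓ0 : ℓf 0 = ℓg 0 := by
        have h1 := hℓfax 0 (by linarith) (by linarith)
        have h2 := hℓgax 0 (by linarith) (by linarith)
        simp only [ofReal_zero] at h1 h2
        rw [h1, h2, hfg0]
      exact iteratedDeriv_sub_eq_zero_of_jets hUn hfd hgd hℓfd hℓgd hℓfe hℓge (hg0 0 h0U) hℓ0 hjet
  -- the chain of discs with centres `j·s`, `s = b/n ≤ η/8`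
  set s : ℝ := b / n with hs_def
  have hs0 : 0 ≤ s := by positivity
  have h8 : 8 * b ≤ (n : ℝ) * η := by
    have := hn_ge
    rwa [div_le_iff₀ hη] at this
  have hsR : s ≤ η / 2 / 4 := by
    rw [hs_def, div_le_iff₀ hn_real_pos]
    linarith
  have hnb : (n : ℝ) * s = b := by
    rw [hs_def]
    field_simp
  have hcent : ∀ j : ℕ, j ≤ n → 0 ≤ (j : ℝ) * s ∧ (j : ℝ) * s ≤ b := by
    intro j hj
    refine ⟨by positivity, ?_⟩
    have hjn : (j : ℝ) ≤ n := by exact_mod_cast hj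
    calc (j : ℝ) * s ≤ n * s := mul_le_mul_of_nonneg_right hjn hs0
      _ = b := hnb
  have hR : (0 : ℝ) < η / 2 := by positivity
  have hA : (0 : ℝ) ≤ 8 * M := by positivity
  have hchain := chain_bound (h := ℓf - ℓg) (L := L) (n := n) hR hs0 hsR hA
    (fun j hj => (hcoef _ (hcent j hj).1 (hcent j hj).2).1)
    (fun j hj => (hcoef _ (hcent j hj).1 (hcent j hj).2).2) hjetH
  have hmemb : (b : ℂ) ∈ closedBall (((n : ℝ) * s : ℝ) : ℂ) (η / 2 / 2) := by
    rw [hnb]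
    exact mem_closedBall_self (by positivity)
  have hfin := hchain n le_rfl (b : ℂ) hmemb
  -- evaluate `h b`
  have hb1 : -η < b := by linarith
  have hb2 : b < b + η := by linarith
  have hval : (ℓf - ℓg) (b : ℂ) = ((Real.log (f b).re - Real.log (g b).re : ℝ) : ℂ) := by
    rw [Pi.sub_apply, hℓfax b hb1 hb2, hℓgax b hb1 hb2, ← Complex.ofReal_sub]
  rw [hval, Complex.norm_real, Real.norm_eq_abs] at hfin
  have hq : 0 < 2 ^ n := pow_pos two_pos n
  have hexp := half_pow_div_le hr0.le hr1.le hq hrq L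
  have hrL : (0 : ℝ) ≤ (Real.sqrt^[n] (1 / 2 : ℝ)) ^ L := pow_nonneg hr0.le L
  calc |Real.log (f b).re - Real.log (g b).re|
      ≤ 3 * 5 ^ n * (8 * M) * (1 / 2 : ℝ) ^ (L / 2 ^ n) := hfin
    _ ≤ 3 * 5 ^ n * (8 * M) * (2 * (Real.sqrt^[n] (1 / 2 : ℝ)) ^ L) :=
        mul_le_mul_of_nonneg_left hexp (by positivity)
    _ = 48 * 5 ^ n * M * (Real.sqrt^[n] (1 / 2 : ℝ)) ^ L := by ring
    _ ≤ 48 * 5 ^ n * (M + 1) * (Real.sqrt^[n] (1 / 2 : ℝ)) ^ L := by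
        apply mul_le_mul_of_nonneg_right _ hrL
        exact mul_le_mul_of_nonneg_left (by linarith) (by positivity)

end Summit.Ventures.CertifiedManyBodySolver.Cruxes.ThermalStiffnessCeilingU8b10_le_1o8.ZerofreeCorridor.CorridorTransfer

end

noncomputable section

namespace Summit.Ventures.CertifiedManyBodySolver.Cruxes.ThermalStiffnessCeilingU8b10_le_1o8.ZerofreeCorridor

open Matrix Finset Polynomial
open Literature.MathematicalPhysics.QuantumLattice
open Literature.MathematicalPhysics.QuantumFieldTheory
open scoped ComplexConjugate

/-! ## §A1 Trinomial pencils: `tr (M₀ + u M₊ + u⁻¹ M₋)^k` is a trigonometric polynomial of degree `≤ k` -/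

section Pencil

variable {m : Type*} [Fintype m] [DecidableEq m]

/-- The polynomial lift `Q(X) = M₋ + X M₀ + X² M₊` of the pencil (so that `u⁻¹ Q(u) = M₀ + u M₊ + u⁻¹ M₋`). -/
def pencilPoly (M₀ Mp Mm : Matrix m m ℂ) : Matrix m m ℂ[X] :=
  Mm.map Polynomial.C + (Polynomial.X : ℂ[X]) • M₀.map Polynomial.C + ((Polynomial.X : ℂ[X]) ^ 2) • Mp.map Polynomial.C

omit [Fintype m] [DecidableEq m] in
/-- Every entry of the lift has degree `≤ 2`. [folklore] -/
theorem natDegree_pencilPoly_apply_le (M₀ Mp Mm : Matrix m m ℂ) (i j : m) :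
    (pencilPoly M₀ Mp Mm i j).natDegree ≤ 2 := by
  simp only [pencilPoly, Matrix.add_apply, Matrix.smul_apply, Matrix.map_apply, smul_eq_mul]
  refine (natDegree_add_le _ _).trans (max_le ((natDegree_add_le _ _).trans (max_le ?_ ?_)) ?_)
  · rw [natDegree_C]; omega
  · exact (natDegree_mul_C_le _ _).trans (natDegree_X_le.trans (by omega))
  · exact (natDegree_mul_C_le _ _).trans (natDegree_X_pow_le 2)

/-- Every entry of the `k`-th power of the lift has degree `≤ 2k`. [folklore] -/
theorem natDegree_pencilPoly_pow_apply_le (M₀ Mp Mm : Matrix m m ℂ) (k : ℕ) (i j : m) :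
    ((pencilPoly M₀ Mp Mm ^ k) i j).natDegree ≤ 2 * k := by
  induction k generalizing i j with
  | zero =>
    rw [pow_zero, one_apply]
    split_ifs <;> simp
  | succ k ih =>
    rw [pow_succ, Matrix.mul_apply]
    refine natDegree_sum_le_of_forall_le _ _ fun l _ => ?_
    exact natDegree_mul_le.trans (by have := ih i l; have := natDegree_pencilPoly_apply_le M₀ Mp Mm l j; omega)

/-- The trace of the `k`-th power of the lift has degree `≤ 2k`. [folklore] -/
theorem natDegree_trace_pencilPoly_pow_le (M₀ Mp Mm : Matrix m m ℂ) (k : ℕ) :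
    ((pencilPoly M₀ Mp Mm ^ k).trace).natDegree ≤ 2 * k := by
  unfold Matrix.trace
  exact natDegree_sum_le_of_forall_le _ _ fun i _ => natDegree_pencilPoly_pow_apply_le M₀ Mp Mm k i i

omit [Fintype m] [DecidableEq m] in
/-- Evaluating the lift at `u` gives `M₋ + u M₀ + u² M₊`. [folklore] -/
theorem pencilPoly_map_eval (M₀ Mp Mm : Matrix m m ℂ) (u : ℂ) :
    (pencilPoly M₀ Mp Mm).map (Polynomial.eval u) = Mm + u • M₀ + (u ^ 2) • Mp := by
  ext i j
  simp only [pencilPoly, Matrix.map_apply, Matrix.add_apply, Matrix.smul_apply, smul_eq_mul, Polynomial.eval_add,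
    Polynomial.eval_mul, Polynomial.eval_C, Polynomial.eval_X, Polynomial.eval_pow]

/-- **(A1)** On the unit circle `u = e^{iψ}`: `tr (M₀ + u M₊ + u⁻¹ M₋)^k = Σ_{d ≤ 2k} g_d e^{i(d-k)ψ}` with the
coefficients `g_d` of `tr Q(X)^k` (independent of `ψ`). [folklore] -/
theorem trace_pencil_pow_eq_sum (M₀ Mp Mm : Matrix m m ℂ) (k : ℕ) :
    ∃ g : ℕ → ℂ, ∀ ψ : ℝ,
      ((M₀ + Complex.exp ((ψ : ℂ) * Complex.I) • Mp + Complex.exp (-((ψ : ℂ) * Complex.I)) • Mm) ^ k).trace =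
        ∑ d ∈ Finset.range (2 * k + 1), g d * Complex.exp ((ψ : ℂ) * Complex.I * ((d : ℂ) - k)) := by
  refine ⟨fun d => ((pencilPoly M₀ Mp Mm ^ k).trace).coeff d, fun ψ => ?_⟩
  set u : ℂ := Complex.exp ((ψ : ℂ) * Complex.I) with hu
  set v : ℂ := Complex.exp (-((ψ : ℂ) * Complex.I)) with hv
  have hvu : v * u = 1 := by rw [hu, hv, ← Complex.exp_add, neg_add_cancel, Complex.exp_zero]
  -- `M₀ + u Mp + v Mm = v • Q(u)`
  have hpencil : M₀ + u • Mp + v • Mm = v • (Mm + u • M₀ + (u ^ 2) • Mp) := by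
    rw [smul_add, smul_add, smul_smul, smul_smul, hvu, one_smul, pow_two, ← mul_assoc, hvu, one_mul]
    abel
  have htrace : ((Mm + u • M₀ + (u ^ 2) • Mp) ^ k).trace = ((pencilPoly M₀ Mp Mm ^ k).trace).eval u := by
    rw [← pencilPoly_map_eval, ← Polynomial.coe_evalRingHom, ← Matrix.map_pow, AddMonoidHom.map_trace]
  rw [hpencil, _root_.smul_pow, trace_smul, smul_eq_mul, htrace,
    eval_eq_sum_range' (n := 2 * k + 1) (lt_of_le_of_lt (natDegree_trace_pencilPoly_pow_le M₀ Mp Mm k) (by omega)),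
    Finset.mul_sum]
  refine Finset.sum_congr rfl fun d _ => ?_
  have hexp : v ^ k * u ^ d = Complex.exp ((ψ : ℂ) * Complex.I * ((d : ℂ) - k)) := by
    rw [hu, hv, ← Complex.exp_nat_mul, ← Complex.exp_nat_mul, ← Complex.exp_add]
    congr 1
    ring
  rw [← hexp]
  ring

end Pencil

/-! ## §A2 A trigonometric polynomial of degree `k < L` with period `2π/L` is constant -/

/-- Root-of-unity sums: `Σ_{l<L} e^{2πi l (d-k)/L} = 0` unless `L ∣ (d - k)`; here `|d - k| < L`, `d ≠ k`. [folklore] -/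
theorem sum_exp_two_pi_mul_div_eq_zero {k L D d : ℕ} (hkL : k < L) (hD : D ≤ k + L) (hd : d < D) (hdk : d ≠ k) :
    ∑ l ∈ Finset.range L, Complex.exp (((2 * Real.pi * l / L : ℝ) : ℂ) * Complex.I * ((d : ℂ) - k)) = 0 := by
  have hL0 : (L : ℂ) ≠ 0 := by exact_mod_cast (show L ≠ 0 by omega)
  set ω : ℂ := Complex.exp (2 * Real.pi * Complex.I * ((d : ℂ) - k) / L) with hω
  have hterm : ∀ l : ℕ, Complex.exp (((2 * Real.pi * l / L : ℝ) : ℂ) * Complex.I * ((d : ℂ) - k)) = ω ^ l := by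
    intro l
    rw [hω, ← Complex.exp_nat_mul]
    congr 1
    push_cast
    field_simp
  simp_rw [hterm]
  have hω1 : ω ≠ 1 := by
    intro h
    rw [hω, Complex.exp_eq_one_iff] at h
    obtain ⟨n, hn⟩ := h
    have hπ : (2 * (Real.pi : ℂ) * Complex.I) ≠ 0 := by simp [Real.pi_ne_zero, Complex.I_ne_zero]
    have h2 : ((d : ℂ) - k) = n * L := by
      have e1 : ((d : ℂ) - k) = (2 * Real.pi * Complex.I * ((d : ℂ) - k) / L) * L / (2 * Real.pi * Complex.I) := by
        field_simp
      rw [e1, hn]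
      field_simp
    have h3 : ((d : ℤ) - k : ℤ) = n * L := by exact_mod_cast h2
    have hd1 : (d : ℤ) < k + L := by exact_mod_cast (lt_of_lt_of_le hd hD)
    have hd0 : (0 : ℤ) ≤ d := by positivity
    have hk1 : (k : ℤ) < L := by exact_mod_cast hkL
    have hdk' : (d : ℤ) ≠ k := by exact_mod_cast hdk
    rcases lt_trichotomy n 0 with hn0 | hn0 | hn0
    · nlinarith
    · rw [hn0, zero_mul] at h3
      exact hdk' (by omega)
    · nlinarith
  have hωL : ω ^ L = 1 := by
    rw [hω, ← Complex.exp_nat_mul]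
    have : (L : ℂ) * (2 * Real.pi * Complex.I * ((d : ℂ) - k) / L) = (((d : ℤ) - k : ℤ) : ℂ) * (2 * Real.pi * Complex.I) := by
      push_cast
      field_simp
    rw [this, Complex.exp_int_mul_two_pi_mul_I]
  rw [geom_sum_eq hω1, hωL, sub_self, zero_div]

/-- **(A2)** If `f(ψ) = Σ_{d<D} g_d e^{i(d-k)ψ}` with `D ≤ k + L`, `k < L`, and `f(ψ + 2π/L) = f(ψ)`, then `f` is constant:
averaging over the `L` shifts kills every frequency `d - k ≠ 0` (all have `|d - k| < L`). [folklore] -/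
theorem trigPoly_eq_const_of_periodic {k L D : ℕ} (hkL : k < L) (hD : D ≤ k + L) (g : ℕ → ℂ) (f : ℝ → ℂ)
    (hf : ∀ ψ : ℝ, f ψ = ∑ d ∈ Finset.range D, g d * Complex.exp ((ψ : ℂ) * Complex.I * ((d : ℂ) - k)))
    (hper : ∀ ψ : ℝ, f (ψ + 2 * Real.pi / L) = f ψ) : ∀ ψ : ℝ, f ψ = f 0 := by
  have hL0 : (L : ℂ) ≠ 0 := by exact_mod_cast (show L ≠ 0 by omega)
  -- the constant
  set c : ℂ := ∑ d ∈ Finset.range D, if d = k then g d else 0 with hc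
  -- iterated periodicity
  have hshift : ∀ (l : ℕ) (ψ : ℝ), f (ψ + 2 * Real.pi * l / L) = f ψ := by
    intro l
    induction l with
    | zero => intro ψ; simp
    | succ l ih =>
      intro ψ
      have : ψ + 2 * Real.pi * (l + 1 : ℕ) / L = (ψ + 2 * Real.pi * l / L) + 2 * Real.pi / L := by
        push_cast; ring
      rw [this, hper, ih]
  have hmain : ∀ ψ : ℝ, (L : ℂ) * f ψ = (L : ℂ) * c := by
    intro ψ
    have hsum : ∑ l ∈ Finset.range L, f (ψ + 2 * Real.pi * l / L) = (L : ℂ) * f ψ := by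
      rw [Finset.sum_congr rfl fun l _ => hshift l ψ, Finset.sum_const, Finset.card_range, nsmul_eq_mul]
    rw [← hsum]
    simp_rw [hf]
    rw [Finset.sum_comm]
    have hsplit : ∀ (d l : ℕ), g d * Complex.exp (((ψ + 2 * Real.pi * l / L : ℝ) : ℂ) * Complex.I * ((d : ℂ) - k)) =
        g d * Complex.exp ((ψ : ℂ) * Complex.I * ((d : ℂ) - k)) *
          Complex.exp (((2 * Real.pi * l / L : ℝ) : ℂ) * Complex.I * ((d : ℂ) - k)) := by
      intro d l
      rw [show ((ψ + 2 * Real.pi * l / L : ℝ) : ℂ) * Complex.I * ((d : ℂ) - k) =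
          (ψ : ℂ) * Complex.I * ((d : ℂ) - k) + ((2 * Real.pi * l / L : ℝ) : ℂ) * Complex.I * ((d : ℂ) - k) by
            push_cast; ring,
        Complex.exp_add]
      ring
    simp_rw [hsplit, ← Finset.mul_sum]
    rw [hc, Finset.mul_sum]
    refine Finset.sum_congr rfl fun d hd => ?_
    rw [Finset.mem_range] at hd
    by_cases hdk : d = k
    · subst hdk
      rw [if_pos rfl]
      have h1 : ∀ l : ℕ, Complex.exp (((2 * Real.pi * l / L : ℝ) : ℂ) * Complex.I * ((d : ℂ) - d)) = 1 := fun l => by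
        rw [sub_self, mul_zero, Complex.exp_zero]
      simp_rw [h1, sub_self, mul_zero, Complex.exp_zero, Finset.sum_const, Finset.card_range, nsmul_eq_mul]
      ring
    · rw [if_neg hdk, sum_exp_two_pi_mul_div_eq_zero hkL hD hd hdk]
      ring
  intro ψ
  have h1 := hmain ψ
  have h2 := hmain 0
  have : f ψ = c := mul_left_cancel₀ hL0 h1
  rw [this, ← mul_left_cancel₀ hL0 h2]

/-! ## §B The uniformly twisted torus is a pencil in `e^{iθ/L}`; the seam-flux torus is `2π`-periodic and gauge-equivalent -/

section Torus

variable {L : ℕ} [NeZero L]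

variable (L) in
/-- Pencil constant part: the `e₂`-hopping (both orientations), and the on-site repulsion. -/
def pencilM₀ (U : ℝ) : Matrix (Finset (Orb (FermionTorus 2 L))) (Finset (Orb (FermionTorus 2 L))) ℂ :=
  -(∑ x : Site 2 L, ∑ σ : Fin 2,
      (creation (orb (FermionTorus.ofTorusSite (Site.shift x 1)) σ) * annihilation (orb (FermionTorus.ofTorusSite x) σ) +
        creation (orb (FermionTorus.ofTorusSite x) σ) * annihilation (orb (FermionTorus.ofTorusSite (Site.shift x 1)) σ))) +
    (U : ℂ) • ∑ y : FermionTorus 2 L, numberOp y 0 * numberOp y 1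

variable (L) in
/-- Pencil `e^{+iθ/L}` part: minus every hop advancing `x₁` by one (`e₁`-bonds and, with weight `t'`, both diagonal families). -/
def pencilMp (t' : ℝ) : Matrix (Finset (Orb (FermionTorus 2 L))) (Finset (Orb (FermionTorus 2 L))) ℂ :=
  -(∑ x : Site 2 L, ∑ σ : Fin 2,
      creation (orb (FermionTorus.ofTorusSite (Site.shift x 0)) σ) * annihilation (orb (FermionTorus.ofTorusSite x) σ)) +
    -(t' : ℂ) • ∑ s : Fin 2, ∑ x : Site 2 L, ∑ σ : Fin 2,
      creation (orb (FermionTorus.ofTorusSite (x + torusDiagJump L s)) σ) * annihilation (orb (FermionTorus.ofTorusSite x) σ)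

variable (L) in
/-- Pencil `e^{-iθ/L}` part: minus every hop retreating `x₁` by one. -/
def pencilMm (t' : ℝ) : Matrix (Finset (Orb (FermionTorus 2 L))) (Finset (Orb (FermionTorus 2 L))) ℂ :=
  -(∑ x : Site 2 L, ∑ σ : Fin 2,
      creation (orb (FermionTorus.ofTorusSite x) σ) * annihilation (orb (FermionTorus.ofTorusSite (Site.shift x 0)) σ)) +
    -(t' : ℂ) • ∑ s : Fin 2, ∑ x : Site 2 L, ∑ σ : Fin 2,
      creation (orb (FermionTorus.ofTorusSite x) σ) * annihilation (orb (FermionTorus.ofTorusSite (x + torusDiagJump L s)) σ)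

/-- **The uniformly twisted `t–t'` torus is a trinomial pencil in `e = e^{iθ/L}`**:
`uniformTwistTT' θ = M₀ + e • M₊ + conj e • M₋`. [cite: Watanabe2019, §2.2.3 and §4.1] -/
theorem uniformTwistTT'_eq_pencil (t' U θ : ℝ) :
    uniformTwistTT' L t' U θ =
      pencilM₀ L U + ((Circle.exp (θ / L) : Circle) : ℂ) • pencilMp L t' +
        conj ((Circle.exp (θ / L) : Circle) : ℂ) • pencilMm L t' := by
  set e : ℂ := ((Circle.exp (θ / L) : Circle) : ℂ) with he
  have h0 : ∀ x : Site 2 L, ((uniformTwistConfig L θ (x, 0) : Circle) : ℂ) = e := fun x => by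
    rw [uniformTwistConfig_apply, if_pos rfl]
  have h1 : ∀ x : Site 2 L, ((uniformTwistConfig L θ (x, 1) : Circle) : ℂ) = 1 := fun x => by
    rw [uniformTwistConfig_apply, if_neg (by decide), Circle.coe_one]
  -- the nearest-neighbour hopping in the uniform twist, split by direction and orientation
  have hhop : (∑ x : Site 2 L, ∑ i : Fin 2, ∑ σ : Fin 2,
      ((((uniformTwistConfig L θ) (x, i) : Circle) : ℂ) •
          (creation (orb (FermionTorus.ofTorusSite (Site.shift x i)) σ) *
            annihilation (orb (FermionTorus.ofTorusSite x) σ)) +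
        (starRingEnd ℂ) (((uniformTwistConfig L θ) (x, i) : Circle) : ℂ) •
          (creation (orb (FermionTorus.ofTorusSite x) σ) *
            annihilation (orb (FermionTorus.ofTorusSite (Site.shift x i)) σ)))) =
      e • (∑ x : Site 2 L, ∑ σ : Fin 2,
          creation (orb (FermionTorus.ofTorusSite (Site.shift x 0)) σ) * annihilation (orb (FermionTorus.ofTorusSite x) σ)) +
      conj e • (∑ x : Site 2 L, ∑ σ : Fin 2,
          creation (orb (FermionTorus.ofTorusSite x) σ) * annihilation (orb (FermionTorus.ofTorusSite (Site.shift x 0)) σ)) +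
      ((∑ x : Site 2 L, ∑ σ : Fin 2,
          creation (orb (FermionTorus.ofTorusSite (Site.shift x 1)) σ) * annihilation (orb (FermionTorus.ofTorusSite x) σ)) +
        ∑ x : Site 2 L, ∑ σ : Fin 2,
          creation (orb (FermionTorus.ofTorusSite x) σ) * annihilation (orb (FermionTorus.ofTorusSite (Site.shift x 1)) σ)) := by
    rw [Finset.sum_comm, Fin.sum_univ_two]
    simp only [h0, h1, map_one, one_smul, Finset.sum_add_distrib, ← Finset.smul_sum]
  -- the diagonal hopping with the constant Peierls amplitude `e`
  have hdiag : diagPeierlsHopping L (fun _ _ => e) =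
      e • (∑ s : Fin 2, ∑ x : Site 2 L, ∑ σ : Fin 2,
          creation (orb (FermionTorus.ofTorusSite (x + torusDiagJump L s)) σ) *
            annihilation (orb (FermionTorus.ofTorusSite x) σ)) +
        conj e • (∑ s : Fin 2, ∑ x : Site 2 L, ∑ σ : Fin 2,
          creation (orb (FermionTorus.ofTorusSite x) σ) *
            annihilation (orb (FermionTorus.ofTorusSite (x + torusDiagJump L s)) σ)) := by
    unfold diagPeierlsHopping
    simp only [Finset.sum_add_distrib, ← Finset.smul_sum]
  unfold uniformTwistTT'
  rw [magneticHubbardTorus_eq, hhop, hdiag]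
  unfold pencilM₀ pencilMp pencilMm
  simp only [Finset.sum_add_distrib]
  module

/-- `conj e^{iψ} = e^{-iψ}` on the unit circle, in the form used by the pencil lemma. [folklore] -/
theorem conj_coe_circleExp (ψ : ℝ) :
    conj ((Circle.exp ψ : Circle) : ℂ) = Complex.exp (-((ψ : ℂ) * Complex.I)) := by
  rw [← Circle.coe_inv_eq_conj, ← Circle.exp_neg, Circle.coe_exp]
  push_cast
  ring_nf

/-- The diagonal seam twist is `2π`-periodic in the flux. [folklore] -/
theorem diagSeamTwist_add_two_pi (θ : ℝ) : diagSeamTwist L (θ + 2 * Real.pi) = diagSeamTwist L θ := by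
  have h : Circle.exp (θ + 2 * Real.pi) = Circle.exp θ := by
    rw [Circle.exp_add, Circle.exp_two_pi, mul_one]
  unfold diagSeamTwist
  rw [h]

/-- **The seam-flux `t–t'` torus is `2π`-periodic in the flux** (only `e^{±iθ}` enters). [cite: ByersYang1961] -/
theorem hubbardTorusTT'Flux_add_two_pi (t' U θ : ℝ) :
    hubbardTorusTT'Flux L t' U (θ + 2 * Real.pi) = hubbardTorusTT'Flux L t' U θ := by
  rw [hubbardTorusTT'Flux_eq, hubbardTorusTT'Flux_eq, seamTwist_periodic, diagSeamTwist_add_two_pi]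

end Torus

/-! ### Traces of powers of sector blocks are gauge invariant -/

section Blocks

variable {n : Type*} [Fintype n]

/-- `(P M Q)^k = P M^k Q` when `Q P = 1` and `P Q = 1`. [folklore] -/
theorem conj_pow_eq {q : Type*} [Fintype q] [DecidableEq q] [DecidableEq n] (P : Matrix q n ℂ) (Q : Matrix n q ℂ)
    (M : Matrix n n ℂ) (hQP : Q * P = 1) (hPQ : P * Q = 1) (k : ℕ) : (P * M * Q) ^ k = P * M ^ k * Q := by
  induction k with
  | zero => rw [pow_zero, pow_zero, Matrix.mul_one, hPQ]
  | succ k ih =>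
    rw [pow_succ, ih, pow_succ]
    simp only [Matrix.mul_assoc]
    rw [← Matrix.mul_assoc Q P, hQP, Matrix.one_mul]

/-- `tr (P M Q)^k = tr M^k` when `Q P = 1 = P Q`. [folklore] -/
theorem trace_conj_pow_eq {q : Type*} [Fintype q] [DecidableEq q] [DecidableEq n] (P : Matrix q n ℂ) (Q : Matrix n q ℂ)
    (M : Matrix n n ℂ) (hQP : Q * P = 1) (hPQ : P * Q = 1) (k : ℕ) : ((P * M * Q) ^ k).trace = (M ^ k).trace := by
  rw [conj_pow_eq P Q M hQP hPQ, Matrix.trace_mul_cycle, hQP, Matrix.one_mul]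

/-- Unit-modulus diagonal conjugation does not change traces of powers of a sector block (for WHATEVER decidability
instance built the big diagonal). [folklore] -/
theorem trace_pow_toBlock_diagonal_conj {inst : DecidableEq n} (v : n → ℂ) (hv : ∀ a, star (v a) * v a = 1)
    (M : Matrix n n ℂ) (p : n → Prop) [Fintype {a // p a}] [DecidableEq {a // p a}] (k : ℕ) :
    (((@diagonal n ℂ inst _ (fun a => star (v a)) * M * @diagonal n ℂ inst _ v).toBlock p p) ^ k).trace =
      ((M.toBlock p p) ^ k).trace := by
  rw [toBlock_diagonal_mul_mul_diagonal]
  have h1 : (fun a : {a // p a} => v a * star (v a)) = fun _ => 1 := funext fun a => by rw [mul_comm]; exact hv a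
  have h2 : (fun a : {a // p a} => star (v a) * v a) = fun _ => 1 := funext fun a => hv a
  refine trace_conj_pow_eq _ _ _ ?_ ?_ k
  · rw [diagonal_mul_diagonal, h1, diagonal_one]
  · rw [diagonal_mul_diagonal, h2, diagonal_one]

end Blocks

section Gauge

variable {L : ℕ} [NeZero L]

/-- **Gauge invariance of the sector moments** (`L ≥ 3`): `tr ((H(θ))|_p)^k = tr ((H_unif(θ))|_p)^k` on every coordinate
sector `p` (the twist `phaseGauge (twistGauge θ)` is diagonal in the occupation basis). [cite: Watanabe2019, §2.2.3 and §4.1] -/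
theorem trace_pow_toBlock_uniformTwistTT'_eq (hL : 3 ≤ L) (t' U θ : ℝ)
    (p : Finset (Orb (FermionTorus 2 L)) → Prop) [Fintype {a // p a}] [DecidableEq {a // p a}] (k : ℕ) :
    (((uniformTwistTT' L t' U θ).toBlock p p) ^ k).trace = (((hubbardTorusTT'Flux L t' U θ).toBlock p p) ^ k).trace := by
  have hunit : ∀ z : Circle, star (z : ℂ) * (z : ℂ) = 1 := fun z => by
    rw [Complex.star_def, ← Complex.normSq_eq_conj_mul_self, Circle.normSq_coe, Complex.ofReal_one]
  rw [uniformTwistTT', ← conj_hubbardTorusTT'Flux_eq_uniform hL t' U θ, phaseGauge_eq, conjTranspose_diagonal_inst]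
  exact trace_pow_toBlock_diagonal_conj _ (fun a => hunit _) _ p k

/-- Sector blocks respect the pencil structure (`toBlock` is linear). [folklore] -/
theorem toBlock_pencil {m : Type*} (A B C : Matrix m m ℂ) (a b : ℂ) (p : m → Prop) :
    (A + a • B + b • C).toBlock p p = A.toBlock p p + a • B.toBlock p p + b • C.toBlock p p := by
  ext i j
  simp [toBlock_apply]

/-! ## §C Flux-blindness of the first `L - 1` sector moments -/

/-- **Flux-blindness of short walks** (`L ≥ 3`, every `t', U`, every coordinate sector `p`, every `k < L`):
`tr ((H^{tt'}_L(θ))|_p)^k = tr ((H^{tt'}_L(0))|_p)^k`. In the uniform gauge the `k`-th sector moment is a trigonometric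
polynomial of degree `≤ k` in `ψ = θ/L` (§A1); it is `2π`-periodic in `θ`, i.e. `2π/L`-periodic in `ψ` (§B); a trigonometric
polynomial of degree `k < L` with that period is constant (§A2). Physically: a closed walk of fewer than `L` hops cannot wind
around the torus, so it cannot feel the Aharonov–Bohm flux. [cite: ByersYang1961] -/
theorem trace_pow_toBlock_hubbardTorusTT'Flux_eq_zero_flux (hL : 3 ≤ L) (t' U θ : ℝ)
    (p : Finset (Orb (FermionTorus 2 L)) → Prop) [Fintype {a // p a}] [DecidableEq {a // p a}] {k : ℕ} (hk : k < L) :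
    (((hubbardTorusTT'Flux L t' U θ).toBlock p p) ^ k).trace = (((hubbardTorusTT'Flux L t' U 0).toBlock p p) ^ k).trace := by
  have hL0 : (L : ℝ) ≠ 0 := by exact_mod_cast (show L ≠ 0 by omega)
  -- the moment in the uniform gauge as a function of `ψ = θ/L`
  set f : ℝ → ℂ := fun ψ => (((uniformTwistTT' L t' U (L * ψ)).toBlock p p) ^ k).trace with hf
  -- (A1) structure
  obtain ⟨g, hg⟩ := trace_pencil_pow_eq_sum ((pencilM₀ L U).toBlock p p) ((pencilMp L t').toBlock p p)
    ((pencilMm L t').toBlock p p) k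
  have hstruct : ∀ ψ : ℝ, f ψ = ∑ d ∈ Finset.range (2 * k + 1), g d * Complex.exp ((ψ : ℂ) * Complex.I * ((d : ℂ) - k)) := by
    intro ψ
    rw [← hg ψ, hf]
    simp only
    rw [uniformTwistTT'_eq_pencil, toBlock_pencil, mul_div_cancel_left₀ ψ hL0, conj_coe_circleExp, Circle.coe_exp]
  -- (B) periodicity
  have hper : ∀ ψ : ℝ, f (ψ + 2 * Real.pi / L) = f ψ := by
    intro ψ
    simp only [hf]
    rw [show (L : ℝ) * (ψ + 2 * Real.pi / L) = L * ψ + 2 * Real.pi by field_simp,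
      trace_pow_toBlock_uniformTwistTT'_eq hL, trace_pow_toBlock_uniformTwistTT'_eq hL, hubbardTorusTT'Flux_add_two_pi]
  -- (A2) constancy
  have hconst := trigPoly_eq_const_of_periodic hk (by omega) g f hstruct hper
  have h1 : f (θ / L) = (((hubbardTorusTT'Flux L t' U θ).toBlock p p) ^ k).trace := by
    simp only [hf]
    rw [mul_div_cancel₀ θ hL0, trace_pow_toBlock_uniformTwistTT'_eq hL]
  have h2 : f 0 = (((hubbardTorusTT'Flux L t' U 0).toBlock p p) ^ k).trace := by
    simp only [hf]
    rw [mul_zero, trace_pow_toBlock_uniformTwistTT'_eq hL]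
  rw [← h1, ← h2, hconst]

end Gauge

/-! ## §D Flux-blindness is Taylor-flatness of `β ↦ tr e^{-βH}` at `β = 0` -/

section Flatness

open scoped Matrix.Norms.L2Operator

variable {m : Type*} [Fintype m] [DecidableEq m]

/-- The exponential moments `β ↦ tr (A^k e^{βA})`. -/
def expMoment (A : Matrix m m ℂ) (k : ℕ) (β : ℂ) : ℂ :=
  (A ^ k * NormedSpace.exp (β • A)).trace

/-- `d/dβ tr (A^k e^{βA}) = tr (A^{k+1} e^{βA})` (Mathlib `hasDerivAt_exp_smul_const'` in the Banach algebra of matrices). [folklore] -/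
theorem hasDerivAt_expMoment (A : Matrix m m ℂ) (k : ℕ) (β : ℂ) :
    HasDerivAt (expMoment A k) (expMoment A (k + 1) β) β := by
  have h1 : HasDerivAt (fun u : ℂ => NormedSpace.exp (u • A)) (A * NormedSpace.exp (β • A)) β :=
    hasDerivAt_exp_smul_const' A β
  set Lk : Matrix m m ℂ →L[ℂ] ℂ :=
    LinearMap.toContinuousLinearMap ((Matrix.traceLinearMap m ℂ ℂ) ∘ₗ (LinearMap.mulLeft ℂ (A ^ k))) with hLk
  have hL : ∀ X : Matrix m m ℂ, Lk X = (A ^ k * X).trace := fun X => rfl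
  have h2 := Lk.hasFDerivAt.comp_hasDerivAt β h1
  have heq : (⇑Lk ∘ fun u : ℂ => NormedSpace.exp (u • A)) = expMoment A k := funext fun u => by
    simp only [Function.comp_apply, hL, expMoment]
  rw [heq, hL, ← Matrix.mul_assoc, ← pow_succ] at h2
  exact h2

/-- `(d/dβ)^k tr e^{βA} = tr (A^k e^{βA})`. [folklore] -/
theorem iteratedDeriv_expMoment_zero (A : Matrix m m ℂ) (k : ℕ) : iteratedDeriv k (expMoment A 0) = expMoment A k := by
  induction k with
  | zero => rw [iteratedDeriv_zero]
  | succ k ih =>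
    rw [iteratedDeriv_succ, ih]
    funext β
    exact (hasDerivAt_expMoment A k β).deriv

/-- **Taylor coefficients of the partition function at infinite temperature**: `(d/dβ)^k tr e^{-βH} |_{β=0} = (-1)^k tr H^k`. [folklore] -/
theorem iteratedDeriv_trace_exp_neg_smul (H : Matrix m m ℂ) (k : ℕ) :
    iteratedDeriv k (fun β : ℂ => (NormedSpace.exp (-β • H)).trace) 0 = (-1) ^ k * (H ^ k).trace := by
  have heq : (fun β : ℂ => (NormedSpace.exp (-β • H)).trace) = expMoment (-H) 0 := by
    funext β
    simp only [expMoment, pow_zero, Matrix.one_mul, smul_neg, neg_smul]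
  rw [heq, iteratedDeriv_expMoment_zero, expMoment, zero_smul, NormedSpace.exp_zero, Matrix.mul_one,
    show -H = (-1 : ℂ) • H by rw [neg_one_smul], _root_.smul_pow, trace_smul, smul_eq_mul]

end Flatness

/-! ## §E The K1 objects: the canonical sector of `thermalFluxLogZ`, flux-blindness and flatness there -/

section K1

open Summit.Ventures.CertifiedManyBodySolver.Observables

/-- The `(N_L, S^z = 0)` coordinate sector of the `t–t′` torus at doping `δ` (the binder of `thermalFluxLogZ`; reducible, so that
its decidability is inferred). -/
abbrev fluxSector (L : ℕ) (δ : ℝ) (s : Finset (Orb (FermionTorus 2 L))) : Prop :=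
  s.card = 2 * ⌊(1 - δ) * (L : ℝ) ^ 2 / 2⌋₊ ∧
    2 * (s.filter fun i => (ofLex i).2 = 0).card = 2 * ⌊(1 - δ) * (L : ℝ) ^ 2 / 2⌋₊

/-- The `(N_L, S^z=0)` sector block of the seam-flux Hamiltonian `hubbardTorusTT'Flux L tp U θ` at doping `δ`. -/
def fluxBlock (L : ℕ) [NeZero L] (tp U δ θ : ℝ) :
    Matrix {a // fluxSector L δ a} {a // fluxSector L δ a} ℂ :=
  (hubbardTorusTT'Flux L tp U θ).toBlock (fluxSector L δ) (fluxSector L δ)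

/-- The sector partition function at COMPLEX inverse temperature: `Z_L(β, θ) = tr_sector e^{−β H_L(θ)}` (entire in `β`); for real
`β` it is `Matrix.partitionFn β (fluxBlock …)`, whose `Re`-log is `thermalFluxLogZ` (`thermalFluxLogZ_eq_log_re`, `rfl`). -/
def thermalFluxZc (L : ℕ) [NeZero L] (tp U δ θ : ℝ) (β : ℂ) : ℂ :=
  (NormedSpace.exp (-β • fluxBlock L tp U δ θ)).trace

/-- **Flux-blindness of short walks** (support statement of the line): `tr_p H_L(θ)^k = tr_p H_L(0)^k` for every `k < L`. -/
def FluxBlindTracePow (L : ℕ) [NeZero L] (tp U δ θ : ℝ) : Prop :=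
  ∀ k : ℕ, k < L → (fluxBlock L tp U δ θ ^ k).trace = (fluxBlock L tp U δ 0 ^ k).trace

/-- The tree observable is the real log of the sector partition function at real `β` (definitional). -/
theorem thermalFluxLogZ_eq_log_re (L : ℕ) [NeZero L] (tp U δ b θ : ℝ) :
    thermalFluxLogZ L tp U δ b θ = Real.log (thermalFluxZc L tp U δ θ (b : ℂ)).re := by
  rfl

/-- **Flux-blindness holds** at every side `L ≥ 3`, every `t′, U`, doping and flux (§C specialised to the K1 sector). [cite: ByersYang1961] -/
theorem fluxBlindTracePow_of_three_le {L : ℕ} [NeZero L] (hL : 3 ≤ L) (tp U δ θ : ℝ) : FluxBlindTracePow L tp U δ θ :=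
  fun _ hk => trace_pow_toBlock_hubbardTorusTT'Flux_eq_zero_flux hL tp U θ (fluxSector L δ) hk

/-- **Flux-blindness is flatness of order `L` at `β = 0`**: the first `L` Taylor coefficients of `Z_L(·,θ)` and `Z_L(·,0)` agree. [folklore] -/
theorem iteratedDeriv_thermalFluxZc_eq {L : ℕ} [NeZero L] {tp U δ θ : ℝ} (hF : FluxBlindTracePow L tp U δ θ) :
    ∀ k : ℕ, k < L → iteratedDeriv k (thermalFluxZc L tp U δ θ) 0 = iteratedDeriv k (thermalFluxZc L tp U δ 0) 0 := by
  intro k hk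
  have hθ : thermalFluxZc L tp U δ θ = fun β : ℂ => (NormedSpace.exp (-β • fluxBlock L tp U δ θ)).trace := rfl
  have h0 : thermalFluxZc L tp U δ 0 = fun β : ℂ => (NormedSpace.exp (-β • fluxBlock L tp U δ 0)).trace := rfl
  rw [hθ, h0, iteratedDeriv_trace_exp_neg_smul, iteratedDeriv_trace_exp_neg_smul, hF k hk]

/-- Hence, unconditionally for `L ≥ 3`: the Taylor jets of order `L - 1` at `β = 0` of the twisted and untwisted sector partition
functions coincide. [cite: ByersYang1961] -/
theorem iteratedDeriv_thermalFluxZc_eq_of_three_le {L : ℕ} [NeZero L] (hL : 3 ≤ L) (tp U δ θ : ℝ) {k : ℕ} (hk : k < L) :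
    iteratedDeriv k (thermalFluxZc L tp U δ θ) 0 = iteratedDeriv k (thermalFluxZc L tp U δ 0) 0 :=
  iteratedDeriv_thermalFluxZc_eq (fluxBlindTracePow_of_three_le hL tp U δ θ) k hk

end K1

/-! ## §F Sockets: twist-insensitivity ⇒ the leaf; the corridor, corridor data, Hypothesis Z -/

section Sockets

open Filter Topology
open Summit.Ventures.CertifiedManyBodySolver.Observables

/-- Qualitative twist-insensitivity of the `(N_L, S^z=0)` sector free energy at inverse temperature `β`:
for some flux scale `θ₁ > 0`, `|log Z_L(0) − log Z_L(θ)| ≤ ε_L → 0` uniformly in `|θ| ≤ θ₁`. -/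
def TwistInsensitiveAt (tp U n β : ℝ) : Prop :=
  ∃ θ₁ : ℝ, 0 < θ₁ ∧ ∃ ε : ℕ → ℝ, Tendsto ε atTop (𝓝 0) ∧ ∃ L₀ : ℕ,
    ∀ (L : ℕ) [NeZero L], L₀ ≤ L → ∀ θ : ℝ, |θ| ≤ θ₁ →
      |thermalFluxLogZ L tp U (1 - n) β 0 - thermalFluxLogZ L tp U (1 - n) β θ| ≤ ε L

/-- **Socket (PROVED).** Twist-insensitivity at `β > 0` forces the single-temperature thermal stiffness leaf for every `c ≥ 0`
(the flux premise is consumed at the positive twist `θ = min θ₀ θ₁`, as `Disproof.k1_false_without_theta0_pos/_fluxPremise` demand). -/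
theorem leafAtBeta_of_twistInsensitiveAt {tp U n β : ℝ} (hβ : 0 < β) {c : ℚ} (_hc : 0 ≤ c)
    (h : TwistInsensitiveAt tp U n β) : ObsThermalStiffnessSeqCeilingAtBeta tp U n β c := by
  intro ρs θ₀ hρs hθ₀ Ls hLs hst
  obtain ⟨θ₁, hθ₁, ε, hε, L₀, hins⟩ := h
  exfalso
  set θ : ℝ := min θ₀ θ₁ with hθdef
  have hθpos : 0 < θ := lt_min hθ₀ hθ₁
  have hθ0 : |θ| ≤ θ₀ := by rw [abs_of_pos hθpos]; exact min_le_left _ _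
  have hθ1 : |θ| ≤ θ₁ := by rw [abs_of_pos hθpos]; exact min_le_right _ _
  have hev : ∀ᶠ j in atTop, β * ρs * θ ^ 2 ≤ ε (Ls j) := by
    have h1 : ∀ᶠ j in atTop, max 1 L₀ ≤ Ls j := hLs.eventually (eventually_ge_atTop (max 1 L₀))
    filter_upwards [h1] with j hj
    haveI : NeZero (Ls j) := ⟨by omega⟩
    have ha := hst j θ hθ0
    have hb := hins (Ls j) (le_of_max_le_right hj) θ hθ1
    exact ha.trans ((le_abs_self _).trans hb)
  have hlim : Tendsto (fun j => ε (Ls j)) atTop (𝓝 0) := hε.comp hLs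
  have hle : β * ρs * θ ^ 2 ≤ 0 := ge_of_tendsto hlim hev
  have hpos : 0 < β * ρs * θ ^ 2 := by positivity
  linarith

/-- **Hypothesis Z (zero-free β-corridor, uniform in `L` and in small twists).** For all large `L` and all `|θ| ≤ θ₁` the sector
partition function `β ↦ Z_L(β, θ)` has no zero in the open rectangle `(−η, β₁ + η) × (−η, η)·i`. -/
def ZeroFreeStrip (tp U n β₁ η θ₁ : ℝ) : Prop :=
  ∃ L₀ : ℕ, ∀ (L : ℕ) [NeZero L], L₀ ≤ L → ∀ θ : ℝ, |θ| ≤ θ₁ →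
    ∀ β : ℂ, -η < β.re → β.re < β₁ + η → |β.im| < η → thermalFluxZc L tp U (1 - n) θ β ≠ 0

/-- The open corridor `(−η, b + η) × (−η, η)·i` around the real segment `[0, b]`. -/
def corridor (η b : ℝ) : Set ℂ := {z : ℂ | -η < z.re ∧ z.re < b + η ∧ |z.im| < η}

/-- Admissible corridor data with size parameter `M`: `f` is analytic and zero-free on the corridor, `‖f‖ ≤ e^{M}` there, and on
the real segment `f` is real with `f ≥ e^{−M}`. -/
structure CorridorData (η b M : ℝ) (f : ℂ → ℂ) : Prop where
  differentiableOn : DifferentiableOn ℂ f (corridor η b)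
  ne_zero : ∀ z ∈ corridor η b, f z ≠ 0
  norm_le : ∀ z ∈ corridor η b, ‖f z‖ ≤ Real.exp M
  real_on_axis : ∀ x : ℝ, -η < x → x < b + η → (f x).im = 0 ∧ Real.exp (-M) ≤ (f x).re

end Sockets

/-! ## §G The stubs of v4 (`stub_corridorTransfer`, `stub_corridorData` — both PROVED) and the kernel-checked composition `…_of`; v5 moves Hypothesis Z to §K -/

section Line

open Filter Topology
open Summit.Ventures.CertifiedManyBodySolver.Observables

/-- **stub 1 — corridor transfer (pure complex analysis; size L; PROVED in v4).** Two admissible functions on the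
corridor that agree to order `L` at `0` have logarithms at `b` within `C·(M+1)·r^L`, `r < 1` depending on `(η, b)` only.
Proof = §J (`CorridorTransfer.corridorTransfer`, the landed helpers `Theorems/TcThermcert1CorridorTransferDiscs.lean` +
`Theorems/TcThermcert1CorridorTransfer.lean`): `h := log f − log g` via holomorphic logarithms on the convex corridor (`h(0)=0`, real on
the axis); one-sided Borel–Carathéodory coefficient bounds on discs with real centres (tree
`Literature/Analysis/Complex/BorelCaratheodoryDeriv.lean`); the jets pass to `h` (`analyticOrderAt`); a fixed chain of `⌈8b/η⌉` split-Taylor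
two-radii steps along the axis carries `2^{−⌊L/2^j⌋}` to `b`. [folklore] -/
theorem stub_corridorTransfer :
    ∀ (η b : ℝ), 0 < η → 0 < b →
      ∃ C r : ℝ, 0 < C ∧ 0 ≤ r ∧ r < 1 ∧
        ∀ (L : ℕ) (M : ℝ) (f g : ℂ → ℂ), 0 ≤ M → CorridorData η b M f → CorridorData η b M g →
          (∀ k : ℕ, k < L → iteratedDeriv k f 0 = iteratedDeriv k g 0) →
          |Real.log (f b).re - Real.log (g b).re| ≤ C * (M + 1) * r ^ L := by
  intro η b hη hb
  obtain ⟨C, r, hC, hr0, hr1, H⟩ := CorridorTransfer.corridorTransfer hη hb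
  exact ⟨C, r, hC, hr0, hr1, fun L M f g hM hf hg hjet =>
    H L M f g hM hf.differentiableOn hf.ne_zero hf.norm_le hf.real_on_axis
      hg.differentiableOn hg.ne_zero hg.norm_le hg.real_on_axis hjet⟩

/-- **stub 2 — a-priori corridor data (size M; PROVED in v3).** Under Hypothesis Z the twisted sector partition functions are corridor
data with `M = (2 + (b+η)(18 + 10|U| + 26|t′|))·L²`, uniformly in `|θ| ≤ θ₁`: by the spectral theorem `Z_L(β,θ) = Σ_i e^{−β λ_i}` is entire,
`|Z_L(β,θ)| ≤ dim · e^{|Re β| Λ_L}`, and on the axis it is real with `Z_L(x,θ) ≥ dim · e^{−|x| Λ_L} ≥ e^{−|x| Λ_L}` (`dim ≥ 1` because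
`Z_L(0,θ) = dim ≠ 0` by Hypothesis Z), where `|λ_i| ≤ ‖H_L(θ)‖ ≤ Λ_L = (18 + 10|U| + 26|t′|) L²` uniformly in the flux and `dim ≤ e^{2L²}`
(`Theorems/TcThermcert1SectorPartitionFnBounds.lean`); zero-freeness is Hypothesis Z itself. [folklore] -/
theorem stub_corridorData :
    ∀ (tp U n b η θ₁ : ℝ), 0 < η → 0 < b → ZeroFreeStrip tp U n b η θ₁ →
      ∃ A : ℝ, 0 ≤ A ∧ ∃ L₀ : ℕ, ∀ (L : ℕ) [NeZero L], L₀ ≤ L → ∀ θ : ℝ, |θ| ≤ θ₁ →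
        CorridorData η b (A * (L : ℝ) ^ 2) (thermalFluxZc L tp U (1 - n) θ) := by
  intro tp U n b η θ₁ hη hb hZ
  obtain ⟨L₀, hZ⟩ := hZ
  set c : ℝ := 18 + 10 * |U| + 26 * |tp| with hc
  have hc0 : 0 ≤ c := by rw [hc]; positivity
  have hbη : 0 ≤ b + η := by linarith
  refine ⟨2 + (b + η) * c, by positivity, L₀, ?_⟩
  intro L _ hL θ hθ
  have hB : (fluxBlock L tp U (1 - n) θ).IsHermitian := (isHermitian_hubbardTorusTT'Flux L tp U θ).submatrix _
  have hΛ : ∀ i, |hB.eigenvalues i| ≤ c * (L : ℝ) ^ 2 := fun i => by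
    rw [hc]; exact Summit.Ventures.CertifiedManyBodySolver.Cruxes.ThermalStiffnessCeilingU8b10_le_1o8.ZerofreeCorridor.AprioriData.abs_eigenvalues_sectorBlock_le tp U θ (fluxSector L (1 - n)) hB i
  have hcL : 0 ≤ c * (L : ℝ) ^ 2 := mul_nonneg hc0 (sq_nonneg _)
  have hcard : (Fintype.card {a // fluxSector L (1 - n) a} : ℝ) ≤ Real.exp (2 * (L : ℝ) ^ 2) := Summit.Ventures.CertifiedManyBodySolver.Cruxes.ThermalStiffnessCeilingU8b10_le_1o8.ZerofreeCorridor.AprioriData.card_sector_le_exp _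
  have hZdef : ∀ β : ℂ, thermalFluxZc L tp U (1 - n) θ β = (NormedSpace.exp (-β • fluxBlock L tp U (1 - n) θ)).trace :=
    fun β => rfl
  have hre : ∀ z ∈ corridor η b, |z.re| ≤ b + η := by
    intro z hz
    obtain ⟨h1, h2, -⟩ := hz
    rw [abs_le]; constructor <;> linarith
  refine ⟨(Summit.Ventures.CertifiedManyBodySolver.Cruxes.ThermalStiffnessCeilingU8b10_le_1o8.ZerofreeCorridor.AprioriData.differentiable_trace_exp_neg_smul hB).differentiableOn, ?_, ?_, ?_⟩
  · intro z hz
    exact hZ L hL θ hθ z hz.1 hz.2.1 hz.2.2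
  · intro z hz
    rw [hZdef]
    refine (Summit.Ventures.CertifiedManyBodySolver.Cruxes.ThermalStiffnessCeilingU8b10_le_1o8.ZerofreeCorridor.AprioriData.norm_trace_exp_neg_smul_le hB hΛ z).trans ?_
    calc (Fintype.card {a // fluxSector L (1 - n) a} : ℝ) * Real.exp (|z.re| * (c * (L : ℝ) ^ 2))
        ≤ Real.exp (2 * (L : ℝ) ^ 2) * Real.exp ((b + η) * (c * (L : ℝ) ^ 2)) :=
          mul_le_mul hcard (Real.exp_le_exp.mpr (mul_le_mul_of_nonneg_right (hre z hz) hcL)) (Real.exp_pos _).le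
            (Real.exp_pos _).le
      _ = Real.exp ((2 + (b + η) * c) * (L : ℝ) ^ 2) := by rw [← Real.exp_add]; ring_nf
  · intro x hx1 hx2
    have hxre : |x| ≤ b + η := abs_le.mpr ⟨by linarith, by linarith⟩
    refine ⟨by rw [hZdef]; exact Summit.Ventures.CertifiedManyBodySolver.Cruxes.ThermalStiffnessCeilingU8b10_le_1o8.ZerofreeCorridor.AprioriData.trace_exp_neg_smul_ofReal_im hB x, ?_⟩
    have hne : thermalFluxZc L tp U (1 - n) θ 0 ≠ 0 :=
      hZ L hL θ hθ 0 (by rw [Complex.zero_re]; linarith) (by rw [Complex.zero_re]; linarith)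
        (by rw [Complex.zero_im, abs_zero]; exact hη)
    have hcard1 : (1 : ℝ) ≤ Fintype.card {a // fluxSector L (1 - n) a} := by
      rw [hZdef, Summit.Ventures.CertifiedManyBodySolver.Cruxes.ThermalStiffnessCeilingU8b10_le_1o8.ZerofreeCorridor.AprioriData.trace_exp_neg_zero_smul] at hne
      exact_mod_cast Nat.one_le_iff_ne_zero.mpr (Nat.cast_ne_zero.mp hne)
    have hexp : Real.exp (-((2 + (b + η) * c) * (L : ℝ) ^ 2)) ≤ Real.exp (-(|x| * (c * (L : ℝ) ^ 2))) := by
      refine Real.exp_le_exp.mpr (neg_le_neg ?_)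
      have h1 : |x| * (c * (L : ℝ) ^ 2) ≤ (b + η) * (c * (L : ℝ) ^ 2) := mul_le_mul_of_nonneg_right hxre hcL
      nlinarith [sq_nonneg (L : ℝ)]
    rw [hZdef]
    calc Real.exp (-((2 + (b + η) * c) * (L : ℝ) ^ 2)) ≤ 1 * Real.exp (-(|x| * (c * (L : ℝ) ^ 2))) := by
          rw [one_mul]; exact hexp
      _ ≤ (Fintype.card {a // fluxSector L (1 - n) a} : ℝ) * Real.exp (-(|x| * (c * (L : ℝ) ^ 2))) :=
          mul_le_mul_of_nonneg_right hcard1 (Real.exp_pos _).le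
      _ ≤ _ := Summit.Ventures.CertifiedManyBodySolver.Cruxes.ThermalStiffnessCeilingU8b10_le_1o8.ZerofreeCorridor.AprioriData.card_mul_exp_neg_le_trace_exp_neg_smul_ofReal_re hB hΛ x

/- v5: `stub_zeroFreeStrip` (Hypothesis Z) is no longer a registered stub: it is DERIVED in §K from the hot-end stubs K1–K3 and
the cold bet `stub_zeroFreeCold` (`zeroFreeStrip_of_stubs`). -/

/-- **Twist-insensitivity from the corridor** (PROVED from stubs 1–2 as hypotheses + the PROVED flux-blindness): for `L ≥ max L₀ 3`,
`|g_L(β₁, θ)| ≤ C·(A L² + 1)·r^L → 0` uniformly in `|θ| ≤ θ₁`. -/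
theorem twistInsensitiveAt_of_zeroFreeStrip
    (hT : ∀ (η b : ℝ), 0 < η → 0 < b →
      ∃ C r : ℝ, 0 < C ∧ 0 ≤ r ∧ r < 1 ∧
        ∀ (L : ℕ) (M : ℝ) (f g : ℂ → ℂ), 0 ≤ M → CorridorData η b M f → CorridorData η b M g →
          (∀ k : ℕ, k < L → iteratedDeriv k f 0 = iteratedDeriv k g 0) →
          |Real.log (f b).re - Real.log (g b).re| ≤ C * (M + 1) * r ^ L)
    (hD : ∀ (tp U n b η θ₁ : ℝ), 0 < η → 0 < b → ZeroFreeStrip tp U n b η θ₁ →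
      ∃ A : ℝ, 0 ≤ A ∧ ∃ L₀ : ℕ, ∀ (L : ℕ) [NeZero L], L₀ ≤ L → ∀ θ : ℝ, |θ| ≤ θ₁ →
        CorridorData η b (A * (L : ℝ) ^ 2) (thermalFluxZc L tp U (1 - n) θ))
    {tp U n β₁ η θ₁ : ℝ} (hη : 0 < η) (hβ₁ : 0 < β₁) (hθ₁ : 0 < θ₁)
    (hZ : ZeroFreeStrip tp U n β₁ η θ₁) : TwistInsensitiveAt tp U n β₁ := by
  obtain ⟨C, r, hC, hr0, hr1, hmain⟩ := hT η β₁ hη hβ₁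
  obtain ⟨A, hA, L₀, hdata⟩ := hD tp U n β₁ η θ₁ hη hβ₁ hZ
  refine ⟨θ₁, hθ₁, fun L => C * (A * (L : ℝ) ^ 2 + 1) * r ^ L, ?_, max L₀ 3, ?_⟩
  · have h2 : Tendsto (fun L : ℕ => (L : ℝ) ^ 2 * r ^ L) atTop (𝓝 0) :=
      tendsto_pow_const_mul_const_pow_of_abs_lt_one 2 (by rw [abs_of_nonneg hr0]; exact hr1)
    have h0 : Tendsto (fun L : ℕ => r ^ L) atTop (𝓝 0) := tendsto_pow_atTop_nhds_zero_of_lt_one hr0 hr1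
    have : Tendsto (fun L : ℕ => C * (A * ((L : ℝ) ^ 2 * r ^ L) + r ^ L)) atTop (𝓝 (C * (A * 0 + 0))) :=
      ((h2.const_mul A).add h0).const_mul C
    simp only [mul_zero, add_zero] at this
    refine this.congr' (Eventually.of_forall fun L => ?_)
    ring
  · intro L _ hL θ hθ
    have hL₀ : L₀ ≤ L := le_of_max_le_left hL
    have hL3 : 3 ≤ L := le_of_max_le_right hL
    have h0θ : |(0 : ℝ)| ≤ θ₁ := by rw [abs_zero]; exact hθ₁.le
    have hfd := hdata L hL₀ θ hθ
    have hgd := hdata L hL₀ 0 h0θ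
    have hflat : ∀ k : ℕ, k < L →
        iteratedDeriv k (thermalFluxZc L tp U (1 - n) θ) 0 = iteratedDeriv k (thermalFluxZc L tp U (1 - n) 0) 0 :=
      fun k hk => iteratedDeriv_thermalFluxZc_eq_of_three_le hL3 tp U (1 - n) θ hk
    have hML : 0 ≤ A * (L : ℝ) ^ 2 := by positivity
    have key := hmain L (A * (L : ℝ) ^ 2) _ _ hML hfd hgd hflat
    rw [thermalFluxLogZ_eq_log_re, thermalFluxLogZ_eq_log_re, abs_sub_comm]
    exact key

/-- The route's K1 crux decl under a REDUCIBLE ALIAS (v7). The A12 skeleton audit (`ledger skeleton check`) takes the first theorem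
that concludes the crux BY NAME as the skeleton and admits only NAMED hypotheses; the hypothesis-carrying compositions
`ThermalStiffnessCeilingU8b10_le_1o8_of` (v4 shape) and `…_of5` (v5 shape) therefore conclude this alias — definitionally the crux,
`K1Crux_iff` is `Iff.rfl` — and the unique by-name theorem of the file is `ThermalStiffnessCeilingU8b10_le_1o8_of_stubs`
(no hypotheses; it applies `…_of5` to the declared stubs). Nothing mathematical changed. -/
abbrev K1Crux : Prop := Summit.Ventures.CertifiedManyBodySolver.Theses.TcThermcert1.ThermalStiffnessCeilingU8b10_le_1o8

/-- The alias is the crux, by `Iff.rfl`. -/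
theorem K1Crux_iff : K1Crux ↔ Summit.Ventures.CertifiedManyBodySolver.Theses.TcThermcert1.ThermalStiffnessCeilingU8b10_le_1o8 := Iff.rfl

/-- **THE COMPOSITION (kernel-checked, no sorry): stub 1 → stub 2 → stub 3 → K1** (v4 shape; concludes the reducible alias `K1Crux`, v7). -/
theorem ThermalStiffnessCeilingU8b10_le_1o8_of :
    (∀ (η b : ℝ), 0 < η → 0 < b →
      ∃ C r : ℝ, 0 < C ∧ 0 ≤ r ∧ r < 1 ∧
        ∀ (L : ℕ) (M : ℝ) (f g : ℂ → ℂ), 0 ≤ M → CorridorData η b M f → CorridorData η b M g →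
          (∀ k : ℕ, k < L → iteratedDeriv k f 0 = iteratedDeriv k g 0) →
          |Real.log (f b).re - Real.log (g b).re| ≤ C * (M + 1) * r ^ L) →
    (∀ (tp U n b η θ₁ : ℝ), 0 < η → 0 < b → ZeroFreeStrip tp U n b η θ₁ →
      ∃ A : ℝ, 0 ≤ A ∧ ∃ L₀ : ℕ, ∀ (L : ℕ) [NeZero L], L₀ ≤ L → ∀ θ : ℝ, |θ| ≤ θ₁ →
        CorridorData η b (A * (L : ℝ) ^ 2) (thermalFluxZc L tp U (1 - n) θ)) →
    (∃ η θ₁ : ℝ, 0 < η ∧ 0 < θ₁ ∧ ZeroFreeStrip 0 8 (7 / 8) 10 η θ₁) →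
    K1Crux := by
  intro hT hD hZ
  obtain ⟨η, θ₁, hη, hθ₁, hZ⟩ := hZ
  exact leafAtBeta_of_twistInsensitiveAt (by norm_num) (by norm_num)
    (twistInsensitiveAt_of_zeroFreeStrip hT hD hη (by norm_num) hθ₁ hZ)

/- v5: the instance `ThermalStiffnessCeilingU8b10_le_1o8_of_stubs` moved to the end of §K. -/

end Line

end Summit.Ventures.CertifiedManyBodySolver.Cruxes.ThermalStiffnessCeilingU8b10_le_1o8.ZerofreeCorridor

/-! ## §H (v2, after crit-1 VERDICT 02:15:10Z remark R1) The typed split `Z = Z_hot ∧ Z_cold` and the reshaped stub glue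

Not registered stubs: the registered stub set (§G) is unchanged. When a seat attacks `stub_zeroFreeStrip`, the lead/strategist may
reshape it into `stub_zeroFreeHot` + `stub_zeroFreeCold` with the glue `stub_zeroFreeStrip_of_hot_cold` below (both directions of the
split are proved: `zeroFreeStrip_of_hot_cold`, `hot_cold_of_zeroFreeStrip`). Z_hot is an equivalence-of-ensembles / local-CLT statement at
high temperature for the CANONICAL sector (grand-canonical Kotecký–Preiss does not give it); Z_cold says no thermodynamic singularity of any
kind on `T ≥ t/10` in the twisted canonical family. -/

namespace Summit.Ventures.CertifiedManyBodySolver.Cruxes.ThermalStiffnessCeilingU8b10_le_1o8.ZerofreeCorridor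

/-- Z_hot: an `L`-uniform zero-free box `(−η, η) × (−η, η)·i` around `β = 0` for the canonical twisted sector (equivalence of
ensembles / local CLT at high temperature; NOT given by grand-canonical Kotecký–Preiss). -/
def ZeroFreeHot (tp U n η θ₁ : ℝ) : Prop :=
  ∃ L₀ : ℕ, ∀ (L : ℕ) [NeZero L], L₀ ≤ L → ∀ θ : ℝ, |θ| ≤ θ₁ →
    ∀ β : ℂ, -η < β.re → β.re < η → |β.im| < η → thermalFluxZc L tp U (1 - n) θ β ≠ 0

/-- Z_cold: no zero within `η` of the real segment `[η, β₁]` (no thermodynamic singularity of ANY kind on `T ≥ 1/β₁` in the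
twisted canonical family, `L`-uniformly). -/
def ZeroFreeCold (tp U n β₁ η θ₁ : ℝ) : Prop :=
  ∃ L₀ : ℕ, ∀ (L : ℕ) [NeZero L], L₀ ≤ L → ∀ θ : ℝ, |θ| ≤ θ₁ →
    ∀ β : ℂ, η ≤ β.re → β.re < β₁ + η → |β.im| < η → thermalFluxZc L tp U (1 - n) θ β ≠ 0

/-- The glue of the split (R1): `Z_hot ∧ Z_cold → Z`. -/
theorem zeroFreeStrip_of_hot_cold {tp U n β₁ η θ₁ : ℝ} (hh : ZeroFreeHot tp U n η θ₁) (hc : ZeroFreeCold tp U n β₁ η θ₁) :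
    ZeroFreeStrip tp U n β₁ η θ₁ := by
  obtain ⟨L₁, h₁⟩ := hh
  obtain ⟨L₂, h₂⟩ := hc
  refine ⟨max L₁ L₂, fun L _ hL θ hθ β hre hre' him => ?_⟩
  rcases lt_or_ge β.re η with hlt | hle
  · exact h₁ L ((le_max_left _ _).trans hL) θ hθ β hre hlt him
  · exact h₂ L ((le_max_right _ _).trans hL) θ hθ β hle hre' him

/-- And conversely `Z → Z_hot ∧ Z_cold` when `η ≤ β₁ + η` (i.e. `0 ≤ β₁`), so the split loses nothing. -/
theorem hot_cold_of_zeroFreeStrip {tp U n β₁ η θ₁ : ℝ} (hβ : 0 ≤ β₁) (hZ : ZeroFreeStrip tp U n β₁ η θ₁) :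
    ZeroFreeHot tp U n η θ₁ ∧ ZeroFreeCold tp U n β₁ η θ₁ := by
  obtain ⟨L₀, h⟩ := hZ
  exact ⟨⟨L₀, fun L _ hL θ hθ β hre hre' him => h L hL θ hθ β hre (by linarith) him⟩,
    ⟨L₀, fun L _ hL θ hθ β hre hre' him => h L hL θ hθ β (by linarith [abs_nonneg β.im, hre]) hre' him⟩⟩


/-- Monotonicity of the hot box in `η`, `θ₁`. -/
theorem ZeroFreeHot.mono {tp U n η η' θ₁ θ₁' : ℝ} (h : ZeroFreeHot tp U n η θ₁) (hη : η' ≤ η) (hθ : θ₁' ≤ θ₁) :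
    ZeroFreeHot tp U n η' θ₁' := by
  obtain ⟨L₀, h⟩ := h
  exact ⟨L₀, fun L _ hL θ hθ' β hre hre' him =>
    h L hL θ (hθ'.trans hθ) β (by linarith) (by linarith) (lt_of_lt_of_le him hη)⟩

/-- Monotonicity of the cold region in `θ₁`. -/
theorem ZeroFreeCold.mono_theta {tp U n β₁ η θ₁ θ₁' : ℝ} (h : ZeroFreeCold tp U n β₁ η θ₁) (hθ : θ₁' ≤ θ₁) :
    ZeroFreeCold tp U n β₁ η θ₁' := by
  obtain ⟨L₀, h⟩ := h
  exact ⟨L₀, fun L _ hL θ hθ' β hre hre' him => h L hL θ (hθ'.trans hθ) β hre hre' him⟩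

/-- **Reshaped stub set (R1)**: `stub_zeroFreeHot ∧ stub_zeroFreeCold → stub_zeroFreeStrip` (the two bets aimed separately;
the cold bet is stated for all small widths `η ≤ η₀` so that the boxes glue). -/
theorem stub_zeroFreeStrip_of_hot_cold
    (hhot : ∃ η θ₁ : ℝ, 0 < η ∧ 0 < θ₁ ∧ ZeroFreeHot 0 8 (7 / 8) η θ₁)
    (hcold : ∃ η₀ θ₁ : ℝ, 0 < η₀ ∧ 0 < θ₁ ∧ ∀ η : ℝ, 0 < η → η ≤ η₀ → ZeroFreeCold 0 8 (7 / 8) 10 η θ₁) :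
    ∃ η θ₁ : ℝ, 0 < η ∧ 0 < θ₁ ∧ ZeroFreeStrip 0 8 (7 / 8) 10 η θ₁ := by
  obtain ⟨η₁, θ₁, hη₁, hθ₁, hh⟩ := hhot
  obtain ⟨η₀, θ₂, hη₀, hθ₂, hc⟩ := hcold
  refine ⟨min η₁ η₀, min θ₁ θ₂, lt_min hη₁ hη₀, lt_min hθ₁ hθ₂, zeroFreeStrip_of_hot_cold ?_ ?_⟩
  · exact hh.mono (min_le_left _ _) (min_le_left _ _)
  · exact (hc (min η₁ η₀) (lt_min hη₁ hη₀) (min_le_right _ _)).mono_theta (min_le_right _ _)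

end Summit.Ventures.CertifiedManyBodySolver.Cruxes.ThermalStiffnessCeilingU8b10_le_1o8.ZerofreeCorridor


/-! ## §K (v5/v6, g8 — lens «rescuer» on our own corpse: census r8 rows 71/72 and card remark R1 «grand-canonical Kotecký–Preiss does
not give Z_hot») THE HOT END IS REACHABLE WITHOUT ANY POSITIVITY STEP

`Z_hot` (an `L`-uniform zero-free box of the CANONICAL twisted sector partition function around `β = 0`) follows from three
statements, none of which is a canonical-ensemble statement:

* K1 `stub_fugacityProjection` — the FUGACITY-TORUS PROJECTION identity (Darwin–Fowler at complex `β`):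
  `Z_L(β,θ) = (2π)⁻² ∬ Ξ_L(β, re^{iφ}, re^{iψ}; θ) (re^{iφ})^{−m} (re^{iψ})^{−m} dψ dφ`, `m = ⌊(1−δ)L²/2⌋`, every `r > 0`, where
  `Ξ_L(β, ζ↑, ζ↓; θ) = Tr( diag(ζ↑^{N↑} ζ↓^{N↓}) e^{−β H_L(θ)} )` is the two-fugacity twisted grand-canonical trace (an identity of finite
  sums: `H_L(θ)` conserves `N↑, N↓`, so the sector block of `e^{−βH}` is `e^{−β H_block}`, and `∫₀^{2π} e^{i(k−m)φ} dφ = 2π·[k = m]`);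
* K2 `stub_gcHighTempAnalytic` — GRAND-CANONICAL complex high-temperature analyticity with two complex fugacities, uniform in the
  volume and in the twist: for `‖β‖ ≤ η₀(ε)` and `ζ` in the annulus `2/3 < |ζσ| < 8/9` (around the reference fugacity `r = 7/9` of
  density `7/16` per spin species; `|1 + ζ| ≥ 1/9` there, so the one-site normalisation never vanishes),
  `Ξ_L = (1+ζ↑)^{L²} (1+ζ↓)^{L²} · exp(L² h)` with `h` analytic on the annulus² and `‖h‖ ≤ ε` — the polymer/cluster expansion of
  Ueltschi 1999 (Thm 2.1 / Prop 2.2: analytic in `β` AND the vector `μ`, domain independent of `V`) at complex `(β, μ↑, μ↓)`, i.e. the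
  tree's #211 complex-fugacity activity layer (`Bounds/ComplexFugacityActivityBound|Analytic`) ported to complex `β` and a
  spin-resolved chemical potential;
* K3 `stub_largePowersSaddle2D` — a MODEL-FREE two-variable large-powers saddle estimate: for every analytic `h` on the annulus² with
  `‖h‖ ≤ ε₁` and all `M ≥ M₀`, the `(a,b)`-coefficient integral of `(1+z)^M (1+w)^M e^{M h(z,w)}` on `|z| = |w| = 7/9` with
  `|a − 7M/16|, |b − 7M/16| ≤ 1` is NON-ZERO (contour through the complex saddle `ζ* = 7/9·(1 + O(ε + 1/M))`, non-degenerate Hessian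
  `σ² = r/(1+r)² = 63/256`, Gaussian main term `≍ |e^{Φ*}|/(M σ²)` against an `e^{−cρ₀²M}` tail; Flajolet–Sedgewick Thm VIII.8 is the
  one-variable positive-coefficient case — here positivity (the daffodil lemma) is replaced by the explicit gap of `|1 + re^{iφ}|` and
  the smallness of `h`).

Composition `zeroFreeHot_of_stubs` (PROVED): with `ε₁, M₀` from K3 and `η₀ = η₀(ε₁)` from K2 at `(t′,U) = (0,8)`, the box
`|Re β|, |Im β| < η₀/2` and `L ≥ max 3 M₀` give `Z_L(β,θ) = torusCoeff(GC) = torusCoeff((1+z)^{L²}(1+w)^{L²}e^{L²h}) ≠ 0` for EVERY `θ`.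
Hence Hypothesis Z ⇐ {K1, K2, K3, Z_cold} (`zeroFreeStrip_of_stubs`); K1 `stub_fugacityProjection` is PROVED (v6) from the tree
helper `Theorems/TcThermcert1FugacityProjection.lean` (`hubbardTorusTT'Flux_sector_trace_exp_eq_torusIntegral`: circle moments,
coefficient extraction for finite sums, sector compression of `e^{−βH}` for `N↑,N↓`-conserving `H`), so the registered (sorried) stub
set of v6/v7 is {`stub_gcHighTempAnalytic`, `stub_largePowersSaddle2D`, `stub_zeroFreeCold`}; K1-crux BY NAME:
`ThermalStiffnessCeilingU8b10_le_1o8_of5` / `…_of_stubs`. v7 (crit-1 sharpenings s1–s3 to the KEEP verdict of 2026-08-29T04:54:55Z):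
the two contour radii are FREE — `torusCoeff F r₁ r₂ a b`, K1 holds for every `r₁, r₂ > 0` (two-radius extraction
`torusIntegral_finset_sum₂` proved here from the helper's circle moments), and K3 concludes `∃ r₁ r₂ ∈ (2/3, 8/9)` with a non-zero
coefficient, so the K3 prover owes no contour-deformation lemma; the K2 docstring separates cited METHOD from ported CONTENT; the
constant chain `ρ₀ → ε₁ → M₀ → η₀(ε₁) → η = η₀/2` is printed once (K3 docstring).

v8 (g9, BN-resc-10 — §L below): K3 is SPLIT and DERIVED. `stub_largePowersSaddle2D` keeps its statement byte-for-byte but is now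
PROVED from K3a `stub_boxLowerBound` (PROVED: tree `box_integral_re_lower_bound`) and K3b `stub_saddleGeometry` (OPEN in v8; PROVED v9) by the
kernel-checked composition `largePowersSaddle2D_of` (tree §5 lemmas `sq_integral_periodic_recentre`, `sq_integral_ne_zero_of_box`,
`eventually_mul_exp_neg_lt_div`). The real-analysis half of the saddle estimate (Gaussian centre vs. tails, `cos ≥ 1/2` on the
`V/√M`-square, the `1/M` scale) is thereby banked; what remains open in K3 is GEOMETRY ONLY: a continuous exponent `Φ` of the
integrand on the torus through the complex critical point with two-sided quadratic real part, `τ₀`-small imaginary quadratic part,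
cubic remainder `K`, and a uniform gap `γ` off the `ρ`-box.

v9 (g9, BN-resc-10b — §M): K3b `stub_saddleGeometry` is PROVED (`:= saddle_geometry`, tree `Theorems/TcThermcert1SaddleGeometry.lean`),
so K3 is proved outright and the registered open stubs are {K2 `stub_gcHighTempAnalytic`, Z_cold `stub_zeroFreeCold`}; no statement changed.

v10 (g10, BN-resc-11 — §N): K2 `stub_gcHighTempAnalytic` is PROVED (`:= gcHighTempAnalytic tp U hε`, tree
`Theorems/TcThermcert1GcHighTemperature.lean` on top of `TcThermcert1GcClusterExpansion.lean` and the ten `TcThermcert1Gc*` parts), so the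
hot end `Z_hot` is a theorem and the registered open stubs are {Z_cold `stub_zeroFreeCold`}; no statement changed. §N adds the PROVED
β₁-family socket `leafAtBeta_of_zeroFreeCold` (any anchor `β₁ > 0`, any `c ≥ 0`).

Disproof honoured: `k1_false_without_theta0_pos` / `_fluxPremise` as before (the flux premise is consumed at a positive twist in §F);
nothing here touches the cold end (`stub_zeroFreeCold` = THE BET, unchanged in content from R1). References: D. Ueltschi, J. Stat.
Phys. 95 (1999) 693 [Ueltschi1999, Thm 2.1, Prop 2.2]; R. Kotecký, D. Preiss, CMP 103 (1986) 491 [KoteckyPreiss1986]; S. Friedli,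
Y. Velenik, Statistical Mechanics of Lattice Systems (2017) Thm 5.4, §5.7; P. Flajolet, R. Sedgewick, Analytic Combinatorics (2009)
Thm VIII.8, Thm IX.8; R. H. Fowler, Statistical Mechanics (1936) ch. II (Darwin–Fowler method). -/

namespace Summit.Ventures.CertifiedManyBodySolver.Cruxes.ThermalStiffnessCeilingU8b10_le_1o8.ZerofreeCorridor

open Matrix Finset Complex MeasureTheory intervalIntegral
open Literature.MathematicalPhysics.QuantumLattice

section HotEnd

open Summit.Ventures.CertifiedManyBodySolver.Theorems.TcThermcert1.ZeroFreeCorridor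

/-- **The two-fugacity twisted grand-canonical trace at complex inverse temperature**
`Ξ_L(β, ζ↑, ζ↓; θ) = Tr( diag(ζ↑^{N↑(s)} ζ↓^{N↓(s)}) · e^{−β H^{tt′}_L(θ)} )` (a polynomial of bidegree `(L², L²)` in the
fugacities, entire in `β`). -/
def gcTwistZc2 (L : ℕ) [NeZero L] (tp U θ : ℝ) (β ζu ζd : ℂ) : ℂ :=
  (diagonal (fun s : Finset (Orb (FermionTorus 2 L)) => ζu ^ (upPart s).card * ζd ^ (downPart s).card) *
      NormedSpace.exp (-β • hubbardTorusTT'Flux L tp U θ)).trace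

/-- **Two-variable coefficient extraction on the torus `|z| = r₁, |w| = r₂`** (v7: the two radii are FREE — crit-1 s2 — so that a
prover may put each circle through the complex saddle; on the canonical side every pair of radii is exact by K1):
`torusCoeff F r₁ r₂ a b = (2π)⁻² ∫₀^{2π} ∫₀^{2π} F(r₁e^{iφ}, r₂e^{iψ}) (r₁e^{iφ})^{−a} (r₂e^{iψ})^{−b} dψ dφ`. -/
def torusCoeff (F : ℂ → ℂ → ℂ) (r₁ r₂ : ℝ) (a b : ℕ) : ℂ :=
  ((2 * Real.pi : ℂ) ^ 2)⁻¹ *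
    ∫ φ in (0 : ℝ)..2 * Real.pi, ∫ ψ in (0 : ℝ)..2 * Real.pi,
      F ((r₁ : ℂ) * cexp ((φ : ℂ) * I)) ((r₂ : ℂ) * cexp ((ψ : ℂ) * I)) /
        (((r₁ : ℂ) * cexp ((φ : ℂ) * I)) ^ a * ((r₂ : ℂ) * cexp ((ψ : ℂ) * I)) ^ b)

/-- The fugacity annulus `2/3 < |ζ| < 8/9` around the reference fugacity `r = 7/9` of density `7/16` per spin species
(`|1 + ζ| ≥ 1/9` on it). -/
def fugAnnulus : Set ℂ := {ζ : ℂ | 2 / 3 < ‖ζ‖ ∧ ‖ζ‖ < 8 / 9}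

/-- A circle of radius `r ∈ (2/3, 8/9)` lies in the annulus. -/
theorem mem_fugAnnulus_of_radius {r : ℝ} (hr : 2 / 3 < r) (hr' : r < 8 / 9) (φ : ℝ) :
    (r : ℂ) * cexp ((φ : ℂ) * I) ∈ fugAnnulus := by
  have h : ‖(r : ℂ) * cexp ((φ : ℂ) * I)‖ = r := by
    rw [norm_mul, Complex.norm_real, Complex.norm_exp_ofReal_mul_I, mul_one, Real.norm_eq_abs,
      abs_of_pos (by linarith)]
  exact ⟨by rw [h]; exact hr, by rw [h]; exact hr'⟩

/-- `torusCoeff` only samples the two circles `|z| = r₁`, `|w| = r₂`: integrands that agree there have the same coefficient. -/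
theorem torusCoeff_congr {F G : ℂ → ℂ → ℂ} {r₁ r₂ : ℝ} (a b : ℕ)
    (h : ∀ φ ψ : ℝ, F ((r₁ : ℂ) * cexp ((φ : ℂ) * I)) ((r₂ : ℂ) * cexp ((ψ : ℂ) * I)) =
      G ((r₁ : ℂ) * cexp ((φ : ℂ) * I)) ((r₂ : ℂ) * cexp ((ψ : ℂ) * I))) :
    torusCoeff F r₁ r₂ a b = torusCoeff G r₁ r₂ a b := by
  unfold torusCoeff
  congr 1
  refine intervalIntegral.integral_congr fun φ _ => ?_
  refine intervalIntegral.integral_congr fun ψ _ => ?_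
  simp only [h φ ψ]

/-- **Coefficient extraction on a torus with two radii** (the tree helper's `torusIntegral_finset_sum` with `|z| = r₁`, `|w| = r₂`):
`(2π)⁻² ∬ (Σ_i c_i z^{k_i} w^{l_i}) z^{−a} w^{−b} dψ dφ = Σ_{i : k_i = a, l_i = b} c_i`. -/
theorem torusIntegral_finset_sum₂ {ι : Type*} (s : Finset ι) (c : ι → ℂ) (k l : ι → ℕ) {r₁ r₂ : ℝ}
    (hr₁ : 0 < r₁) (hr₂ : 0 < r₂) (a b : ℕ) :
    ((2 * Real.pi : ℂ) ^ 2)⁻¹ * ∫ φ in (0 : ℝ)..2 * Real.pi, ∫ ψ in (0 : ℝ)..2 * Real.pi,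
      (∑ i ∈ s, c i * (((r₁ : ℂ) * cexp ((φ : ℂ) * I)) ^ k i * ((r₂ : ℂ) * cexp ((ψ : ℂ) * I)) ^ l i)) /
        (((r₁ : ℂ) * cexp ((φ : ℂ) * I)) ^ a * ((r₂ : ℂ) * cexp ((ψ : ℂ) * I)) ^ b) =
      ∑ i ∈ s, if k i = a ∧ l i = b then c i else 0 := by
  -- the inner integral, for fixed `φ`
  have hinner : ∀ φ : ℝ, ∫ ψ in (0 : ℝ)..2 * Real.pi,
      (∑ i ∈ s, c i * (((r₁ : ℂ) * cexp ((φ : ℂ) * I)) ^ k i * ((r₂ : ℂ) * cexp ((ψ : ℂ) * I)) ^ l i)) /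
        (((r₁ : ℂ) * cexp ((φ : ℂ) * I)) ^ a * ((r₂ : ℂ) * cexp ((ψ : ℂ) * I)) ^ b) =
      ∑ i ∈ s, (c i * (if l i = b then (2 * Real.pi : ℂ) else 0)) *
        (((r₁ : ℂ) * cexp ((φ : ℂ) * I)) ^ k i / ((r₁ : ℂ) * cexp ((φ : ℂ) * I)) ^ a) := by
    intro φ
    have hpt : ∀ ψ : ℝ,
        (∑ i ∈ s, c i * (((r₁ : ℂ) * cexp ((φ : ℂ) * I)) ^ k i * ((r₂ : ℂ) * cexp ((ψ : ℂ) * I)) ^ l i)) /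
          (((r₁ : ℂ) * cexp ((φ : ℂ) * I)) ^ a * ((r₂ : ℂ) * cexp ((ψ : ℂ) * I)) ^ b) =
        ∑ i ∈ s, (c i * (((r₁ : ℂ) * cexp ((φ : ℂ) * I)) ^ k i / ((r₁ : ℂ) * cexp ((φ : ℂ) * I)) ^ a)) *
          (((r₂ : ℂ) * cexp ((ψ : ℂ) * I)) ^ l i / ((r₂ : ℂ) * cexp ((ψ : ℂ) * I)) ^ b) := by
      intro ψ
      rw [Finset.sum_div]
      refine Finset.sum_congr rfl fun i _ => ?_
      rw [mul_div_assoc, mul_div_mul_comm, mul_assoc]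
    simp_rw [hpt]
    have hint : ∀ i ∈ s, IntervalIntegrable
        (fun ψ : ℝ => (c i * (((r₁ : ℂ) * cexp ((φ : ℂ) * I)) ^ k i / ((r₁ : ℂ) * cexp ((φ : ℂ) * I)) ^ a)) *
          (((r₂ : ℂ) * cexp ((ψ : ℂ) * I)) ^ l i / ((r₂ : ℂ) * cexp ((ψ : ℂ) * I)) ^ b)) volume 0 (2 * Real.pi) :=
      fun i _ => (continuous_const.mul (continuous_circlePoint_pow_div hr₂ (l i) b)).intervalIntegrable _ _
    rw [intervalIntegral.integral_finsetSum hint]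
    refine Finset.sum_congr rfl fun i _ => ?_
    rw [intervalIntegral.integral_const_mul, integral_circlePoint_pow_div hr₂]
    ring
  simp_rw [hinner]
  have hint' : ∀ i ∈ s, IntervalIntegrable
      (fun φ : ℝ => (c i * (if l i = b then (2 * Real.pi : ℂ) else 0)) *
        (((r₁ : ℂ) * cexp ((φ : ℂ) * I)) ^ k i / ((r₁ : ℂ) * cexp ((φ : ℂ) * I)) ^ a)) volume 0 (2 * Real.pi) :=
    fun i _ => (continuous_const.mul (continuous_circlePoint_pow_div hr₁ (k i) a)).intervalIntegrable _ _
  rw [intervalIntegral.integral_finsetSum hint']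
  simp_rw [intervalIntegral.integral_const_mul, integral_circlePoint_pow_div hr₁, Finset.mul_sum]
  refine Finset.sum_congr rfl fun i _ => ?_
  have hπ : (2 * Real.pi : ℂ) ≠ 0 := by exact_mod_cast Real.two_pi_pos.ne'
  by_cases hk : k i = a <;> by_cases hl : l i = b <;> simp [hk, hl]; field_simp

/-- **The fugacity-torus projection identity with two radii** (Darwin–Fowler at complex `β`; the tree helper's
`trace_exp_neg_smul_toBlock_eq_torusIntegral` on `|ζ↑| = r₁`, `|ζ↓| = r₂`). -/
theorem trace_exp_neg_smul_toBlock_eq_torusIntegral₂ {Λ : Type*} [LinearOrder Λ] [Fintype Λ]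
    {inst : DecidableEq (Finset (Orb Λ))} (H : Matrix (Finset (Orb Λ)) (Finset (Orb Λ)) ℂ)
    (hH : PreservesSectors H) (p : Finset (Orb Λ) → Prop) [DecidablePred p] (a b : ℕ)
    (hp : ∀ s, p s ↔ (upPart s).card = a ∧ (downPart s).card = b) (β : ℂ) {r₁ r₂ : ℝ} (hr₁ : 0 < r₁) (hr₂ : 0 < r₂) :
    (NormedSpace.exp (-β • H.toBlock p p)).trace =
      ((2 * Real.pi : ℂ) ^ 2)⁻¹ * ∫ φ in (0 : ℝ)..2 * Real.pi, ∫ ψ in (0 : ℝ)..2 * Real.pi,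
        (@diagonal _ ℂ inst _ (fun s : Finset (Orb Λ) =>
            ((r₁ : ℂ) * cexp ((φ : ℂ) * I)) ^ (upPart s).card * ((r₂ : ℂ) * cexp ((ψ : ℂ) * I)) ^ (downPart s).card) *
          NormedSpace.exp (-β • H)).trace /
          (((r₁ : ℂ) * cexp ((φ : ℂ) * I)) ^ a * ((r₂ : ℂ) * cexp ((ψ : ℂ) * I)) ^ b) := by
  rw [trace_exp_neg_smul_toBlock_eq_sum_ite H hH p a b hp β]
  simp_rw [trace_diagonal_fugacity_mul]
  rw [torusIntegral_finset_sum₂]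
  · refine Finset.sum_congr rfl fun s _ => ?_
    simp only [hp s]
  · exact hr₁
  · exact hr₂

/-- **stub K1 — the fugacity-torus projection identity (Darwin–Fowler at complex `β`).** The canonical `(N↑,N↓) = (m,m)` sector
partition function of the twisted torus is the `(m,m)`-coefficient of the two-fugacity grand-canonical trace, `m = ⌊(1−δ)L²/2⌋`, on any
pair of circles `|ζ↑| = r₁ > 0`, `|ζ↓| = r₂ > 0` (v7: two free radii). An identity of finite sums (`H_L(θ)` conserves `N↑, N↓`;
`∫₀^{2π} e^{i(k−m)φ}dφ = 2π[k=m]`); PROVED from the tree helper `TcThermcert1FugacityProjection` (circle moments, sector compression,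
`#s = 2m ∧ 2·#{spin 0} = 2m ⟺ #↑ = #↓ = m`) and the two-radius extraction above. [folklore; tree `Bounds/SectorFourierProjection` is
the one-charge, roots-of-unity version] -/
theorem stub_fugacityProjection :
    ∀ (L : ℕ) [NeZero L] (tp U δ θ : ℝ) (β : ℂ) (r₁ r₂ : ℝ), 0 < r₁ → 0 < r₂ →
      thermalFluxZc L tp U δ θ β =
        torusCoeff (gcTwistZc2 L tp U θ β) r₁ r₂ (⌊(1 - δ) * (L : ℝ) ^ 2 / 2⌋₊) (⌊(1 - δ) * (L : ℝ) ^ 2 / 2⌋₊) := by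
  intro L _ tp U δ θ β r₁ r₂ hr₁ hr₂
  unfold thermalFluxZc fluxBlock torusCoeff gcTwistZc2
  exact trace_exp_neg_smul_toBlock_eq_torusIntegral₂ _ (preservesSectors_hubbardTorusTT'Flux L tp U θ) (fluxSector L δ)
    (⌊(1 - δ) * (L : ℝ) ^ 2 / 2⌋₊) (⌊(1 - δ) * (L : ℝ) ^ 2 / 2⌋₊) (fun s => card_and_two_mul_card_filter_iff s _) β hr₁ hr₂

/-- **stub K2 — grand-canonical complex high-temperature analyticity with two complex fugacities, uniform in `L` and `θ`. PROVED (v10)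
from the tree: `Theorems/TcThermcert1GcHighTemperature.lean`, `gcHighTempAnalytic` (statement identical; `gcTwistZc2`/`fugAnnulus` unfold
by `rfl`).**
For every `ε > 0` there is `η₀ > 0` such that for all `L ≥ 3`, all twists `θ` and all complex `β` with `‖β‖ ≤ η₀`:
`Ξ_L(β, ζ↑, ζ↓; θ) = (1+ζ↑)^{L²} (1+ζ↓)^{L²} exp(L² h(ζ↑,ζ↓))` on the annulus², with `h` analytic there and `‖h‖ ≤ ε`.
Why plausibly true: at `β = 0` it holds with `h = 0`; for small `‖β‖` it is the Kotecký–Preiss / Ueltschi polymer expansion of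
`log Ξ_L` at complex `(β, μ↑, μ↓)` (one-site normalisation `z₀ = 1 + ζ↑ + ζ↓ + ζ↑ζ↓e^{−βU}`, `|z₀| ≥ 1/81 − O(‖β‖U)` on the annulus²;
activities `∝ (‖β‖(1+|t′|))^{#bonds}`, `θ` enters only through phases), `h = L⁻²·(polymer log)`, analytic as a locally uniform limit /
local `clog`, and `‖h‖ ≤ a(‖β‖) → 0`. Size L (port of the tree's #211 complex-fugacity layer to complex `β` + spin-resolved `μ`). NOTE (crit-1
s1): the cited theorems support the METHOD (Kotecký–Preiss with weights analytic in `(β, μ)`, convergence domain independent of the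
volume); the `L`-uniform bound over a COMPLEX fugacity annulus of arbitrary phase (`|(1+ζ↑)(1+ζ↓)| ≥ 1/81`, site ratio ≤ 289, hence a
KP-tiny `η₀`) is the content of the port, not a quotation. [cite: Ueltschi1999, Thm 2.1 and Prop 2.2; KoteckyPreiss1986] -/
theorem stub_gcHighTempAnalytic :
    ∀ tp U : ℝ, ∀ ε : ℝ, 0 < ε → ∃ η₀ : ℝ, 0 < η₀ ∧
      ∀ (L : ℕ) [NeZero L], 3 ≤ L → ∀ θ : ℝ, ∀ β : ℂ, ‖β‖ ≤ η₀ →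
        ∃ h : ℂ × ℂ → ℂ, AnalyticOnNhd ℂ h (fugAnnulus ×ˢ fugAnnulus) ∧
          (∀ ζ ∈ fugAnnulus ×ˢ fugAnnulus, ‖h ζ‖ ≤ ε) ∧
          ∀ ζ ∈ fugAnnulus ×ˢ fugAnnulus,
            gcTwistZc2 L tp U θ β ζ.1 ζ.2 =
              (1 + ζ.1) ^ (L ^ 2) * (1 + ζ.2) ^ (L ^ 2) * cexp ((L : ℂ) ^ 2 * h ζ) := by
  intro tp U ε hε
  exact gcHighTempAnalytic tp U hε

/-! ### §L (v8, g9 — BN-resc-10) THE TYPED SPLIT OF K3: local box lower bound (K3a, PROVED) + saddle geometry (K3b, PROVED v9) ⇒ K3 (PROVED)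

Write the `(a,b)`-coefficient integrand on the torus `|z| = r₁, |w| = r₂` as `e^{M Φ(φ,ψ)}` with a continuous exponent `Φ`
(`Φ = log(1+z) + log(1+w) + h(z,w) − (a/M)(log r₁ + iφ) − (b/M)(log r₂ + iψ)`, principal logs, `Re(1+z) > 0`). Then
`(2π)² · torusCoeff = e^{MΦ₀} ∬_{[−π,π]²} e^{M G(u,v)} du dv`, `G(u,v) = Φ(φ₀+u, ψ₀+v) − Φ(φ₀,ψ₀)`, for ANY centre `(φ₀,ψ₀)`
(periodic recentring — tree `sq_integral_periodic_recentre`). K3 therefore follows from: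
* K3a `stub_boxLowerBound` (PROVED, tree `box_integral_re_lower_bound`): if on the box `|u|,|v| ≤ ρ` one has
  `−S(u²+v²) ≤ Re G ≤ −s(u²+v²)` and `|Im G| ≤ τ₀(u²+v²) + K(|u|+|v|)³` with `τ₀ = τ₀(ρ,s,S,K)` small enough, then
  `Re ∬_{[−ρ,ρ]²} e^{MG} ≥ c/M` for `M ≥ M₀` (`c = e^{−2S}`; centre square of side `V/√M` where the phase is `≤ 1`, Gaussian tails);
* K3b `stub_saddleGeometry` (PROVED v9, tree `saddle_geometry`): the exponent `Φ` exists with those box bounds at the critical point `(φ₀,ψ₀)` of the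
  perturbed phase (radii `r₁, r₂` = moduli of the critical fugacities) for absolute `ρ, s, S, K`, ANY prescribed `τ₀ > 0` (by taking
  `ε₁ = ε₁(τ₀)` small), and a uniform gap `Re G ≤ −γ` off the box;
* K3c `largePowersSaddle2D_of` (PROVED): box `≥ c/M`, off-box `|e^{MG}| ≤ e^{−γM}` on area `≤ 8π²`, and `8π² e^{−γM} < c/M` for
  `M ≥ M₂` (tree `sq_integral_ne_zero_of_box`, `eventually_mul_exp_neg_lt_div`), so `torusCoeff = (2π)⁻² e^{MΦ₀} · (≠ 0) ≠ 0`.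
DEPENDENCE CHAIN (fixed by the quantifier order, crit-1 s3 respected): K3b gives absolute `ρ, s, S, K, γ`; K3a turns them into
`τ₀, c, M₀`; K3b at that `τ₀` gives `ε₁, M₁`; `M₂ = M₂(γ, c)`; K3 holds with `ε₁` and `max M₀ (max M₁ M₂)`. -/

/-- Rotating an angle by `2π` does not move the point on the circle. -/
theorem cexp_add_two_pi_mul_I (x : ℝ) : cexp (((x + 2 * Real.pi : ℝ) : ℂ) * I) = cexp ((x : ℂ) * I) := by
  push_cast
  rw [add_mul, Complex.exp_add, Complex.exp_two_pi_mul_I, mul_one]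

/-- **stub K3a — the local box lower bound (PROVED: tree `Theorems/TcThermcert1SaddleBoxLowerBound.lean`,
`box_integral_re_lower_bound`; model-free real analysis).** Given `0 < ρ`, `0 < s`, `0 < S`, `0 ≤ K` there are `τ₀ > 0`, `c > 0`, `M₀`
such that for all `M ≥ M₀` and all jointly continuous `G` with, on `|u|,|v| ≤ ρ`, `−S(u²+v²) ≤ Re G ≤ −s(u²+v²)` and
`|Im G| ≤ τ₀(u²+v²) + K(|u|+|v|)³`: `c/M ≤ Re ∫_{−ρ}^{ρ}∫_{−ρ}^{ρ} e^{M G(u,v)} dv du`. (`τ₀ = 1/(4V²)`, `c = e^{−2S}`,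
`M₀ = ⌈V²/ρ²⌉₊ + ⌈256K²V⁶⌉₊ + 1`, `sV² = s + 2S + (√(π/s)+2)/s`.) [folklore: Laplace method with a complex phase; de Bruijn,
Asymptotic Methods in Analysis (1958) ch. 4; FlajoletSedgewick2009 Thm VIII.8] -/
theorem stub_boxLowerBound :
    ∀ ρ s S K : ℝ, 0 < ρ → 0 < s → 0 < S → 0 ≤ K →
      ∃ τ₀ : ℝ, 0 < τ₀ ∧ ∃ c : ℝ, 0 < c ∧ ∃ M₀ : ℕ, ∀ M : ℕ, M₀ ≤ M →
        ∀ G : ℝ → ℝ → ℂ, Continuous (Function.uncurry G) →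
          (∀ u v : ℝ, |u| ≤ ρ → |v| ≤ ρ →
              (G u v).re ≤ -s * (u ^ 2 + v ^ 2) ∧ -S * (u ^ 2 + v ^ 2) ≤ (G u v).re ∧
                |(G u v).im| ≤ τ₀ * (u ^ 2 + v ^ 2) + K * (|u| + |v|) ^ 3) →
            c / M ≤ (∫ u in (-ρ)..ρ, ∫ v in (-ρ)..ρ, Complex.exp ((M : ℂ) * G u v)).re :=
  fun _ _ _ _ hρ hs hS hK => box_integral_re_lower_bound hρ hs hS hK

/-- **stub K3b — saddle geometry of the perturbed large-powers exponent on the fugacity torus (PROVED v9: tree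
`Theorems/TcThermcert1SaddleGeometry.lean`, `saddle_geometry` — `ρ = 10⁻⁶`, `s = 1/20`, `S = 1/5`, `K = 16501`, `γ = ρ²/200`,
`ε₁ = min(τ₀/412, ρ²/1000)`, `M₁ = 300`; v8: OPEN, size M–L).**
There are ABSOLUTE constants `0 < ρ ≤ π`, `0 < s`, `0 < S`, `0 ≤ K`, `0 < γ` such that for every `τ₀ > 0` there are `ε₁ > 0` and `M₁`
with: for all `M ≥ M₁`, all `a, b` with `|a − 7M/16|, |b − 7M/16| ≤ 1` and every `h` analytic on the annulus² with `‖h‖ ≤ ε₁`, there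
are radii `r₁, r₂ ∈ (2/3, 8/9)`, a centre `(φ₀, ψ₀)` and a jointly continuous `Φ : ℝ → ℝ → ℂ` such that
(i) the `torusCoeff` integrand of `(1+z)^M (1+w)^M e^{M h(z,w)}` at `z = r₁e^{iφ}`, `w = r₂e^{iψ}` equals `e^{M Φ(φ,ψ)}` for all real
`φ, ψ`; (ii) on the box `|u|,|v| ≤ ρ`: `−S(u²+v²) ≤ Re(Φ(φ₀+u,ψ₀+v) − Φ(φ₀,ψ₀)) ≤ −s(u²+v²)` and
`|Im(Φ(φ₀+u,ψ₀+v) − Φ(φ₀,ψ₀))| ≤ τ₀(u²+v²) + K(|u|+|v|)³`; (iii) off the box (`|u|,|v| ≤ π`, `ρ ≤ |u| ∨ ρ ≤ |v|`):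
`Re(Φ(φ₀+u,ψ₀+v) − Φ(φ₀,ψ₀)) ≤ −γ`.
Why plausibly true: `Φ(φ,ψ) = log(1+z) + log(1+w) + h(z,w) − (a/M)(log r₁ + iφ) − (b/M)(log r₂ + iψ)` (principal logs; `|z|,|w| < 8/9`
so `Re(1+z) > 0`; `e^{MΦ}` = the integrand since `M·(a/M) = a`). Take `(z₀,w₀) = (r₁e^{iφ₀}, r₂e^{iψ₀})` = THE COMPLEX CRITICAL POINT
`z/(1+z) + z∂_z h = a/M`, `w/(1+w) + w∂_w h = b/M` (Banach fixed point in `ℂ²` around the unperturbed saddle `α/(1−α)`, `α = a/M = 7/16 ± 1/M`,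
i.e. `7/9 + O(ε₁ + 1/M)`; `d(z/(1+z))/dz = (1+z)^{−2} ≠ 0`; Cauchy bounds `|∂h| ≤ 18ε₁`, `|∂²h| ≤ 648ε₁`, `|∂³h| = O(ε₁)` at margin `1/18`), so the
LINEAR term of `u ↦ Φ(φ₀+u, ψ₀+v)` vanishes. Quadratic part: `∂²_φ log(1+z) = −z/(1+z)² = −63/256 + O(ε₁ + 1/M)` (real `< 0` up to `O(ε₁)`
imaginary part), cross term `O(ε₁)` (only through `h`); hence `s, S = 63/512 ∓ 1/100`, the imaginary quadratic coefficient `≤ C ε₁ ≤ τ₀` for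
`ε₁ ≤ τ₀/C`, and the cubic Taylor remainder (third derivatives of `log(1+re^{iφ})` and of `h∘torus`, uniformly bounded) gives an absolute `K`
— on `|u|,|v| ≤ ρ` its real part `≤ 4Kρ(u²+v²)` is absorbed in `s, S` for `ρ` absolute small. Gap: `log|1+r e^{i(φ₀+u)}| − log|1+z₀| ≤
−c₀ min(u², ρ²)/4 + Cφ₀²` with `φ₀ = O(ε₁)`, `|Re(h − h₀)| ≤ 2ε₁`, the `w`-terms likewise `≤ Cε₁²` — so `γ = c₀ρ²/8` once `ε₁ ≤ c′ρ²`
(`ε₁ = min(τ₀/C, c′ρ²)` is chosen AFTER `ρ, γ, τ₀`, as the quantifier order allows). Why it might fail: only by mis-typing — the critical point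
must be EXACT (a residual linear term `iλu` is not absorbed by K3a), and `Φ` must be a GLOBAL continuous exponent (it is: principal `log(1+z)`
is continuous on `|z| < 1`). Disproof honoured: nothing here touches `k1_false_without_theta0_pos` / `_fluxPremise` (hot end only; the flux premise
is still consumed at a positive twist in §F); no landed Negative lemma concerns the hot end. [cite: FlajoletSedgewick2009, Thm VIII.8 (large powers)
and Thm IX.8; PemantleWilson2013, ch. 5 (Fourier–Laplace integrals with complex phase) and Thm 9.2.7 (smooth critical points); de Bruijn 1958 ch. 4–5;
presearch: corpus `greene1981-mathematics-analysis-algorithms` pp. 45–55 (saddle point bounds for large powers, one variable, positive) — the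
METHOD is in print, the two-variable torus statement with an `ε₁`-perturbation at a complex critical point is the content of the stub] -/
theorem stub_saddleGeometry :
    ∃ ρ s S K γ : ℝ, 0 < ρ ∧ 0 < s ∧ 0 < S ∧ 0 ≤ K ∧ 0 < γ ∧ ρ ≤ Real.pi ∧
      ∀ τ₀ : ℝ, 0 < τ₀ → ∃ ε₁ : ℝ, 0 < ε₁ ∧ ∃ M₁ : ℕ, ∀ M : ℕ, M₁ ≤ M →
        ∀ a b : ℕ, |(a : ℝ) - 7 / 16 * M| ≤ 1 → |(b : ℝ) - 7 / 16 * M| ≤ 1 →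
          ∀ h : ℂ × ℂ → ℂ, AnalyticOnNhd ℂ h (fugAnnulus ×ˢ fugAnnulus) →
            (∀ ζ ∈ fugAnnulus ×ˢ fugAnnulus, ‖h ζ‖ ≤ ε₁) →
            ∃ r₁ r₂ : ℝ, 2 / 3 < r₁ ∧ r₁ < 8 / 9 ∧ 2 / 3 < r₂ ∧ r₂ < 8 / 9 ∧
              ∃ φ₀ ψ₀ : ℝ, ∃ Φ : ℝ → ℝ → ℂ, Continuous (Function.uncurry Φ) ∧
                (∀ φ ψ : ℝ,
                  (1 + (r₁ : ℂ) * cexp ((φ : ℂ) * I)) ^ M * (1 + (r₂ : ℂ) * cexp ((ψ : ℂ) * I)) ^ M *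
                      cexp ((M : ℂ) * h ((r₁ : ℂ) * cexp ((φ : ℂ) * I), (r₂ : ℂ) * cexp ((ψ : ℂ) * I))) /
                    (((r₁ : ℂ) * cexp ((φ : ℂ) * I)) ^ a * ((r₂ : ℂ) * cexp ((ψ : ℂ) * I)) ^ b) =
                  cexp ((M : ℂ) * Φ φ ψ)) ∧
                (∀ u v : ℝ, |u| ≤ ρ → |v| ≤ ρ →
                  (Φ (φ₀ + u) (ψ₀ + v) - Φ φ₀ ψ₀).re ≤ -s * (u ^ 2 + v ^ 2) ∧
                  -S * (u ^ 2 + v ^ 2) ≤ (Φ (φ₀ + u) (ψ₀ + v) - Φ φ₀ ψ₀).re ∧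
                  |(Φ (φ₀ + u) (ψ₀ + v) - Φ φ₀ ψ₀).im| ≤ τ₀ * (u ^ 2 + v ^ 2) + K * (|u| + |v|) ^ 3) ∧
                (∀ u v : ℝ, |u| ≤ Real.pi → |v| ≤ Real.pi → (ρ ≤ |u| ∨ ρ ≤ |v|) →
                  (Φ (φ₀ + u) (ψ₀ + v) - Φ φ₀ ψ₀).re ≤ -γ) :=
  saddle_geometry

/-- **K3c — the composition (PROVED): local box lower bound (K3a) + saddle geometry (K3b) ⇒ K3.** -/
theorem largePowersSaddle2D_of
    (hA : ∀ ρ s S K : ℝ, 0 < ρ → 0 < s → 0 < S → 0 ≤ K →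
      ∃ τ₀ : ℝ, 0 < τ₀ ∧ ∃ c : ℝ, 0 < c ∧ ∃ M₀ : ℕ, ∀ M : ℕ, M₀ ≤ M →
        ∀ G : ℝ → ℝ → ℂ, Continuous (Function.uncurry G) →
          (∀ u v : ℝ, |u| ≤ ρ → |v| ≤ ρ →
              (G u v).re ≤ -s * (u ^ 2 + v ^ 2) ∧ -S * (u ^ 2 + v ^ 2) ≤ (G u v).re ∧
                |(G u v).im| ≤ τ₀ * (u ^ 2 + v ^ 2) + K * (|u| + |v|) ^ 3) →
            c / M ≤ (∫ u in (-ρ)..ρ, ∫ v in (-ρ)..ρ, Complex.exp ((M : ℂ) * G u v)).re)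
    (hB : ∃ ρ s S K γ : ℝ, 0 < ρ ∧ 0 < s ∧ 0 < S ∧ 0 ≤ K ∧ 0 < γ ∧ ρ ≤ Real.pi ∧
      ∀ τ₀ : ℝ, 0 < τ₀ → ∃ ε₁ : ℝ, 0 < ε₁ ∧ ∃ M₁ : ℕ, ∀ M : ℕ, M₁ ≤ M →
        ∀ a b : ℕ, |(a : ℝ) - 7 / 16 * M| ≤ 1 → |(b : ℝ) - 7 / 16 * M| ≤ 1 →
          ∀ h : ℂ × ℂ → ℂ, AnalyticOnNhd ℂ h (fugAnnulus ×ˢ fugAnnulus) →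
            (∀ ζ ∈ fugAnnulus ×ˢ fugAnnulus, ‖h ζ‖ ≤ ε₁) →
            ∃ r₁ r₂ : ℝ, 2 / 3 < r₁ ∧ r₁ < 8 / 9 ∧ 2 / 3 < r₂ ∧ r₂ < 8 / 9 ∧
              ∃ φ₀ ψ₀ : ℝ, ∃ Φ : ℝ → ℝ → ℂ, Continuous (Function.uncurry Φ) ∧
                (∀ φ ψ : ℝ,
                  (1 + (r₁ : ℂ) * cexp ((φ : ℂ) * I)) ^ M * (1 + (r₂ : ℂ) * cexp ((ψ : ℂ) * I)) ^ M *
                      cexp ((M : ℂ) * h ((r₁ : ℂ) * cexp ((φ : ℂ) * I), (r₂ : ℂ) * cexp ((ψ : ℂ) * I))) /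
                    (((r₁ : ℂ) * cexp ((φ : ℂ) * I)) ^ a * ((r₂ : ℂ) * cexp ((ψ : ℂ) * I)) ^ b) =
                  cexp ((M : ℂ) * Φ φ ψ)) ∧
                (∀ u v : ℝ, |u| ≤ ρ → |v| ≤ ρ →
                  (Φ (φ₀ + u) (ψ₀ + v) - Φ φ₀ ψ₀).re ≤ -s * (u ^ 2 + v ^ 2) ∧
                  -S * (u ^ 2 + v ^ 2) ≤ (Φ (φ₀ + u) (ψ₀ + v) - Φ φ₀ ψ₀).re ∧
                  |(Φ (φ₀ + u) (ψ₀ + v) - Φ φ₀ ψ₀).im| ≤ τ₀ * (u ^ 2 + v ^ 2) + K * (|u| + |v|) ^ 3) ∧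
                (∀ u v : ℝ, |u| ≤ Real.pi → |v| ≤ Real.pi → (ρ ≤ |u| ∨ ρ ≤ |v|) →
                  (Φ (φ₀ + u) (ψ₀ + v) - Φ φ₀ ψ₀).re ≤ -γ)) :
    ∃ ε₁ : ℝ, 0 < ε₁ ∧ ∃ M₀ : ℕ, ∀ M : ℕ, M₀ ≤ M →
      ∀ a b : ℕ, |(a : ℝ) - 7 / 16 * M| ≤ 1 → |(b : ℝ) - 7 / 16 * M| ≤ 1 →
        ∀ h : ℂ × ℂ → ℂ, AnalyticOnNhd ℂ h (fugAnnulus ×ˢ fugAnnulus) →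
          (∀ ζ ∈ fugAnnulus ×ˢ fugAnnulus, ‖h ζ‖ ≤ ε₁) →
          ∃ r₁ r₂ : ℝ, 2 / 3 < r₁ ∧ r₁ < 8 / 9 ∧ 2 / 3 < r₂ ∧ r₂ < 8 / 9 ∧
            torusCoeff (fun z w => (1 + z) ^ M * (1 + w) ^ M * cexp ((M : ℂ) * h (z, w))) r₁ r₂ a b ≠ 0 := by
  obtain ⟨ρ, s, S, K, γ, hρ, hs, hS, hK, hγ, hρπ, hB'⟩ := hB
  obtain ⟨τ₀, hτ₀, c, hc, M₀, hA'⟩ := hA ρ s S K hρ hs hS hK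
  obtain ⟨ε₁, hε₁, M₁, hB''⟩ := hB' τ₀ hτ₀
  obtain ⟨M₂, hM₂⟩ := eventually_mul_exp_neg_lt_div hγ hc (by positivity : (0 : ℝ) ≤ 8 * Real.pi ^ 2)
  refine ⟨ε₁, hε₁, max M₀ (max M₁ M₂), fun M hM a b ha hb h hha hhb => ?_⟩
  have hM₀ : M₀ ≤ M := le_trans (le_max_left _ _) hM
  have hM₁ : M₁ ≤ M := le_trans (le_trans (le_max_left _ _) (le_max_right _ _)) hM
  have hM₂' : M₂ ≤ M := le_trans (le_trans (le_max_right _ _) (le_max_right _ _)) hM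
  obtain ⟨r₁, r₂, hr₁, hr₁', hr₂, hr₂', φ₀, ψ₀, Φ, hΦc, hΦeq, hloc, hgap⟩ := hB'' M hM₁ a b ha hb h hha hhb
  refine ⟨r₁, r₂, hr₁, hr₁', hr₂, hr₂', ?_⟩
  -- the recentred, normalised exponent `G u v = Φ(φ₀+u, ψ₀+v) − Φ(φ₀, ψ₀)`
  obtain ⟨G, hG⟩ : ∃ G : ℝ → ℝ → ℂ, ∀ u v, G u v = Φ (φ₀ + u) (ψ₀ + v) - Φ φ₀ ψ₀ := ⟨_, fun _ _ => rfl⟩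
  have hGc : Continuous (Function.uncurry G) := by
    have e : Function.uncurry G = fun p : ℝ × ℝ => Φ (φ₀ + p.1) (ψ₀ + p.2) - Φ φ₀ ψ₀ :=
      funext fun p => hG p.1 p.2
    rw [e]
    exact (hΦc.comp (by fun_prop : Continuous fun p : ℝ × ℝ => (φ₀ + p.1, ψ₀ + p.2))).sub continuous_const
  -- K3a on the box
  have hbox : c / M ≤ (∫ u in (-ρ)..ρ, ∫ v in (-ρ)..ρ, cexp ((M : ℂ) * G u v)).re :=
    hA' M hM₀ G hGc (fun u v hu hv => by rw [hG]; exact hloc u v hu hv)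
  -- the gap off the box
  have hoff : ∀ u v : ℝ, |u| ≤ Real.pi → |v| ≤ Real.pi → (ρ ≤ |u| ∨ ρ ≤ |v|) →
      ‖cexp ((M : ℂ) * G u v)‖ ≤ Real.exp (-γ * M) := by
    intro u v hu hv huv
    rw [Complex.norm_exp, Real.exp_le_exp,
      show ((M : ℂ) * G u v).re = (M : ℝ) * (G u v).re by rw [← Complex.ofReal_natCast, Complex.re_ofReal_mul], hG]
    have := hgap u v hu hv huv
    have hM0 : (0 : ℝ) ≤ M := Nat.cast_nonneg M
    nlinarith
  have hne : (∫ u in (-Real.pi)..Real.pi, ∫ v in (-Real.pi)..Real.pi, cexp ((M : ℂ) * G u v)) ≠ 0 :=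
    sq_integral_ne_zero_of_box hρ hρπ (Real.exp_pos _).le _ (Complex.continuous_exp.comp (continuous_const.mul hGc))
      hbox hoff (by simpa [mul_comm] using hM₂ M hM₂')
  -- the coefficient integral is `(2π)⁻² e^{MΦ₀}` times that integral
  have hper1 : ∀ φ, Function.Periodic (fun ψ => cexp ((M : ℂ) * Φ φ ψ)) (2 * Real.pi) := by
    intro φ ψ
    show cexp ((M : ℂ) * Φ φ (ψ + 2 * Real.pi)) = cexp ((M : ℂ) * Φ φ ψ)
    rw [← hΦeq, ← hΦeq, cexp_add_two_pi_mul_I]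
  have hper2 : ∀ ψ, Function.Periodic (fun φ => cexp ((M : ℂ) * Φ φ ψ)) (2 * Real.pi) := by
    intro ψ φ
    show cexp ((M : ℂ) * Φ (φ + 2 * Real.pi) ψ) = cexp ((M : ℂ) * Φ φ ψ)
    rw [← hΦeq, ← hΦeq, cexp_add_two_pi_mul_I]
  have hfac : ∀ u v, cexp ((M : ℂ) * Φ (φ₀ + u) (ψ₀ + v)) = cexp ((M : ℂ) * Φ φ₀ ψ₀) * cexp ((M : ℂ) * G u v) := by
    intro u v
    rw [hG, ← Complex.exp_add]
    congr 1
    ring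
  unfold torusCoeff
  simp only [hΦeq]
  rw [sq_integral_periodic_recentre (fun φ ψ => cexp ((M : ℂ) * Φ φ ψ)) hper1 hper2 φ₀ ψ₀]
  simp only [hfac, intervalIntegral.integral_const_mul]
  refine mul_ne_zero (inv_ne_zero (pow_ne_zero _ ?_)) (mul_ne_zero (Complex.exp_ne_zero _) hne)
  exact mul_ne_zero two_ne_zero (Complex.ofReal_ne_zero.mpr Real.pi_ne_zero)

/-- **stub K3 — model-free two-variable large-powers saddle estimate with a small analytic perturbation (v8: DERIVED — PROVED from K3a
`stub_boxLowerBound` (proved) and K3b `stub_saddleGeometry` (proved, v9) by `largePowersSaddle2D_of`; statement unchanged).** There are `ε₁ > 0`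
and `M₀` such that for all `M ≥ M₀`, all `a, b` with `|a − 7M/16|, |b − 7M/16| ≤ 1` and every `h` analytic on the annulus² with
`‖h‖ ≤ ε₁`, the `(a,b)`-coefficient integral of `(1+z)^M (1+w)^M e^{M h(z,w)}` over SOME pair of circles `|z| = r₁`, `|w| = r₂` inside
the annulus `(2/3, 8/9)` (the prover's choice, e.g. through the complex saddle — v7, crit-1 s2: no contour-deformation lemma is owed,
every pair of radii being exact on the canonical side by K1) does not vanish.
Why plausibly true: put both circles through the complex critical point `|z*|, |w*| = 7/9·(1 + O(ε₁ + 1/M))` (IFT/Newton;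
`∂²_φ log(1+re^{iφ})|₀ = −r/(1+r)² = −63/256 ≠ 0`; Cauchy bounds `|∂h| ≤ 9ε₁`, `|∂²h| ≤ 162ε₁` at margin `1/9`); near it the
integral is Gaussian `≍ |e^{Φ*}|·2π/(Mσ²)` with an `O(ε₁)` complex perturbation of the quadratic form; on `|δ| ≥ ρ₀` the explicit gap
`log|1+ρe^{iφ}| − log(1+ρ) ≤ −c(ρ)φ²` beats `2ε₁ + O(1/M)`. DEPENDENCE CHAIN (crit-1 s3; the `∀ h`-after-`∀ M` order forces a FIXED
box): choose `ρ₀` (absolute), then `ε₁ = ε₁(ρ₀)`, then `M₀ = M₀(ρ₀, ε₁)`; downstream `η₀ = η₀(ε₁)` from K2 and `η = η₀/2` in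
`zeroFreeHot_of_stubs`. Size M–L (Flajolet–Sedgewick Thm VIII.8 is the one-variable positive case). [cite: FlajoletSedgewick2009,
Thm VIII.8 and Thm IX.8] -/
theorem stub_largePowersSaddle2D :
    ∃ ε₁ : ℝ, 0 < ε₁ ∧ ∃ M₀ : ℕ, ∀ M : ℕ, M₀ ≤ M →
      ∀ a b : ℕ, |(a : ℝ) - 7 / 16 * M| ≤ 1 → |(b : ℝ) - 7 / 16 * M| ≤ 1 →
        ∀ h : ℂ × ℂ → ℂ, AnalyticOnNhd ℂ h (fugAnnulus ×ˢ fugAnnulus) →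
          (∀ ζ ∈ fugAnnulus ×ˢ fugAnnulus, ‖h ζ‖ ≤ ε₁) →
          ∃ r₁ r₂ : ℝ, 2 / 3 < r₁ ∧ r₁ < 8 / 9 ∧ 2 / 3 < r₂ ∧ r₂ < 8 / 9 ∧
            torusCoeff (fun z w => (1 + z) ^ M * (1 + w) ^ M * cexp ((M : ℂ) * h (z, w))) r₁ r₂ a b ≠ 0 :=
  largePowersSaddle2D_of stub_boxLowerBound stub_saddleGeometry

/-- **Z_hot from K1–K3 (PROVED).** An `L`-uniform zero-free box around `β = 0` for the canonical twisted `(m,m)` sector at the anchor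
`(t′,U,n) = (0,8,7/8)`, for EVERY twist bound `θ₁`. -/
theorem zeroFreeHot_of_stubs
    (hK1 : ∀ (L : ℕ) [NeZero L] (tp U δ θ : ℝ) (β : ℂ) (r₁ r₂ : ℝ), 0 < r₁ → 0 < r₂ →
      thermalFluxZc L tp U δ θ β =
        torusCoeff (gcTwistZc2 L tp U θ β) r₁ r₂ (⌊(1 - δ) * (L : ℝ) ^ 2 / 2⌋₊) (⌊(1 - δ) * (L : ℝ) ^ 2 / 2⌋₊))
    (hK2 : ∀ tp U : ℝ, ∀ ε : ℝ, 0 < ε → ∃ η₀ : ℝ, 0 < η₀ ∧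
      ∀ (L : ℕ) [NeZero L], 3 ≤ L → ∀ θ : ℝ, ∀ β : ℂ, ‖β‖ ≤ η₀ →
        ∃ h : ℂ × ℂ → ℂ, AnalyticOnNhd ℂ h (fugAnnulus ×ˢ fugAnnulus) ∧
          (∀ ζ ∈ fugAnnulus ×ˢ fugAnnulus, ‖h ζ‖ ≤ ε) ∧
          ∀ ζ ∈ fugAnnulus ×ˢ fugAnnulus,
            gcTwistZc2 L tp U θ β ζ.1 ζ.2 =
              (1 + ζ.1) ^ (L ^ 2) * (1 + ζ.2) ^ (L ^ 2) * cexp ((L : ℂ) ^ 2 * h ζ))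
    (hK3 : ∃ ε₁ : ℝ, 0 < ε₁ ∧ ∃ M₀ : ℕ, ∀ M : ℕ, M₀ ≤ M →
      ∀ a b : ℕ, |(a : ℝ) - 7 / 16 * M| ≤ 1 → |(b : ℝ) - 7 / 16 * M| ≤ 1 →
        ∀ h : ℂ × ℂ → ℂ, AnalyticOnNhd ℂ h (fugAnnulus ×ˢ fugAnnulus) →
          (∀ ζ ∈ fugAnnulus ×ˢ fugAnnulus, ‖h ζ‖ ≤ ε₁) →
          ∃ r₁ r₂ : ℝ, 2 / 3 < r₁ ∧ r₁ < 8 / 9 ∧ 2 / 3 < r₂ ∧ r₂ < 8 / 9 ∧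
            torusCoeff (fun z w => (1 + z) ^ M * (1 + w) ^ M * cexp ((M : ℂ) * h (z, w))) r₁ r₂ a b ≠ 0) :
    ∃ η : ℝ, 0 < η ∧ ∀ θ₁ : ℝ, ZeroFreeHot 0 8 (7 / 8) η θ₁ := by
  obtain ⟨ε₁, hε₁, M₀, hM⟩ := hK3
  obtain ⟨η₀, hη₀, hGC⟩ := hK2 0 8 ε₁ hε₁
  refine ⟨η₀ / 2, by positivity, fun θ₁ => ⟨max 3 M₀, fun L _ hL θ _ β hre hre' him => ?_⟩⟩
  have hL3 : 3 ≤ L := le_trans (le_max_left _ _) hL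
  have hLM : M₀ ≤ L ^ 2 := le_trans (le_trans (le_max_right _ _) hL) (Nat.le_self_pow two_ne_zero L)
  -- `‖β‖ ≤ |Re β| + |Im β| < η₀`
  have hβ : ‖β‖ ≤ η₀ := by
    have h1 : ‖β‖ ≤ |β.re| + |β.im| := Complex.norm_le_abs_re_add_abs_im β
    have h2 : |β.re| < η₀ / 2 := abs_lt.2 ⟨by linarith, by linarith⟩
    linarith
  obtain ⟨h, hha, hhb, hheq⟩ := hGC L hL3 θ β hβ
  -- the sector label
  set m : ℕ := ⌊(1 - (1 - 7 / 8 : ℝ)) * (L : ℝ) ^ 2 / 2⌋₊ with hm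
  have hx : (1 - (1 - 7 / 8 : ℝ)) * (L : ℝ) ^ 2 / 2 = 7 / 16 * ((L ^ 2 : ℕ) : ℝ) := by push_cast; ring
  have hx0 : 0 ≤ 7 / 16 * ((L ^ 2 : ℕ) : ℝ) := by positivity
  have hmc : |(m : ℝ) - 7 / 16 * ((L ^ 2 : ℕ) : ℝ)| ≤ 1 := by
    rw [hm, hx]
    have h1 := Nat.floor_le hx0
    have h2 := Nat.lt_floor_add_one (7 / 16 * ((L ^ 2 : ℕ) : ℝ))
    rw [abs_le]; constructor <;> linarith
  -- K3: radii through the complex saddle, and non-vanishing of the perturbed large-power coefficient there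
  obtain ⟨r₁, r₂, hr₁, hr₁', hr₂, hr₂', hne⟩ := hM (L ^ 2) hLM m m hmc hmc h hha hhb
  -- K1: canonical = coefficient of the grand-canonical trace on exactly those circles (every pair of radii is exact)
  rw [hK1 L 0 8 (1 - 7 / 8) θ β r₁ r₂ (by linarith) (by linarith)]
  -- K2: on the circles the GC trace is the perturbed large power
  rw [torusCoeff_congr (G := fun z w => (1 + z) ^ (L ^ 2) * (1 + w) ^ (L ^ 2) * cexp (((L ^ 2 : ℕ) : ℂ) * h (z, w))) m m
    (fun φ ψ => by
      have hmem : ((r₁ : ℂ) * cexp ((φ : ℂ) * I), (r₂ : ℂ) * cexp ((ψ : ℂ) * I)) ∈ fugAnnulus ×ˢ fugAnnulus :=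
        Set.mk_mem_prod (mem_fugAnnulus_of_radius hr₁ hr₁' φ) (mem_fugAnnulus_of_radius hr₂ hr₂' ψ)
      have := hheq _ hmem
      simp only at this
      rw [this]; push_cast; ring_nf)]
  exact hne

/-- Hypothesis Z from the v5 stub set {K1, K2, K3, Z_cold} (PROVED glue: `zeroFreeHot_of_stubs` + `stub_zeroFreeStrip_of_hot_cold`). -/
theorem zeroFreeStrip_of_stubs5
    (hK1 : ∀ (L : ℕ) [NeZero L] (tp U δ θ : ℝ) (β : ℂ) (r₁ r₂ : ℝ), 0 < r₁ → 0 < r₂ →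
      thermalFluxZc L tp U δ θ β =
        torusCoeff (gcTwistZc2 L tp U θ β) r₁ r₂ (⌊(1 - δ) * (L : ℝ) ^ 2 / 2⌋₊) (⌊(1 - δ) * (L : ℝ) ^ 2 / 2⌋₊))
    (hK2 : ∀ tp U : ℝ, ∀ ε : ℝ, 0 < ε → ∃ η₀ : ℝ, 0 < η₀ ∧
      ∀ (L : ℕ) [NeZero L], 3 ≤ L → ∀ θ : ℝ, ∀ β : ℂ, ‖β‖ ≤ η₀ →
        ∃ h : ℂ × ℂ → ℂ, AnalyticOnNhd ℂ h (fugAnnulus ×ˢ fugAnnulus) ∧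
          (∀ ζ ∈ fugAnnulus ×ˢ fugAnnulus, ‖h ζ‖ ≤ ε) ∧
          ∀ ζ ∈ fugAnnulus ×ˢ fugAnnulus,
            gcTwistZc2 L tp U θ β ζ.1 ζ.2 =
              (1 + ζ.1) ^ (L ^ 2) * (1 + ζ.2) ^ (L ^ 2) * cexp ((L : ℂ) ^ 2 * h ζ))
    (hK3 : ∃ ε₁ : ℝ, 0 < ε₁ ∧ ∃ M₀ : ℕ, ∀ M : ℕ, M₀ ≤ M →
      ∀ a b : ℕ, |(a : ℝ) - 7 / 16 * M| ≤ 1 → |(b : ℝ) - 7 / 16 * M| ≤ 1 →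
        ∀ h : ℂ × ℂ → ℂ, AnalyticOnNhd ℂ h (fugAnnulus ×ˢ fugAnnulus) →
          (∀ ζ ∈ fugAnnulus ×ˢ fugAnnulus, ‖h ζ‖ ≤ ε₁) →
          ∃ r₁ r₂ : ℝ, 2 / 3 < r₁ ∧ r₁ < 8 / 9 ∧ 2 / 3 < r₂ ∧ r₂ < 8 / 9 ∧
            torusCoeff (fun z w => (1 + z) ^ M * (1 + w) ^ M * cexp ((M : ℂ) * h (z, w))) r₁ r₂ a b ≠ 0)
    (hcold : ∃ η₀ θ₁ : ℝ, 0 < η₀ ∧ 0 < θ₁ ∧ ∀ η : ℝ, 0 < η → η ≤ η₀ → ZeroFreeCold 0 8 (7 / 8) 10 η θ₁) :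
    ∃ η θ₁ : ℝ, 0 < η ∧ 0 < θ₁ ∧ ZeroFreeStrip 0 8 (7 / 8) 10 η θ₁ := by
  obtain ⟨η, hη, hhot⟩ := zeroFreeHot_of_stubs hK1 hK2 hK3
  exact stub_zeroFreeStrip_of_hot_cold ⟨η, 1, hη, one_pos, hhot 1⟩ hcold

/-- **THE v5 COMPOSITION (kernel-checked, no sorry): corridor transfer → a-priori data → K1 → K2 → K3 → Z_cold → K1-crux BY NAME.** -/
theorem ThermalStiffnessCeilingU8b10_le_1o8_of5
    (hT : ∀ (η b : ℝ), 0 < η → 0 < b →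
      ∃ C r : ℝ, 0 < C ∧ 0 ≤ r ∧ r < 1 ∧
        ∀ (L : ℕ) (M : ℝ) (f g : ℂ → ℂ), 0 ≤ M → CorridorData η b M f → CorridorData η b M g →
          (∀ k : ℕ, k < L → iteratedDeriv k f 0 = iteratedDeriv k g 0) →
          |Real.log (f b).re - Real.log (g b).re| ≤ C * (M + 1) * r ^ L)
    (hD : ∀ (tp U n b η θ₁ : ℝ), 0 < η → 0 < b → ZeroFreeStrip tp U n b η θ₁ →
      ∃ A : ℝ, 0 ≤ A ∧ ∃ L₀ : ℕ, ∀ (L : ℕ) [NeZero L], L₀ ≤ L → ∀ θ : ℝ, |θ| ≤ θ₁ →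
        CorridorData η b (A * (L : ℝ) ^ 2) (thermalFluxZc L tp U (1 - n) θ))
    (hK1 : ∀ (L : ℕ) [NeZero L] (tp U δ θ : ℝ) (β : ℂ) (r₁ r₂ : ℝ), 0 < r₁ → 0 < r₂ →
      thermalFluxZc L tp U δ θ β =
        torusCoeff (gcTwistZc2 L tp U θ β) r₁ r₂ (⌊(1 - δ) * (L : ℝ) ^ 2 / 2⌋₊) (⌊(1 - δ) * (L : ℝ) ^ 2 / 2⌋₊))
    (hK2 : ∀ tp U : ℝ, ∀ ε : ℝ, 0 < ε → ∃ η₀ : ℝ, 0 < η₀ ∧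
      ∀ (L : ℕ) [NeZero L], 3 ≤ L → ∀ θ : ℝ, ∀ β : ℂ, ‖β‖ ≤ η₀ →
        ∃ h : ℂ × ℂ → ℂ, AnalyticOnNhd ℂ h (fugAnnulus ×ˢ fugAnnulus) ∧
          (∀ ζ ∈ fugAnnulus ×ˢ fugAnnulus, ‖h ζ‖ ≤ ε) ∧
          ∀ ζ ∈ fugAnnulus ×ˢ fugAnnulus,
            gcTwistZc2 L tp U θ β ζ.1 ζ.2 =
              (1 + ζ.1) ^ (L ^ 2) * (1 + ζ.2) ^ (L ^ 2) * cexp ((L : ℂ) ^ 2 * h ζ))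
    (hK3 : ∃ ε₁ : ℝ, 0 < ε₁ ∧ ∃ M₀ : ℕ, ∀ M : ℕ, M₀ ≤ M →
      ∀ a b : ℕ, |(a : ℝ) - 7 / 16 * M| ≤ 1 → |(b : ℝ) - 7 / 16 * M| ≤ 1 →
        ∀ h : ℂ × ℂ → ℂ, AnalyticOnNhd ℂ h (fugAnnulus ×ˢ fugAnnulus) →
          (∀ ζ ∈ fugAnnulus ×ˢ fugAnnulus, ‖h ζ‖ ≤ ε₁) →
          ∃ r₁ r₂ : ℝ, 2 / 3 < r₁ ∧ r₁ < 8 / 9 ∧ 2 / 3 < r₂ ∧ r₂ < 8 / 9 ∧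
            torusCoeff (fun z w => (1 + z) ^ M * (1 + w) ^ M * cexp ((M : ℂ) * h (z, w))) r₁ r₂ a b ≠ 0)
    (hcold : ∃ η₀ θ₁ : ℝ, 0 < η₀ ∧ 0 < θ₁ ∧ ∀ η : ℝ, 0 < η → η ≤ η₀ → ZeroFreeCold 0 8 (7 / 8) 10 η θ₁) :
    K1Crux :=
  ThermalStiffnessCeilingU8b10_le_1o8_of hT hD (zeroFreeStrip_of_stubs5 hK1 hK2 hK3 hcold)

/-! ### §N (v10, g10 — BN-resc-11) THE β₁-FAMILY: with the hot end a theorem, cold-side zero-freeness at ANY anchor gives the leaf there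

With K1, K2, K3 proved, `Z_hot` holds outright (`zeroFreeHot_of_stubs` applied to three sorry-free theorems). Hence for EVERY anchor
`β₁ > 0`: the small-width family `∀ η ≤ η₀, Z_cold(t′=0, U=8, n=7/8; β₁, η, θ₁)` ALONE yields the zero-free strip around `[0, β₁]`
(`zeroFreeStrip_of_hot_cold` at `η = min η_hot η`), twist-insensitivity at `β₁` (corridor transfer + a-priori data, both proved), and the
thermal stiffness leaf at `β₁` for every ceiling `c ≥ 0` (socket §F). At `(β₁, c) = (10, 1/8)` this is `…_of_stubs`; for a re-anchored
leaf `β₁·t < β_c·t` (census r11: the printed `T_c ≈ t/10` of the stripe transition at `U = 8`, `δ = 1/8`, `t′ = 0` puts `β₁ = 10` at the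
edge) it is the statement such a leaf would consume. Not a registered stub; no statement of the registered set changed. -/

/-- **The β₁-family socket (PROVED).** For every `β₁ > 0` and `c ≥ 0`: cold-side zero-freeness of the twisted canonical sector partition
function near `[η, β₁]` for all small widths `η` implies `ObsThermalStiffnessSeqCeilingAtBeta 0 8 (7/8) β₁ c`. -/
theorem leafAtBeta_of_zeroFreeCold {β₁ : ℝ} (hβ₁ : 0 < β₁) {c : ℚ} (hc : 0 ≤ c)
    (hcold : ∃ η₀ θ₁ : ℝ, 0 < η₀ ∧ 0 < θ₁ ∧ ∀ η : ℝ, 0 < η → η ≤ η₀ → ZeroFreeCold 0 8 (7 / 8) β₁ η θ₁) :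
    Summit.Ventures.CertifiedManyBodySolver.Observables.ObsThermalStiffnessSeqCeilingAtBeta 0 8 (7 / 8) β₁ c := by
  obtain ⟨η₁, hη₁, hhot⟩ := zeroFreeHot_of_stubs stub_fugacityProjection stub_gcHighTempAnalytic stub_largePowersSaddle2D
  obtain ⟨η₀, θ₁, hη₀, hθ₁, hcold⟩ := hcold
  have hη : 0 < min η₁ η₀ := lt_min hη₁ hη₀
  have hZ : ZeroFreeStrip 0 8 (7 / 8) β₁ (min η₁ η₀) θ₁ :=
    zeroFreeStrip_of_hot_cold ((hhot θ₁).mono (min_le_left _ _) le_rfl) (hcold (min η₁ η₀) hη (min_le_right _ _))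
  exact leafAtBeta_of_twistInsensitiveAt hβ₁ hc
    (twistInsensitiveAt_of_zeroFreeStrip stub_corridorTransfer stub_corridorData hη hβ₁ hθ₁ hZ)

/-- Monotonicity of the cold region in the anchor: zero-freeness near `[η, β₁]` implies it near `[η, β₁']` for `β₁' ≤ β₁`. -/
theorem ZeroFreeCold.mono_beta {tp U n β₁ β₁' η θ₁ : ℝ} (h : ZeroFreeCold tp U n β₁ η θ₁) (hβ : β₁' ≤ β₁) :
    ZeroFreeCold tp U n β₁' η θ₁ := by
  obtain ⟨L₀, h⟩ := h
  exact ⟨L₀, fun L _ hL θ hθ β hre hre' him => h L hL θ hθ β hre (by linarith) him⟩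

/-- Hence the small-width cold family is monotone in the anchor, `β₁' ≤ β₁`. -/
theorem zeroFreeCold_family_mono {tp U n β₁ β₁' : ℝ} (hβ : β₁' ≤ β₁)
    (h : ∃ η₀ θ₁ : ℝ, 0 < η₀ ∧ 0 < θ₁ ∧ ∀ η : ℝ, 0 < η → η ≤ η₀ → ZeroFreeCold tp U n β₁ η θ₁) :
    ∃ η₀ θ₁ : ℝ, 0 < η₀ ∧ 0 < θ₁ ∧ ∀ η : ℝ, 0 < η → η ≤ η₀ → ZeroFreeCold tp U n β₁' η θ₁ := by
  obtain ⟨η₀, θ₁, hη₀, hθ₁, h⟩ := h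
  exact ⟨η₀, θ₁, hη₀, hθ₁, fun η hη hle => (h η hη hle).mono_beta hβ⟩

/-- **K1′ BY NAME from `Z_cold(8)`** (director-hubbard I2165 ∕ FL-RULING 89 (a); the split child `stmt-Ventures-24560` of K1, route rev 1,
minted by hub-tc-therm-plan-1 g2, `Cruxes/ThermalStiffnessCeilingU8b10_le_1o8/SPLIT-K1-b8.md`): the small-width cold-side zero-freeness family at
the RE-ANCHORED inverse temperature `β₁·t = 8` (strictly weaker than `stub_zeroFreeCold`, which is the `β₁·t = 10` family — `zeroFreeCold_family_mono`)
gives the β·t = 8 thermal stiffness leaf at level `7/44`, stated here as the BODY `ObsThermalStiffnessSeqCeilingAtBeta 0 8 (7/8) 8 (7/44)` of the route decl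
`TcThermcert1.ThermalStiffnessCeilingU8b8_le_7o44` (definitionally equal; in this K1′ skeleton file the BY-NAME conclusion is reserved to the skeleton theorem
`ThermalStiffnessCeilingU8b8_le_7o44_of_stubs8` below, so that the A12 audit takes it — the first by-name theorem — as the skeleton; in the parent line v10 this
theorem concludes the decl by name). The `X_of : stub → crux` shape of the K1′ skeleton. -/
theorem ThermalStiffnessCeilingU8b8_le_7o44_of_zeroFreeCold8
    (hcold8 : ∃ η₀ θ₁ : ℝ, 0 < η₀ ∧ 0 < θ₁ ∧ ∀ η : ℝ, 0 < η → η ≤ η₀ → ZeroFreeCold 0 8 (7 / 8) 8 η θ₁) :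
    Summit.Ventures.CertifiedManyBodySolver.Observables.ObsThermalStiffnessSeqCeilingAtBeta 0 8 (7 / 8) 8 (7 / 44) :=
  leafAtBeta_of_zeroFreeCold (by norm_num) (by norm_num) hcold8

/-- **stub Z_cold(8) — THE BET of the K1′ skeleton** (the `β₁·t = 8` RE-ANCHOR of `stub_zeroFreeCold`; strictly weaker: the β₁·t = 10 family
implies it by `zeroFreeCold_family_mono`). For all small widths `η ≤ η₀`: no zero of the twisted canonical `(m,m)`-sector partition function within `η`
of the temperature segment `[η, 8]`, `L`-uniformly, for `|θ| ≤ θ₁` — no thermodynamic singularity of ANY kind on `T ≥ t/8` in the twisted canonical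
family at `(t′,U,n) = (0,8,7/8)`. Print: β·t = 8 lies on the charge-DISORDERED side of the CP-AFQMC stripe onset `T_c ∼ t/10` (XiaoEtAl2023 =
arXiv:2202.11741 p.10, App. C p.14; BN-resc-11) — a flag on the β·t = 10 version, not on this one. Refutable by a certified zero for a cofinal set of `L`.
[cite: LeeYang1952; FisherZeros1965; XiaoEtAl2023] -/
theorem stub_zeroFreeCold8 :
    ∃ η₀ θ₁ : ℝ, 0 < η₀ ∧ 0 < θ₁ ∧ ∀ η : ℝ, 0 < η → η ≤ η₀ → ZeroFreeCold 0 8 (7 / 8) 8 η θ₁ := by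
  sorry

/-- **THE SKELETON THEOREM of the K1′ line: the split child `TcThermcert1.ThermalStiffnessCeilingU8b8_le_7o44` (stmt-Ventures-24560) BY NAME from the
declared stubs** — K1 `stub_fugacityProjection`, K2 `stub_gcHighTempAnalytic`, K3 `stub_largePowersSaddle2D`, transfer, data (all PROVED) and the one
sorried stub `stub_zeroFreeCold8`; the only theorem of this file whose conclusion is a route decl. -/
theorem ThermalStiffnessCeilingU8b8_le_7o44_of_stubs8 :
    Summit.Ventures.CertifiedManyBodySolver.Theses.TcThermcert1.ThermalStiffnessCeilingU8b8_le_7o44 :=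
  ThermalStiffnessCeilingU8b8_le_7o44_of_zeroFreeCold8 stub_zeroFreeCold8

end HotEnd

end Summit.Ventures.CertifiedManyBodySolver.Cruxes.ThermalStiffnessCeilingU8b10_le_1o8.ZerofreeCorridor
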